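import Summits.Parity.GeneralizedHardyLittlewood.Theses.FordMaynardSieveConst01651
import Summits.Parity.GeneralizedHardyLittlewood.Theorems.FordMaynardSieveConst01651SieveConst01651StubHkPieces
import Summits.Parity.GeneralizedHardyLittlewood.Theorems.FordMaynardSieveConst01651SieveConst01651FiveGeneric
import Summits.Parity.GeneralizedHardyLittlewood.Theorems.FordMaynardSieveConst01651SieveConst01651CertValue
import Literature.Barriers.Parity.FriedlanderGranvilleUniformityTools
import Literature.NumberTheory.Sieve.FordMaynardTypeIBound
import HarnessLib

/-!
# Line `sieve_decomposition` — target `SieveConst01651` (r0) of route `FordMaynardSieveConst01651` (stmt-Parity-19185)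
Ford–Maynard Thm 7.3 (a) at `P = (1/2,0,ν)` with CLOSED support, cut along arXiv:2407.14368 §7.2/§6.2 (seat
`linewriter-parity-smallroutes-1`: g0 v1–v20, g1 v21).  Narrative, trail, per-stub playbooks: `Lines/sieve_decomposition.md`.
v21 (21-frontier ruling 2026-08-31T19:36:58Z, path (b)): `SieveConst01651` ⇐ `stub_signClauseFive` (R1, FINITE: dim-5 generic
sign clause of the landed witness `coneCert`, couple form = `hgen` of `…FiveGeneric.stub_coneCertClosed_of_generic_five`; ONE
`--computational` checker) + `stub_certValuePos` (R2, OPEN: `0 < sieveBoundG1 (1651/10000) coneCert`; kernel form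
`…CertValue.coneCert_value_pos_iff`; no external Arb value) + `stub_typeIIRegion` (FM Prop 7.19, RE-TYPED with `w n ≥ −x^{ν/10}`).
`hfun Admissible pvec roughPart smoothPart Gwt Hwt window IsRough Nset Rset` are now the tree's `…SieveConst01651Defs` (verbatim
v20 bodies): v20's `stub_hkPieces` := landed `…StubHkPieces.stub_hkPieces` (p828729); v20's `stub_coneCertClosed` := `coneCertClosed_of`.
-/

noncomputable section

open Finset
open Literature.NumberTheory.Sieve Literature.NumberTheory.Sieve.FordMaynard Literature.Barriers.Parity.FordMaynard
open Summit.Parity.GeneralizedHardyLittlewood.FordMaynardSieveConst01651SieveConst01651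
  (hfun Admissible hfun_apply hfun_of_ne pvec roughPart smoothPart Gwt Hwt window IsRough Nset Rset mem_window mem_Nset mem_Rset
   coneCert openSmall stub_hkPieces stub_coneCertClosed_of_residues' coneCert_signClause_five_of_generic)

namespace Summit.Parity.GeneralizedHardyLittlewood.Cruxes.SieveConst01651.SieveDecomposition

def IsExc (n : ℕ) : Prop :=
  (∃ p ∈ n.primeFactors, p ^ 2 ∣ n ∧ (p : ℝ) ≤ (n : ℝ) ^ (1 / 4 : ℝ)) ∨ ∃ p ∈ n.primeFactors, n = p ^ 2

def Eset (ν x : ℝ) : Finset ℕ := by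
  classical exact (Nset ν x).filter IsExc

def SFset (ν x : ℝ) : Finset ℕ := by
  classical exact (Nset ν x).filter Squarefree

def NSFset (ν x : ℝ) : Finset ℕ := by
  classical exact (Nset ν x).filter (fun n => ¬ Squarefree n)

def SFkset (ν x : ℝ) (k : ℕ) : Finset ℕ := by
  classical exact (SFset ν x).filter (fun n => n.primeFactorsList.length = k)

open scoped Classical in

def sliceTest (ν : ℝ) (g : VecFn) (k : ℕ) : (Fin k → ℝ) → ℝ :=
  fun x => if (∀ i, ν < x i ∧ x i < 1 - ν) ∧ Monotone x then starSum g k x / ∏ i, x i else 0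

def mainG1 (ν : ℝ) (g : VecFn) (k : ℕ) (x : ℝ) : (Fin k → ℝ) → ℝ :=
  mainG (hfun ν g k) (1 : ℕ).primeFactors.card k (uvec x 1) (Real.log (x / (2 * ((1 : ℕ) : ℝ))) / Real.log x)
    (Real.log ((⌊x⌋₊ : ℕ) : ℝ) / Real.log x)

def vk (k n : ℕ) : Fin k → ℝ := fun i => Real.log (n.primeFactorsList.getD i 0) / Real.log n

/-- Stub 0 (ccert, XL): the closed-support cone-data certificate at … -/
def Signature.stub_coneCertClosed : Prop :=
  ∃ g₀ : VecFn, IsPiecewiseConstOnCone g₀ ∧ (∀ e : Fin 0 → ℝ, g₀ 0 e = 1) ∧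
    (∀ (k : ℕ) (x : Fin k → ℝ), Monotone x → g₀ k x ≠ 0 →
      k = 0 ∨ ((∀ i, (1651 / 10000 : ℝ) < x i) ∧ ∑ i, x i ≤ 1 / 2)) ∧
    (∀ k : ℕ, 2 ≤ k → k ≤ 6 → ∀ x : Fin k → ℝ, Monotone x →
      (∀ i, (1651 / 10000 : ℝ) < x i ∧ x i < 1 - 1651 / 10000) → ∑ i, x i = 1 →
        starSum g₀ k x ≤ 0) ∧
    0 < sieveBoundG1 (1651 / 10000) g₀

/-- FM Lemma 7.18 (c) REPAIRED (sign on `𝒩 ∖ ℰ`), on the divisor lattice … -/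
def Signature.signLemma : Prop :=
  ∀ ν : ℝ, 0 < ν → ν < 1 / 4 → ∀ g : VecFn, Admissible ν g →
    ∀ n : ℕ, 2 ≤ n → ¬ n.Prime → IsRough ν n → ¬ IsExc n →
      ∑ d ∈ n.divisors, g d.primeFactorsList.length (pvec n d) ≤ 0

/-- Stub 1a (M, tree instantiation; v15 — replaces v14's … -/
def Signature.tupleSumIntegral : Prop :=
  ∀ ν : ℝ, 0 < ν → ν < 1 / 4 → ∀ g : VecFn, Admissible ν g →
    ∀ k : ℕ, 2 ≤ k → k ≤ ⌊1 / ν⌋₊ →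
      ∀ ε : ℝ, 0 < ε → ∃ x₀ : ℝ, ∀ x : ℝ, x₀ ≤ x →
        |primeTupleSum k x (mainG1 ν g k x) - primeTupleIntegral k x (mainG1 ν g k x)| ≤ ε * x / Real.log x

/-- Former stub (PROVED here; see the card). -/
def Signature.injSumIntegral : Prop :=
  ∀ ν : ℝ, 0 < ν → ν < 1 / 4 → ∀ g : VecFn, Admissible ν g →
    ∀ k : ℕ, 2 ≤ k → k ≤ ⌊1 / ν⌋₊ →
      ∀ ε : ℝ, 0 < ε → ∃ x₀ : ℝ, ∀ x : ℝ, x₀ ≤ x →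
        |injSum (hfun ν g k) x 1 ⌊x⌋₊ k - primeTupleIntegral k x (mainG1 ν g k x)| ≤ ε * x / Real.log x

/-- Former stub (PROVED here; see the card). -/
def Signature.VsumIntegral : Prop :=
  ∀ ν : ℝ, 0 < ν → ν < 1 / 4 → ∀ g : VecFn, Admissible ν g →
    ∀ k : ℕ, 2 ≤ k → k ≤ ⌊1 / ν⌋₊ →
      ∀ ε : ℝ, 0 < ε → ∃ x₀ : ℝ, ∀ x : ℝ, x₀ ≤ x →
        |Vsum (hfun ν g k) x 1 ⌊x⌋₊
            - (1 / (k.factorial : ℝ)) * primeTupleIntegral k x (mainG1 ν g k x)| ≤ ε * x / Real.log x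

/-- Former stub (PROVED here; see the card). -/
def Signature.sliceSymm : Prop :=
  ∀ ν : ℝ, 0 < ν → ν < 1 / 4 → ∀ g : VecFn, Admissible ν g →
    ∀ k : ℕ, 2 ≤ k → k ≤ ⌊1 / ν⌋₊ → ∀ x : ℝ,
      typeITerm (hfun ν g k) (1 : ℕ).primeFactors.card (uvec x 1) k = sliceIntegral k 1 (sliceTest ν g k)

open scoped Classical in

def Phi (ν : ℝ) (g : VecFn) (k : ℕ) : (Fin k → ℝ) → ℝ :=
  fun u => (if ∀ i, ν < u i then starSum g k u else 0) / ∏ i, u i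

open scoped Classical in
/-- Former stub (PROVED here; see the card). -/
def Signature.chamberSymm : Prop :=
  ∀ (k : ℕ) (w M : ℝ) (Φ : (Fin k → ℝ) → ℝ), Measurable Φ → (∀ u, |Φ u| ≤ M) →
    (∀ (σ : Equiv.Perm (Fin k)) (u : Fin k → ℝ), Φ (u ∘ σ) = Φ u) →
      sliceIntegral k w Φ = (k.factorial : ℝ) * sliceIntegral k w (fun u => if Monotone u then Φ u else 0)

/-- Former stub (PROVED here; see the card). -/
def Signature.windowPNT : Prop :=
  ∀ ε : ℝ, 0 < ε → ∃ x₀ : ℝ, ∀ x : ℝ, x₀ ≤ x →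
    |(∫ w in Set.Ioc (Real.log (x / (2 * ((1 : ℕ) : ℝ))) / Real.log x) (Real.log ((⌊x⌋₊ : ℕ) : ℝ) / Real.log x), x ^ w / w)
        - ((windowPrimes x).card : ℝ)| ≤ ε * x / Real.log x

/-- Former stub (PROVED here; see the card). -/
def Signature.integralMainTerm : Prop :=
  ∀ ν : ℝ, 0 < ν → ν < 1 / 4 → ∀ g : VecFn, Admissible ν g →
    ∀ k : ℕ, 2 ≤ k → k ≤ ⌊1 / ν⌋₊ →
      ∀ ε : ℝ, 0 < ε → ∃ x₀ : ℝ, ∀ x : ℝ, x₀ ≤ x →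
        |(1 / (k.factorial : ℝ)) * primeTupleIntegral k x (mainG1 ν g k x)
            - sliceIntegral k 1 (sliceTest ν g k) * ((windowPrimes x).card : ℝ)| ≤ ε * x / Real.log x

/-- Former stub (PROVED here; see the card). -/
def Signature.VsumMainTerm : Prop :=
  ∀ ν : ℝ, 0 < ν → ν < 1 / 4 → ∀ g : VecFn, Admissible ν g →
    ∀ k : ℕ, 2 ≤ k → k ≤ ⌊1 / ν⌋₊ →
      ∀ ε : ℝ, 0 < ε → ∃ x₀ : ℝ, ∀ x : ℝ, x₀ ≤ x →
        |Vsum (hfun ν g k) x 1 ⌊x⌋₊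
            - sliceIntegral k 1 (sliceTest ν g k) * ((windowPrimes x).card : ℝ)| ≤ ε * x / Real.log x

/-- Former stub (PROVED here; see the card). -/
def Signature.sliceMainTerm : Prop :=
  ∀ ν : ℝ, 0 < ν → ν < 1 / 4 → ∀ g : VecFn, Admissible ν g →
    ∀ k : ℕ, 2 ≤ k → k ≤ ⌊1 / ν⌋₊ →
      ∀ ε : ℝ, 0 < ε → ∃ x₀ : ℝ, ∀ x : ℝ, x₀ ≤ x →
        |∑ n ∈ SFkset ν x k, starSum g k (vk k n)
            - sliceIntegral k 1 (sliceTest ν g k) * ((windowPrimes x).card : ℝ)| ≤ ε * x / Real.log x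

/-- Former stub (PROVED here; see the card). -/
def Signature.sqfreeMainTerm : Prop :=
  ∀ ν : ℝ, 0 < ν → ν < 1 / 4 → ∀ g : VecFn, Admissible ν g →
    ∀ ε : ℝ, 0 < ε → ∃ x₀ : ℝ, ∀ x : ℝ, x₀ ≤ x →
      |∑ n ∈ SFset ν x, starSum g n.primeFactorsList.length (pvec n n)
          - (sieveBoundG1 ν g - 1) * ((windowPrimes x).card : ℝ)| ≤ ε * x / Real.log x

/-- Former stub (PROVED here; see the card). -/
def Signature.mainTerm : Prop :=
  ∀ ν : ℝ, 0 < ν → ν < 1 / 4 → ∀ g : VecFn, Admissible ν g →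
    ∀ ε : ℝ, 0 < ε → ∃ x₀ : ℝ, ∀ x : ℝ, x₀ ≤ x →
      |∑ n ∈ Nset ν x, Hwt g ν n - (sieveBoundG1 ν g - 1) * ((windowPrimes x).card : ℝ)|
        ≤ ε * x / Real.log x

/-- Former stub (PROVED here; see the card). -/
def Signature.weightJumps : Prop :=
  ∀ ν : ℝ, 0 < ν → ν < 1 / 4 → ∀ g : VecFn, Admissible ν g →
    ∃ C : ℝ, ∀ m : ℕ, 1 ≤ m → ∀ N : ℕ,
      (((Ico 1 N).filter (fun k : ℕ => Gwt g ν (m * (k + 1)) m ≠ Gwt g ν (m * k) m)).card : ℝ)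
        ≤ C * (m.divisors.card : ℝ)

/-- Former stub (PROVED here; see the card). -/
def Signature.typeITerm : Prop :=
  ∀ ν : ℝ, 0 < ν → ν < 1 / 4 → ∀ g : VecFn, Admissible ν g →
    ∃ K : ℝ, ∀ x : ℝ, 2 ≤ x → ∀ B : ℝ, 1 ≤ B → ∀ w : ℕ → ℝ, TypeI w x (1 / 2) B →
      |∑ n ∈ window x, w n * Hwt g ν n| ≤ K * x / Real.log x ^ B

/-- Stub 3 (XL print): FM Proposition 7.19 at `P = (1/2, 0, ν)` — v21 RE-TYPED with both halves of (w). -/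
def Signature.stub_typeIIRegion : Prop :=
  ∀ ν : ℝ, 0 < ν → ν < 1 / 4 → ∀ g : VecFn, Admissible ν g →
    ∀ A : ℝ, 1 ≤ A → ∀ ϖ : ℝ, 1 ≤ ϖ → ∃ B₀ : ℝ, ∀ B : ℝ, B₀ ≤ B → ∃ K x₀ : ℝ, ∀ x : ℝ, x₀ ≤ x →
      ∀ w : ℕ → ℝ, (∀ n : ℕ, -(x ^ (ν / 10)) ≤ w n) → GrowthBound w x ϖ → TypeI w x (1 / 2) B → TypeII w x 0 ν B →
        |∑ n ∈ Rset ν x, w n * Hwt g ν n| ≤ K * x / Real.log x ^ A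

/-- Stub R1 (v21, FINITE): dim-5 generic sign clause of `coneCert`, couple form (= `hgen` of `stub_coneCertClosed_of_generic_five`). -/
def Signature.stub_signClauseFive : Prop :=
  ∀ x : Fin 5 → ℝ, Monotone x → (∀ i, (1651 / 10000 : ℝ) < x i ∧ x i < 1 - 1651 / 10000) →
    ∑ i, x i = 1 → (∀ i, x i ∈ openSmall) →
    (∀ i j, i < j → x i + x j ≠ 8349 / 20000 ∧ x i + x j ≠ 1 / 2) →
    -4 + ∑ A ∈ (Finset.univ : Finset (Finset (Fin 5))).filter (fun A => A.card = 2),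
      (coneCert A.card (fun i => x (A.orderEmbOfFin rfl i)) +
        coneCert Aᶜ.card (fun i => x (Aᶜ.orderEmbOfFin rfl i))) ≤ 0

/-- Stub R2 (v21, OPEN): the certificate value of `coneCert` is positive (kernel form: `coneCert_value_pos_iff`). -/
def Signature.stub_certValuePos : Prop :=
  0 < sieveBoundG1 (1651 / 10000) coneCert

/-- The squarefull patch (no longer a stub: PROVED below as `squarefull_patch`). -/
def Signature.squarefullPatch : Prop :=
  ∀ ν : ℝ, 0 < ν → ν < 1 / 4 → ∀ x : ℝ, 2 ≤ x → ∀ B : ℝ, 0 < B → ∀ a : ℕ → ℝ, (∀ n, 0 ≤ a n) →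
    TypeI (fun n => a n - 1) x (1 / 2) B →
      ∑ n ∈ Eset ν x, a n ≤ 4 * x ^ (1 - ν) + 2 * Real.sqrt x + 2 + 2 * x / Real.log x ^ B

/-- **Open stub R1** (v21; FINITE — ONE `--computational` `native_decide` checker with its soundness lemma). -/
theorem stub_signClauseFive :
    ∀ x : Fin 5 → ℝ, Monotone x → (∀ i, (1651 / 10000 : ℝ) < x i ∧ x i < 1 - 1651 / 10000) →
      ∑ i, x i = 1 → (∀ i, x i ∈ openSmall) →
      (∀ i j, i < j → x i + x j ≠ 8349 / 20000 ∧ x i + x j ≠ 1 / 2) →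
      -4 + ∑ A ∈ (Finset.univ : Finset (Finset (Fin 5))).filter (fun A => A.card = 2),
        (coneCert A.card (fun i => x (A.orderEmbOfFin rfl i)) +
          coneCert Aᶜ.card (fun i => x (Aᶜ.orderEmbOfFin rfl i))) ≤ 0 := by
  sorry

/-- **Open stub R2** (v21; OPEN — certificate value; no external Arb value admitted). -/
theorem stub_certValuePos : 0 < sieveBoundG1 (1651 / 10000) coneCert := by
  sorry

/-- **Open stub 3** (XL, print; FM Proposition 7.19 at `P = (1/2, 0, ν)`; v21 re-typed with `w n ≥ −x^{ν/10}`). -/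
theorem stub_typeIIRegion :
    ∀ ν : ℝ, 0 < ν → ν < 1 / 4 → ∀ g : VecFn, Admissible ν g →
      ∀ A : ℝ, 1 ≤ A → ∀ ϖ : ℝ, 1 ≤ ϖ → ∃ B₀ : ℝ, ∀ B : ℝ, B₀ ≤ B → ∃ K x₀ : ℝ, ∀ x : ℝ, x₀ ≤ x →
        ∀ w : ℕ → ℝ, (∀ n : ℕ, -(x ^ (ν / 10)) ≤ w n) → GrowthBound w x ϖ → TypeI w x (1 / 2) B →
          TypeII w x 0 ν B →
          |∑ n ∈ Rset ν x, w n * Hwt g ν n| ≤ K * x / Real.log x ^ A := by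
  sorry

/-- The dim-5 sign clause in plain form from R1 (`…FiveGeneric.coneCert_signClause_five_of_generic`). -/
theorem signClauseFive_plain (h : Signature.stub_signClauseFive) :
    ∀ x : Fin 5 → ℝ, Monotone x → (∀ i, (1651 / 10000 : ℝ) < x i ∧ x i < 1 - 1651 / 10000) →
      ∑ i, x i = 1 → starSum coneCert 5 x ≤ 0 :=
  coneCert_signClause_five_of_generic h

/-- **v20's `stub_coneCertClosed` DISCHARGED modulo R1 + R2** (witness `coneCert`; = `…FiveGeneric.stub_coneCertClosed_of_generic_five`, unfolded as `…SignClauseFour.stub_coneCertClosed_of_residues'` ∘ `signClauseFive_plain`). -/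
theorem coneCertClosed_of (h₁ : Signature.stub_signClauseFive) (h₂ : Signature.stub_certValuePos) :
    Signature.stub_coneCertClosed :=
  stub_coneCertClosed_of_residues' (signClauseFive_plain h₁) h₂

theorem mem_Eset {ν x : ℝ} {n : ℕ} : n ∈ Eset ν x ↔ n ∈ Nset ν x ∧ IsExc n := by
  unfold Eset; simp [mem_filter]

theorem filter_prime_window (x : ℝ) : (window x).filter Nat.Prime = windowPrimes x := by
  ext n
  simp only [window, windowPrimes, mem_filter, mem_Icc, Nat.mem_primesLE]
  constructor
  · rintro ⟨⟨⟨-, h2⟩, h3⟩, hp⟩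
    exact ⟨⟨h2, hp⟩, h3⟩
  · rintro ⟨⟨h2, hp⟩, h3⟩
    exact ⟨⟨⟨hp.one_lt.le, h2⟩, h3⟩, hp⟩

theorem roughPart_one (y : ℝ) : roughPart y 1 = 1 := by
  simp [roughPart]

theorem smoothPart_one (y : ℝ) : smoothPart y 1 = 1 := by
  simp [smoothPart, roughPart_one]

theorem Gwt_one {ν : ℝ} {g : VecFn} (hadm : Admissible ν g) {n : ℕ} (hn : 1 ≤ n) : Gwt g ν n 1 = 1 := by
  obtain ⟨-, -, h0, -, -⟩ := hadm
  have hdim : ∀ (k : ℕ) (e : Fin k → ℝ), k = 0 → g k e = 1 := by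
    intro k e hk; subst hk; exact h0 e
  have hcond : ((1 : ℕ) : ℝ) ≤ (n : ℝ) ^ (1 / 2 : ℝ) := by
    rw [Nat.cast_one]
    exact Real.one_le_rpow (by exact_mod_cast hn) (by norm_num)
  rw [Gwt, if_pos hcond, smoothPart_one, ArithmeticFunction.moebius_apply_one]
  rw [hdim _ _ (by rw [roughPart_one, Nat.primeFactorsList_one]; rfl)]
  simp

theorem Gwt_prime_self {ν : ℝ} {g : VecFn} {p : ℕ} (hp : p.Prime) : Gwt g ν p p = 0 := by
  have h1 : (1 : ℝ) < (p : ℝ) := by exact_mod_cast hp.one_lt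
  have hlt : (p : ℝ) ^ (1 / 2 : ℝ) < (p : ℝ) := by
    have := Real.rpow_lt_rpow_of_exponent_lt h1 (show (1 / 2 : ℝ) < 1 by norm_num)
    rwa [Real.rpow_one] at this
  rw [Gwt, if_neg (not_le.2 hlt)]

theorem Hwt_prime {ν : ℝ} {g : VecFn} (hadm : Admissible ν g) {p : ℕ} (hp : p.Prime) : Hwt g ν p = 1 := by
  rw [Hwt, hp.divisors, sum_pair hp.one_lt.ne, Gwt_one hadm hp.one_lt.le, Gwt_prime_self hp, add_zero]

theorem roughPart_dvd (y : ℝ) {d : ℕ} (hd : d ≠ 0) : roughPart y d ∣ d := by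
  have h := Nat.prod_factorization_pow_eq_self hd
  rw [Finsupp.prod, Nat.support_factorization] at h
  unfold roughPart
  conv_rhs => rw [← h]
  exact Finset.prod_dvd_prod_of_subset _ _ _ (filter_subset _ _)

theorem card_divisors_le_two_pow {n : ℕ} (hn : n ≠ 0) :
    n.divisors.card ≤ 2 ^ n.primeFactorsList.length := by
  classical
  have hmaps : Set.MapsTo (fun d : ℕ => d.primeFactorsList) ↑n.divisors
      ↑(n.primeFactorsList.sublists.toFinset) := by
    intro d hd
    simp only [Finset.mem_coe, List.mem_toFinset, List.mem_sublists] at hd ⊢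
    exact Nat.primeFactorsList_sublist_of_dvd (Nat.dvd_of_mem_divisors hd) hn
  have hinj : Set.InjOn (fun d : ℕ => d.primeFactorsList) ↑n.divisors := by
    intro a ha b hb hab
    have ha0 : a ≠ 0 := (Nat.pos_of_mem_divisors (Finset.mem_coe.1 ha)).ne'
    have hb0 : b ≠ 0 := (Nat.pos_of_mem_divisors (Finset.mem_coe.1 hb)).ne'
    simp only at hab
    calc a = a.primeFactorsList.prod := (Nat.prod_primeFactorsList ha0).symm
      _ = b.primeFactorsList.prod := by rw [hab]
      _ = b := Nat.prod_primeFactorsList hb0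
  calc n.divisors.card ≤ (n.primeFactorsList.sublists.toFinset).card :=
        Finset.card_le_card_of_injOn _ hmaps hinj
    _ ≤ n.primeFactorsList.sublists.length := List.toFinset_card_le _
    _ = 2 ^ n.primeFactorsList.length := List.length_sublists _

theorem length_mul_lt_one_of_rough {ν : ℝ} {n : ℕ} (hn : 2 ≤ n) (hr : IsRough ν n) :
    (n.primeFactorsList.length : ℝ) * ν < 1 := by
  set l := n.primeFactorsList with hl
  set t : ℕ := ⌊(n : ℝ) ^ ν⌋₊ + 1 with ht
  have hn0 : n ≠ 0 := by omega
  have hnpos : (0 : ℝ) < (n : ℝ) ^ ν := by positivity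
  have htle : ∀ p ∈ l, t ≤ p := by
    intro p hp
    have hp' : p ∈ n.primeFactors := Nat.mem_primeFactors_iff_mem_primeFactorsList.2 hp
    have hlt : (n : ℝ) ^ ν < (p : ℝ) := hr p hp'
    exact (Nat.floor_lt hnpos.le).2 hlt
  have hprod : t ^ l.length ≤ n := by
    have := List.pow_card_le_prod l t htle
    rwa [hl, Nat.prod_primeFactorsList hn0] at this
  have hlen : 1 ≤ l.length := by
    obtain ⟨p, hp, hpn⟩ := Nat.exists_prime_and_dvd (show n ≠ 1 by omega)
    exact List.length_pos_of_mem ((Nat.mem_primeFactorsList hn0).2 ⟨hp, hpn⟩)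
  have h1 : ((n : ℝ) ^ ν) ^ l.length < (t : ℝ) ^ l.length := by
    apply pow_lt_pow_left₀ _ hnpos.le (by omega)
    rw [ht]; push_cast; exact Nat.lt_floor_add_one _
  have h2 : ((t : ℝ)) ^ l.length ≤ (n : ℝ) := by exact_mod_cast hprod
  have hn1 : (1 : ℝ) < (n : ℝ) := by exact_mod_cast (show 1 < n by omega)
  have h3 : (n : ℝ) ^ ((l.length : ℝ) * ν) < (n : ℝ) ^ (1 : ℝ) := by
    rw [mul_comm, Real.rpow_mul (by positivity), Real.rpow_natCast, Real.rpow_one]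
    exact h1.trans_le h2
  exact (Real.rpow_lt_rpow_left_iff hn1).1 h3

theorem pvec_monotone {n : ℕ} (hn : 2 ≤ n) (d : ℕ) : Monotone (pvec n d) := by
  intro i j hij
  unfold pvec
  have hlog : 0 < Real.log n := Real.log_pos (by exact_mod_cast (show 1 < n by omega))
  apply div_le_div_of_nonneg_right _ hlog.le
  have hi : 0 < d.primeFactorsList.get i := Nat.pos_of_mem_primeFactorsList (List.get_mem _ _)
  apply Real.log_le_log (by exact_mod_cast hi)
  exact_mod_cast Nat.primeFactorsList_sorted d hij

theorem abs_moebius_cast_le_one (m : ℕ) : |((ArithmeticFunction.moebius m : ℤ) : ℝ)| ≤ 1 := by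
  rw [← Int.cast_abs]
  by_cases hsq : Squarefree m
  · rw [ArithmeticFunction.abs_moebius_eq_one_of_squarefree hsq]; simp
  · rw [ArithmeticFunction.moebius_eq_zero_of_not_squarefree hsq]; simp

theorem abs_Gwt_le {ν : ℝ} {g : VecFn} {n d : ℕ} (hn : 2 ≤ n) {C : ℝ} (hC0 : 0 ≤ C)
    (hC : ∀ x : Fin (roughPart ((n : ℝ) ^ ν) d).primeFactorsList.length → ℝ, Monotone x → |g _ x| ≤ C) :
    |Gwt g ν n d| ≤ C := by
  unfold Gwt
  split_ifs with h
  · rw [abs_mul]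
    calc _ ≤ 1 * C := mul_le_mul (abs_moebius_cast_le_one _) (hC _ (pvec_monotone hn _)) (abs_nonneg _) zero_le_one
      _ = C := one_mul C
  · simpa using hC0

theorem Hwt_abs_le {ν : ℝ} (hν : 0 < ν) {g : VecFn} (hpc : IsPiecewiseConstOnCone g) :
    ∃ M : ℝ, ∀ n : ℕ, 2 ≤ n → IsRough ν n → |Hwt g ν n| ≤ M := by
  have hC : ∀ k, ∃ C : ℝ, ∀ x : Fin k → ℝ, Monotone x → |g k x| ≤ C := by
    intro k
    obtain ⟨m, P, c, -, hg⟩ := hpc k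
    classical
    refine ⟨∑ j, |c j|, fun x hx => ?_⟩
    rw [hg x hx]
    refine (abs_sum_le_sum_abs _ _).trans (sum_le_sum fun j _ => ?_)
    split_ifs <;> simp
  choose C hC using hC
  set K₀ : ℕ := ⌊1 / ν⌋₊ with hK₀
  set Cmax : ℝ := ∑ k ∈ range (K₀ + 1), |C k| with hCmax
  have hCmax0 : 0 ≤ Cmax := sum_nonneg fun k _ => abs_nonneg _
  have hCle : ∀ k, k ≤ K₀ → C k ≤ Cmax := fun k hk =>
    (le_abs_self _).trans
      (single_le_sum (f := fun k => |C k|) (fun k _ => abs_nonneg _) (mem_range.2 (Nat.lt_succ_of_le hk)))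
  refine ⟨2 ^ K₀ * Cmax, fun n hn hr => ?_⟩
  have hn0 : n ≠ 0 := by omega
  have hlen := length_mul_lt_one_of_rough hn hr
  have hK : n.primeFactorsList.length ≤ K₀ := by
    apply Nat.le_floor
    rw [le_div_iff₀ hν]
    exact hlen.le
  have hG : ∀ d ∈ n.divisors, |Gwt g ν n d| ≤ Cmax := by
    intro d hd
    have hd0 : d ≠ 0 := (Nat.pos_of_mem_divisors hd).ne'
    have hdvd : d ∣ n := Nat.dvd_of_mem_divisors hd
    have hlenr : (roughPart ((n : ℝ) ^ ν) d).primeFactorsList.length ≤ K₀ :=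
      le_trans (Nat.primeFactorsList_sublist_of_dvd ((roughPart_dvd _ hd0).trans hdvd) hn0).length_le hK
    exact abs_Gwt_le hn hCmax0 (fun x hx => (hC _ x hx).trans (hCle _ hlenr))
  calc |Hwt g ν n| ≤ ∑ d ∈ n.divisors, |Gwt g ν n d| := abs_sum_le_sum_abs _ _
    _ ≤ ∑ d ∈ n.divisors, Cmax := sum_le_sum hG
    _ = n.divisors.card * Cmax := by rw [sum_const, nsmul_eq_mul]
    _ ≤ 2 ^ K₀ * Cmax := by
        apply mul_le_mul_of_nonneg_right _ hCmax0
        calc (n.divisors.card : ℝ) ≤ ((2 ^ n.primeFactorsList.length : ℕ) : ℝ) := by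
              exact_mod_cast card_divisors_le_two_pow hn0
          _ ≤ ((2 ^ K₀ : ℕ) : ℝ) := by exact_mod_cast Nat.pow_le_pow_right two_pos hK
          _ = 2 ^ K₀ := by push_cast; ring

theorem mem_Eset' {ν x : ℝ} {n : ℕ} :
    n ∈ Eset ν x ↔ (n ∈ window x ∧ (2 ≤ n ∧ ¬ n.Prime ∧ IsRough ν n)) ∧ IsExc n := by
  rw [mem_Eset, mem_Nset]

def innerI (w : ℕ → ℝ) (x : ℝ) (I : ℕ → ℕ × ℕ) (m : ℕ) : ℝ :=
  ∑ n ∈ (Icc (I m).1 (I m).2).filter (fun n : ℕ => x / 2 < (m * n : ℝ) ∧ (m * n : ℝ) ≤ x), w (m * n)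

theorem typeI_extract {w : ℕ → ℝ} {x B : ℝ} (hB : 0 ≤ B) (hT : TypeI w x (1 / 2) B) (I : ℕ → ℕ × ℕ)
    {S : Finset ℕ} (hS : S ⊆ Icc 1 ⌊x ^ (1 / 2 : ℝ)⌋₊) :
    ∑ m ∈ S, |innerI w x I m| ≤ x / Real.log x ^ B := by
  have h : ∑ m ∈ Icc 1 ⌊x ^ (1 / 2 : ℝ)⌋₊, ((m.divisors.card : ℝ) ^ B) * |innerI w x I m|
      ≤ x / Real.log x ^ B := hT I
  refine le_trans ?_ h
  calc ∑ m ∈ S, |innerI w x I m| ≤ ∑ m ∈ S, ((m.divisors.card : ℝ) ^ B) * |innerI w x I m| := by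
        refine sum_le_sum fun m hm => le_mul_of_one_le_left (abs_nonneg _) ?_
        have hm1 : 1 ≤ m := (mem_Icc.1 (hS hm)).1
        have hcard : (1 : ℝ) ≤ (m.divisors.card : ℝ) := by
          have : 0 < m.divisors.card := Finset.card_pos.2 ⟨m, Nat.mem_divisors_self m (by omega)⟩
          exact_mod_cast this
        exact Real.one_le_rpow hcard hB
    _ ≤ ∑ m ∈ Icc 1 ⌊x ^ (1 / 2 : ℝ)⌋₊, ((m.divisors.card : ℝ) ^ B) * |innerI w x I m| :=
        sum_le_sum_of_subset_of_nonneg hS fun m _ _ =>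
          mul_nonneg (Real.rpow_nonneg (Nat.cast_nonneg _) _) (abs_nonneg _)

theorem sum_window_filter_dvd (f : ℕ → ℝ) {x : ℝ} (hx : 0 ≤ x) {m : ℕ} (hm : m ≠ 0) :
    ∑ n ∈ (window x).filter (fun n => m ∣ n), f n
      = ∑ k ∈ (Icc 1 ⌊x⌋₊).filter (fun k : ℕ => x / 2 < (m * k : ℝ) ∧ (m * k : ℝ) ≤ x), f (m * k) := by
  classical
  have hinj : Set.InjOn (fun k : ℕ => m * k)
      ↑((Icc 1 ⌊x⌋₊).filter (fun k : ℕ => x / 2 < (m * k : ℝ) ∧ (m * k : ℝ) ≤ x)) := by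
    intro a _ b _ hab
    exact Nat.eq_of_mul_eq_mul_left (Nat.pos_of_ne_zero hm) hab
  rw [← sum_image hinj]
  apply sum_congr _ (fun _ _ => rfl)
  ext n
  simp only [mem_filter, mem_image, mem_window, mem_Icc]
  constructor
  · rintro ⟨⟨⟨h1, h2⟩, h3⟩, k, rfl⟩
    have hk0 : k ≠ 0 := by rintro rfl; simp at h1
    refine ⟨k, ⟨⟨Nat.one_le_iff_ne_zero.2 hk0, le_trans (Nat.le_mul_of_pos_left k (Nat.pos_of_ne_zero hm)) h2⟩,
      ?_, ?_⟩, rfl⟩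
    · exact_mod_cast h3
    · have : ((m * k : ℕ) : ℝ) ≤ x := (Nat.cast_le.2 h2).trans (Nat.floor_le hx)
      exact_mod_cast this
  · rintro ⟨k, ⟨⟨h1, h2⟩, h3, h4⟩, rfl⟩
    refine ⟨⟨⟨Nat.one_le_iff_ne_zero.2 (mul_ne_zero hm (by omega)), Nat.le_floor (by exact_mod_cast h4)⟩,
      by exact_mod_cast h3⟩, Dvd.intro k rfl⟩

theorem card_cofactors_le {x : ℝ} (hx : 0 ≤ x) {m : ℕ} (hm : 0 < m) :
    (((Icc 1 ⌊x⌋₊).filter (fun k : ℕ => x / 2 < (m * k : ℝ) ∧ (m * k : ℝ) ≤ x)).card : ℝ)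
      ≤ x / (2 * m) + 1 := by
  have hm' : (0 : ℝ) < m := by exact_mod_cast hm
  set A : ℕ := ⌊x / (2 * m)⌋₊ with hA
  set Bn : ℕ := ⌊x / m⌋₊ with hBn
  have hsub : (Icc 1 ⌊x⌋₊).filter (fun k : ℕ => x / 2 < (m * k : ℝ) ∧ (m * k : ℝ) ≤ x) ⊆ Ioc A Bn := by
    intro k hk
    simp only [mem_filter, mem_Icc] at hk
    obtain ⟨-, h1, h2⟩ := hk
    rw [mem_Ioc]
    constructor
    · by_contra hle
      push Not at hle
      have hk' : (k : ℝ) ≤ x / (2 * m) := (Nat.cast_le.2 hle).trans (Nat.floor_le (by positivity))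
      have : (m : ℝ) * k ≤ (m : ℝ) * (x / (2 * m)) := mul_le_mul_of_nonneg_left hk' hm'.le
      have h' : (m : ℝ) * (x / (2 * m)) = x / 2 := by field_simp
      linarith
    · apply Nat.le_floor
      rw [le_div_iff₀ hm']
      linarith [mul_comm (m : ℝ) k]
  calc (((Icc 1 ⌊x⌋₊).filter (fun k : ℕ => x / 2 < (m * k : ℝ) ∧ (m * k : ℝ) ≤ x)).card : ℝ)
        ≤ ((Ioc A Bn).card : ℝ) := by exact_mod_cast card_le_card hsub
    _ = ((Bn - A : ℕ) : ℝ) := by rw [Nat.card_Ioc]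
    _ ≤ x / (2 * m) + 1 := by
        rcases le_or_gt A Bn with h | h
        · rw [Nat.cast_sub h]
          have hB' : (Bn : ℝ) ≤ x / m := Nat.floor_le (by positivity)
          have hA' : x / (2 * m) < A + 1 := Nat.lt_floor_add_one _
          have : x / m = 2 * (x / (2 * m)) := by field_simp
          linarith
        · rw [Nat.sub_eq_zero_of_le h.le]
          simp only [Nat.cast_zero]
          positivity

theorem sum_sq_primes_le {x B : ℝ} (hx : 2 ≤ x) (hB : 0 ≤ B) {a : ℕ → ℝ} (ha : ∀ n, 0 ≤ a n)
    (hT : TypeI (fun n => a n - 1) x (1 / 2) B) {T : Finset ℕ} (hTw : T ⊆ window x)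
    (hT2 : ∀ n ∈ T, ∃ p : ℕ, p.Prime ∧ n = p * p) :
    ∑ n ∈ T, a n ≤ x / Real.log x ^ B + Real.sqrt x := by
  classical
  have hx0 : 0 < x := by linarith
  set w : ℕ → ℝ := fun n => a n - 1 with hw
  set S₂ : Finset ℕ := (Icc 1 ⌊x ^ (1 / 2 : ℝ)⌋₊).filter
    (fun p => p.Prime ∧ (x / 2 < (p * p : ℝ) ∧ (p * p : ℝ) ≤ x)) with hS₂
  have hsub : T ⊆ S₂.image (fun p => p * p) := by
    intro n hn
    obtain ⟨p, hp, rfl⟩ := hT2 n hn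
    obtain ⟨⟨-, h2⟩, h3⟩ := mem_window.1 (hTw hn)
    have h2' : ((p : ℝ) * p) ≤ x := by
      have : ((p * p : ℕ) : ℝ) ≤ x := (Nat.cast_le.2 h2).trans (Nat.floor_le hx0.le)
      exact_mod_cast this
    have h3' : x / 2 < (p : ℝ) * p := by exact_mod_cast h3
    refine mem_image.2 ⟨p, ?_, rfl⟩
    rw [hS₂, mem_filter, mem_Icc]
    refine ⟨⟨hp.one_lt.le, Nat.le_floor ?_⟩, hp, h3', h2'⟩
    rw [← Real.sqrt_eq_rpow]
    calc (p : ℝ) = Real.sqrt ((p : ℝ) * p) := (Real.sqrt_mul_self (Nat.cast_nonneg p)).symm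
      _ ≤ Real.sqrt x := Real.sqrt_le_sqrt h2'
  have hinj : Set.InjOn (fun p : ℕ => p * p) ↑S₂ := fun a _ b _ h => Nat.mul_self_inj.1 h
  set I₂ : ℕ → ℕ × ℕ := fun m => (m, m) with hI₂
  have hinner : ∀ p ∈ S₂, innerI w x I₂ p = a (p * p) - 1 := by
    intro p hp
    rw [hS₂, mem_filter] at hp
    obtain ⟨-, -, h3, h4⟩ := hp
    rw [innerI, hI₂]
    simp only [Icc_self, filter_singleton, h3, h4, and_self, if_true, sum_singleton, hw]
  have hS₂sub : S₂ ⊆ Icc 1 ⌊x ^ (1 / 2 : ℝ)⌋₊ := filter_subset _ _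
  have hI := typeI_extract hB hT I₂ hS₂sub
  have hcard : (S₂.card : ℝ) ≤ Real.sqrt x := by
    calc (S₂.card : ℝ) ≤ ((Icc 1 ⌊x ^ (1 / 2 : ℝ)⌋₊).card : ℝ) := by exact_mod_cast card_le_card hS₂sub
      _ = (⌊x ^ (1 / 2 : ℝ)⌋₊ : ℝ) := by simp
      _ ≤ x ^ (1 / 2 : ℝ) := Nat.floor_le (by positivity)
      _ = Real.sqrt x := (Real.sqrt_eq_rpow x).symm
  calc ∑ n ∈ T, a n ≤ ∑ n ∈ S₂.image (fun p => p * p), a n :=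
        sum_le_sum_of_subset_of_nonneg hsub fun n _ _ => ha n
    _ = ∑ p ∈ S₂, a (p * p) := sum_image hinj
    _ = ∑ p ∈ S₂, (innerI w x I₂ p + 1) := sum_congr rfl fun p hp => by rw [hinner p hp]; ring
    _ = ∑ p ∈ S₂, innerI w x I₂ p + S₂.card := by
        rw [sum_add_distrib, sum_const, nsmul_eq_mul, mul_one]
    _ ≤ ∑ p ∈ S₂, |innerI w x I₂ p| + S₂.card := by
        gcongr with p hp
        exact le_abs_self _
    _ ≤ x / Real.log x ^ B + Real.sqrt x := add_le_add hI hcard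

theorem sum_smallSquareFactor_le {ν x B : ℝ} (hν : 0 < ν) (hν1 : ν ≤ 1) (hx : 2 ≤ x) (hB : 0 ≤ B)
    {a : ℕ → ℝ} (ha : ∀ n, 0 ≤ a n) (hT : TypeI (fun n => a n - 1) x (1 / 2) B) {T : Finset ℕ}
    (hTw : T ⊆ window x)
    (hT1 : ∀ n ∈ T, ∃ p : ℕ, p.Prime ∧ p * p ∣ n ∧ (p : ℝ) ≤ x ^ (1 / 4 : ℝ) ∧ (x / 2) ^ ν < (p : ℝ)) :
    ∑ n ∈ T, a n ≤ x / Real.log x ^ B + 2 * x ^ (1 - ν) + Real.sqrt x := by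
  classical
  have hx0 : 0 < x := by linarith
  have hx1 : 1 ≤ x := by linarith
  set P₁ : Finset ℕ := (Icc 1 ⌊x ^ (1 / 4 : ℝ)⌋₊).filter (fun p => p.Prime ∧ (x / 2) ^ ν < (p : ℝ))
    with hP₁
  set w : ℕ → ℝ := fun n => a n - 1 with hw
  have h1 : ∑ n ∈ T, a n ≤ ∑ p ∈ P₁, ∑ n ∈ (window x).filter (fun n => p * p ∣ n), a n := by
    have hle : ∀ n ∈ T, a n ≤ ∑ p ∈ P₁.filter (fun p => p * p ∣ n), a n := by
      intro n hn
      obtain ⟨p, hp, hdvd, hp4, hpν⟩ := hT1 n hn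
      have hpP : p ∈ P₁.filter (fun p => p * p ∣ n) := by
        rw [mem_filter, hP₁, mem_filter, mem_Icc]
        exact ⟨⟨⟨hp.one_lt.le, Nat.le_floor hp4⟩, hp, hpν⟩, hdvd⟩
      exact single_le_sum (f := fun _ => a n) (fun _ _ => ha n) hpP
    calc ∑ n ∈ T, a n ≤ ∑ n ∈ T, ∑ p ∈ P₁.filter (fun p => p * p ∣ n), a n := sum_le_sum hle
      _ ≤ ∑ n ∈ window x, ∑ p ∈ P₁.filter (fun p => p * p ∣ n), a n :=
          sum_le_sum_of_subset_of_nonneg hTw fun n _ _ => sum_nonneg fun _ _ => ha n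
      _ = ∑ n ∈ window x, ∑ p ∈ P₁, (if p * p ∣ n then a n else 0) := by
          refine sum_congr rfl fun n _ => ?_
          rw [sum_filter]
      _ = ∑ p ∈ P₁, ∑ n ∈ window x, (if p * p ∣ n then a n else 0) := sum_comm
      _ = ∑ p ∈ P₁, ∑ n ∈ (window x).filter (fun n => p * p ∣ n), a n := by
          refine sum_congr rfl fun p _ => ?_
          rw [sum_filter]
  set I₁ : ℕ → ℕ × ℕ := fun _ => (1, ⌊x⌋₊) with hI₁
  have h2 : ∀ p ∈ P₁, ∑ n ∈ (window x).filter (fun n => p * p ∣ n), a n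
      ≤ |innerI w x I₁ (p * p)| + (x / 2 * ((p : ℝ) ^ 2)⁻¹ + 1) := by
    intro p hp
    rw [hP₁, mem_filter] at hp
    obtain ⟨-, hpr, -⟩ := hp
    have hpp0 : p * p ≠ 0 := mul_ne_zero hpr.ne_zero hpr.ne_zero
    rw [sum_window_filter_dvd a hx0.le hpp0]
    have hK := card_cofactors_le hx0.le (Nat.pos_of_ne_zero hpp0)
    have hak : ∀ k, a (p * p * k) = w (p * p * k) + 1 := fun k => by simp [hw]
    rw [sum_congr rfl (fun k _ => hak k), sum_add_distrib, sum_const, nsmul_eq_mul, mul_one]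
    have hin : innerI w x I₁ (p * p)
        = ∑ k ∈ (Icc 1 ⌊x⌋₊).filter
            (fun k : ℕ => x / 2 < ((p * p : ℕ) : ℝ) * (k : ℝ) ∧ ((p * p : ℕ) : ℝ) * (k : ℝ) ≤ x),
            w (p * p * k) := rfl
    rw [← hin]
    have hcast : x / (2 * ((p * p : ℕ) : ℝ)) = x / 2 * ((p : ℝ) ^ 2)⁻¹ := by
      have hp0 : (p : ℝ) ≠ 0 := by exact_mod_cast hpr.ne_zero
      push_cast
      field_simp
    linarith [le_abs_self (innerI w x I₁ (p * p)), hcast ▸ hK]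
  have h3 : ∑ p ∈ P₁, |innerI w x I₁ (p * p)| ≤ x / Real.log x ^ B := by
    have hinj : Set.InjOn (fun p : ℕ => p * p) ↑P₁ := fun a _ b _ h => Nat.mul_self_inj.1 h
    have := sum_image hinj (f := fun m => |innerI w x I₁ m|)
    rw [← this]
    apply typeI_extract hB hT I₁
    intro m hm
    rw [mem_image] at hm
    obtain ⟨p, hp, rfl⟩ := hm
    rw [hP₁, mem_filter, mem_Icc] at hp
    obtain ⟨⟨_, h2⟩, hpr, -⟩ := hp
    rw [mem_Icc]
    refine ⟨Nat.one_le_iff_ne_zero.2 (mul_ne_zero hpr.ne_zero hpr.ne_zero), Nat.le_floor ?_⟩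
    have hp4 : (p : ℝ) ≤ x ^ (1 / 4 : ℝ) := (Nat.cast_le.2 h2).trans (Nat.floor_le (by positivity))
    have h44 : (x ^ (1 / 4 : ℝ)) * (x ^ (1 / 4 : ℝ)) = x ^ (1 / 2 : ℝ) := by
      rw [← Real.rpow_add hx0]; norm_num
    push_cast
    rw [← h44]
    exact mul_le_mul hp4 hp4 (Nat.cast_nonneg _) (by positivity)
  have h4 : ∑ p ∈ P₁, (x / 2 * ((p : ℝ) ^ 2)⁻¹ + 1) ≤ 2 * x ^ (1 - ν) + Real.sqrt x := by
    rw [sum_add_distrib, ← mul_sum, sum_const, nsmul_eq_mul, mul_one]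
    set k₀ : ℕ := ⌊(x / 2) ^ ν⌋₊ with hk₀
    set n₀ : ℕ := ⌊x ^ (1 / 4 : ℝ)⌋₊ + 1 with hn₀
    have hxh : (0 : ℝ) < (x / 2) ^ ν := by positivity
    have hsubI : P₁ ⊆ Ioo k₀ n₀ := by
      intro p hp
      rw [hP₁, mem_filter, mem_Icc] at hp
      obtain ⟨⟨_, h2⟩, _, hν'⟩ := hp
      rw [mem_Ioo]
      constructor
      · have : (k₀ : ℝ) < p := (Nat.floor_le hxh.le).trans_lt hν'
        exact_mod_cast this
      · omega
    have hinv : ∑ p ∈ P₁, ((p : ℝ) ^ 2)⁻¹ ≤ 2 / (x / 2) ^ ν := by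
      calc ∑ p ∈ P₁, ((p : ℝ) ^ 2)⁻¹ ≤ ∑ i ∈ Ioo k₀ n₀, ((i : ℝ) ^ 2)⁻¹ :=
            sum_le_sum_of_subset_of_nonneg hsubI fun i _ _ => by positivity
        _ ≤ 2 / (k₀ + 1) := sum_Ioo_inv_sq_le k₀ n₀
        _ ≤ 2 / (x / 2) ^ ν := div_le_div_of_nonneg_left zero_le_two hxh (Nat.lt_floor_add_one _).le
    have hhalf : x ^ ν / 2 ≤ (x / 2) ^ ν := by
      rw [Real.div_rpow hx0.le zero_le_two]
      apply div_le_div_of_nonneg_left (by positivity) (by positivity)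
      calc (2 : ℝ) ^ ν ≤ 2 ^ (1 : ℝ) := Real.rpow_le_rpow_of_exponent_le one_le_two hν1
        _ = 2 := Real.rpow_one 2
    have hxν : 0 < x ^ ν := by positivity
    have hmain : x / 2 * ∑ p ∈ P₁, ((p : ℝ) ^ 2)⁻¹ ≤ 2 * x ^ (1 - ν) := by
      calc x / 2 * ∑ p ∈ P₁, ((p : ℝ) ^ 2)⁻¹ ≤ x / 2 * (2 / (x / 2) ^ ν) :=
            mul_le_mul_of_nonneg_left hinv (by positivity)
        _ ≤ x / 2 * (2 / (x ^ ν / 2)) := by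
            apply mul_le_mul_of_nonneg_left _ (by positivity)
            exact div_le_div_of_nonneg_left zero_le_two (by positivity) hhalf
        _ = 2 * x ^ (1 - ν) := by
            rw [Real.rpow_sub hx0, Real.rpow_one]
            field_simp
    have hcardP : (P₁.card : ℝ) ≤ Real.sqrt x := by
      calc (P₁.card : ℝ) ≤ ((Icc 1 ⌊x ^ (1 / 4 : ℝ)⌋₊).card : ℝ) := by
            exact_mod_cast card_le_card (filter_subset _ _)
        _ = (⌊x ^ (1 / 4 : ℝ)⌋₊ : ℝ) := by simp
        _ ≤ x ^ (1 / 4 : ℝ) := Nat.floor_le (by positivity)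
        _ ≤ x ^ (1 / 2 : ℝ) := Real.rpow_le_rpow_of_exponent_le hx1 (by norm_num)
        _ = Real.sqrt x := (Real.sqrt_eq_rpow x).symm
    linarith
  calc ∑ n ∈ T, a n ≤ ∑ p ∈ P₁, ∑ n ∈ (window x).filter (fun n => p * p ∣ n), a n := h1
    _ ≤ ∑ p ∈ P₁, (|innerI w x I₁ (p * p)| + (x / 2 * ((p : ℝ) ^ 2)⁻¹ + 1)) := sum_le_sum h2
    _ = ∑ p ∈ P₁, |innerI w x I₁ (p * p)| + ∑ p ∈ P₁, (x / 2 * ((p : ℝ) ^ 2)⁻¹ + 1) := sum_add_distrib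
    _ ≤ x / Real.log x ^ B + 2 * x ^ (1 - ν) + Real.sqrt x := by linarith [h3, h4]

theorem squarefull_patch :
    ∀ ν : ℝ, 0 < ν → ν < 1 / 4 → ∀ x : ℝ, 2 ≤ x → ∀ B : ℝ, 0 < B → ∀ a : ℕ → ℝ, (∀ n, 0 ≤ a n) →
    TypeI (fun n => a n - 1) x (1 / 2) B →
      ∑ n ∈ Eset ν x, a n ≤ 4 * x ^ (1 - ν) + 2 * Real.sqrt x + 2 + 2 * x / Real.log x ^ B := by
  intro ν hν hν4 x hx B hB a ha hT
  classical
  have hx0 : 0 < x := by linarith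
  set kind1 : ℕ → Prop := fun n =>
    ∃ p : ℕ, p.Prime ∧ p * p ∣ n ∧ (p : ℝ) ≤ x ^ (1 / 4 : ℝ) ∧ (x / 2) ^ ν < (p : ℝ) with hkind1
  rw [← sum_filter_add_sum_filter_not (Eset ν x) kind1 a]
  have hT1w : (Eset ν x).filter kind1 ⊆ window x :=
    fun n hn => ((mem_Eset'.1 (mem_filter.1 hn).1).1).1
  have hT2w : (Eset ν x).filter (fun n => ¬ kind1 n) ⊆ window x :=
    fun n hn => ((mem_Eset'.1 (mem_filter.1 hn).1).1).1
  have hA := sum_smallSquareFactor_le hν (by linarith) hx hB.le ha hT hT1w (fun n hn => (mem_filter.1 hn).2)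
  have hB' : ∑ n ∈ (Eset ν x).filter (fun n => ¬ kind1 n), a n ≤ x / Real.log x ^ B + Real.sqrt x := by
    refine sum_sq_primes_le hx hB.le ha hT hT2w fun n hn => ?_
    rw [mem_filter, mem_Eset'] at hn
    obtain ⟨⟨⟨hw, h2, hnp, hr⟩, hexc⟩, hk⟩ := hn
    obtain ⟨⟨-, hle⟩, hgt⟩ := mem_window.1 hw
    have hnx : (n : ℝ) ≤ x := (Nat.cast_le.2 hle).trans (Nat.floor_le hx0.le)
    rcases hexc with ⟨p, hp, hdvd, hp4⟩ | ⟨p, hp, hnp2⟩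
    · exfalso
      refine hk ⟨p, Nat.prime_of_mem_primeFactors hp, by simpa [sq] using hdvd, ?_, ?_⟩
      · exact hp4.trans (Real.rpow_le_rpow (Nat.cast_nonneg n) hnx (by norm_num))
      · exact (Real.rpow_lt_rpow (by positivity) hgt hν).trans (hr p hp)
    · exact ⟨p, Nat.prime_of_mem_primeFactors hp, by rw [hnp2, sq]⟩
  have h0 : 0 ≤ x ^ (1 - ν) := by positivity
  have : 2 * x / Real.log x ^ B = 2 * (x / Real.log x ^ B) := by ring
  linarith

theorem pvec_monotone_all (n d : ℕ) : Monotone (pvec n d) := by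
  intro i j hij
  unfold pvec
  rcases lt_or_ge 1 n with hn | hn
  · have hlog : 0 < Real.log n := Real.log_pos (by exact_mod_cast hn)
    apply div_le_div_of_nonneg_right _ hlog.le
    have hi : 0 < d.primeFactorsList.get i := Nat.pos_of_mem_primeFactorsList (List.get_mem _ _)
    apply Real.log_le_log (by exact_mod_cast hi)
    exact_mod_cast Nat.primeFactorsList_sorted d hij
  · have : Real.log n = 0 := by
      interval_cases n <;> simp
    simp [this]

theorem abs_g_le_uniform {ν : ℝ} (hν : 0 < ν) {g : VecFn} (hadm : Admissible ν g) :
    ∃ C : ℝ, 0 ≤ C ∧ ∀ (k : ℕ) (x : Fin k → ℝ), Monotone x → |g k x| ≤ C := by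
  obtain ⟨-, hpc, -, hsupp, -⟩ := hadm
  have hC : ∀ k, ∃ C : ℝ, ∀ x : Fin k → ℝ, Monotone x → |g k x| ≤ C := by
    intro k
    obtain ⟨m, P, c, -, hg⟩ := hpc k
    classical
    refine ⟨∑ j, |c j|, fun x hx => ?_⟩
    rw [hg x hx]
    refine (abs_sum_le_sum_abs _ _).trans (sum_le_sum fun j _ => ?_)
    split_ifs <;> simp
  choose C hC using hC
  set K₀ : ℕ := ⌊1 / ν⌋₊ with hK₀
  refine ⟨∑ k ∈ range (K₀ + 1), |C k|, sum_nonneg fun k _ => abs_nonneg _, fun k x hx => ?_⟩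
  by_cases hk : k ≤ K₀
  · exact (hC k x hx).trans ((le_abs_self _).trans
      (single_le_sum (f := fun k => |C k|) (fun k _ => abs_nonneg _) (mem_range.2 (Nat.lt_succ_of_le hk))))
  · have h0 : g k x = 0 := by
      by_contra h
      rcases hsupp k x h with h1 | ⟨h2, h3⟩
      · exact hk (h1 ▸ Nat.zero_le _)
      · have hkpos : 0 < k := by omega
        have hlt : (k : ℝ) * ν < 1 / 2 := by
          calc (k : ℝ) * ν = ∑ _i : Fin k, ν := by simp
            _ < ∑ i, x i := by
                apply Finset.sum_lt_sum_of_nonempty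
                · exact Finset.univ_nonempty_iff.2 ⟨⟨0, hkpos⟩⟩
                · intro i _; exact h2 i
            _ ≤ 1 / 2 := h3
        apply hk
        apply Nat.le_floor
        rw [le_div_iff₀ hν]
        linarith
    rw [h0, abs_zero]
    exact sum_nonneg fun k _ => abs_nonneg _

theorem abs_Gwt_le_uniform {ν : ℝ} (hν : 0 < ν) {g : VecFn} (hadm : Admissible ν g) :
    ∃ C : ℝ, 0 ≤ C ∧ ∀ n d : ℕ, |Gwt g ν n d| ≤ C := by
  obtain ⟨C, hC0, hC⟩ := abs_g_le_uniform hν hadm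
  refine ⟨C, hC0, fun n d => ?_⟩
  unfold Gwt
  split_ifs with h
  · rw [abs_mul]
    calc _ ≤ 1 * C :=
          mul_le_mul (abs_moebius_cast_le_one _) (hC _ _ (pvec_monotone_all _ _)) (abs_nonneg _) zero_le_one
      _ = C := one_mul C
  · simpa using hC0

theorem Icc_one_succ (N : ℕ) : Icc 1 (N + 1) = insert (N + 1) (Icc 1 N) := by
  ext k; simp only [mem_Icc, mem_insert]; omega

theorem Ico_one_succ {N : ℕ} (h : 1 ≤ N) : Ico 1 (N + 1) = insert N (Ico 1 N) := by
  ext k; simp only [mem_Ico, mem_insert]; omega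

theorem abel_identity (w G : ℕ → ℝ) (N : ℕ) :
    ∑ k ∈ Icc 1 N, w k * G k
      = G N * (∑ k ∈ Icc 1 N, w k) - ∑ k ∈ Ico 1 N, (G (k + 1) - G k) * ∑ j ∈ Icc 1 k, w j := by
  induction N with
  | zero => simp
  | succ N ih =>
    rw [Icc_one_succ, sum_insert (by simp), sum_insert (by simp), ih]
    rcases Nat.eq_zero_or_pos N with rfl | hN
    · simp [mul_comm]
    · rw [Ico_one_succ hN, sum_insert (by simp)]
      ring

theorem abel_bound (w G : ℕ → ℝ) (N : ℕ) {M : ℝ} (hM0 : 0 ≤ M)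
    (hM : ∀ i ∈ Icc 1 N, |∑ k ∈ Icc 1 i, w k| ≤ M) :
    |∑ k ∈ Icc 1 N, w k * G k| ≤ (|G N| + ∑ k ∈ Ico 1 N, |G (k + 1) - G k|) * M := by
  rw [abel_identity]
  have hSN : |∑ k ∈ Icc 1 N, w k| ≤ M := by
    rcases Nat.eq_zero_or_pos N with rfl | hN
    · simpa using hM0
    · exact hM N (by rw [mem_Icc]; omega)
  calc |G N * ∑ k ∈ Icc 1 N, w k - ∑ k ∈ Ico 1 N, (G (k + 1) - G k) * ∑ j ∈ Icc 1 k, w j|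
      ≤ |G N * ∑ k ∈ Icc 1 N, w k| + |∑ k ∈ Ico 1 N, (G (k + 1) - G k) * ∑ j ∈ Icc 1 k, w j| := abs_sub _ _
    _ ≤ |G N| * M + ∑ k ∈ Ico 1 N, |G (k + 1) - G k| * M := by
        apply add_le_add
        · rw [abs_mul]; exact mul_le_mul_of_nonneg_left hSN (abs_nonneg _)
        · refine (abs_sum_le_sum_abs _ _).trans (sum_le_sum fun k hk => ?_)
          rw [abs_mul]
          refine mul_le_mul_of_nonneg_left (hM k ?_) (abs_nonneg _)
          rw [mem_Ico] at hk; rw [mem_Icc]; omega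
    _ = _ := by rw [← sum_mul]; ring

theorem sum_abs_diff_le (G : ℕ → ℝ) (N : ℕ) {C : ℝ} (hC : ∀ k, |G k| ≤ C) :
    ∑ k ∈ Ico 1 N, |G (k + 1) - G k|
      ≤ 2 * C * (((Ico 1 N).filter (fun k => G (k + 1) ≠ G k)).card : ℝ) := by
  classical
  rw [← sum_filter_add_sum_filter_not (Ico 1 N) (fun k => G (k + 1) ≠ G k)]
  have h2 : ∑ k ∈ (Ico 1 N).filter (fun k => ¬ (G (k + 1) ≠ G k)), |G (k + 1) - G k| = 0 := by
    refine sum_eq_zero fun k hk => ?_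
    rw [mem_filter, not_not] at hk
    rw [hk.2, sub_self, abs_zero]
  rw [h2, add_zero]
  calc ∑ k ∈ (Ico 1 N).filter (fun k => G (k + 1) ≠ G k), |G (k + 1) - G k|
      ≤ ∑ k ∈ (Ico 1 N).filter (fun k => G (k + 1) ≠ G k), 2 * C := by
        refine sum_le_sum fun k _ => ?_
        calc |G (k + 1) - G k| ≤ |G (k + 1)| + |G k| := abs_sub _ _
          _ ≤ C + C := add_le_add (hC _) (hC _)
          _ = 2 * C := by ring
    _ = 2 * C * _ := by rw [sum_const, nsmul_eq_mul]; ring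

theorem typeITerm_of_jumps (hJ : Signature.weightJumps) : Signature.typeITerm := by
  intro ν hν hν4 g hadm
  obtain ⟨C, hC0, hC⟩ := abs_Gwt_le_uniform hν hadm
  obtain ⟨C', hC'⟩ := hJ ν hν hν4 g hadm
  have hK0 : 0 ≤ C + 2 * C * max C' 0 :=
    add_nonneg hC0 (mul_nonneg (mul_nonneg zero_le_two hC0) (le_max_right _ _))
  refine ⟨C + 2 * C * max C' 0, fun x hx B hB w hT => ?_⟩
  classical
  have hx0 : 0 ≤ x := by linarith
  have hN1 : 1 ≤ ⌊x⌋₊ := le_trans (by norm_num) (Nat.le_floor (by exact_mod_cast hx) : 2 ≤ ⌊x⌋₊)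
  have hfub : ∑ n ∈ window x, w n * Hwt g ν n
      = ∑ d ∈ Icc 1 ⌊x⌋₊, ∑ n ∈ (window x).filter (fun n => d ∣ n), w n * Gwt g ν n d := by
    unfold Hwt
    simp_rw [mul_sum]
    refine sum_comm' ?_
    intro n d
    simp only [mem_filter, Nat.mem_divisors, mem_window, mem_Icc]
    constructor
    · rintro ⟨⟨⟨h1, h2⟩, h3⟩, hd, hn0⟩
      exact ⟨⟨⟨⟨h1, h2⟩, h3⟩, hd⟩, Nat.pos_of_dvd_of_pos hd (by omega),
        le_trans (Nat.le_of_dvd (by omega) hd) h2⟩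
    · rintro ⟨⟨⟨⟨h1, h2⟩, h3⟩, hd⟩, h4, h5⟩
      exact ⟨⟨⟨h1, h2⟩, h3⟩, hd, by omega⟩
  have hSsub : Icc 1 ⌊x ^ (1 / 2 : ℝ)⌋₊ ⊆ Icc 1 ⌊x⌋₊ := by
    intro d hd; rw [mem_Icc] at hd ⊢
    refine ⟨hd.1, hd.2.trans (Nat.floor_le_floor ?_)⟩
    calc x ^ (1 / 2 : ℝ) ≤ x ^ (1 : ℝ) := Real.rpow_le_rpow_of_exponent_le (by linarith) (by norm_num)
      _ = x := Real.rpow_one x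
  have hvan : ∀ d ∈ Icc 1 ⌊x⌋₊, d ∉ Icc 1 ⌊x ^ (1 / 2 : ℝ)⌋₊ →
      ∑ n ∈ (window x).filter (fun n => d ∣ n), w n * Gwt g ν n d = 0 := by
    intro d hd hdS
    refine sum_eq_zero fun n hn => ?_
    rw [mem_filter, mem_window] at hn
    rw [mem_Icc] at hd
    have hdgt : x ^ (1 / 2 : ℝ) < d := by
      have : ⌊x ^ (1 / 2 : ℝ)⌋₊ < d := by
        by_contra h
        exact hdS (mem_Icc.2 ⟨hd.1, not_lt.1 h⟩)
      exact (Nat.floor_lt (by positivity)).1 this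
    have hnx : (n : ℝ) ≤ x := (Nat.cast_le.2 hn.1.1.2).trans (Nat.floor_le hx0)
    have hcut : ¬ ((d : ℝ) ≤ (n : ℝ) ^ (1 / 2 : ℝ)) := by
      intro h
      have : (n : ℝ) ^ (1 / 2 : ℝ) ≤ x ^ (1 / 2 : ℝ) := Real.rpow_le_rpow (Nat.cast_nonneg _) hnx (by norm_num)
      linarith
    unfold Gwt
    rw [if_neg hcut, mul_zero]
  rw [hfub, ← sum_subset hSsub hvan]
  set w' : ℕ → ℕ → ℝ := fun d k => if x / 2 < (d * k : ℝ) ∧ (d * k : ℝ) ≤ x then w (d * k) else 0 with hw'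
  have hmaxd : ∀ d : ℕ, ∃ i ∈ Icc 1 ⌊x⌋₊, ∀ i' ∈ Icc 1 ⌊x⌋₊,
      |∑ k ∈ Icc 1 i', w' d k| ≤ |∑ k ∈ Icc 1 i, w' d k| := fun d =>
    exists_max_image (Icc 1 ⌊x⌋₊) (fun i => |∑ k ∈ Icc 1 i, w' d k|) ⟨1, by rw [mem_Icc]; omega⟩
  choose istar histar hmax using hmaxd
  set I : ℕ → ℕ × ℕ := fun d => (1, istar d) with hI
  have hinner : ∀ d, innerI w x I d = ∑ k ∈ Icc 1 (istar d), w' d k := by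
    intro d
    unfold innerI
    rw [sum_filter]
  have hper : ∀ d ∈ Icc 1 ⌊x ^ (1 / 2 : ℝ)⌋₊, |∑ n ∈ (window x).filter (fun n => d ∣ n), w n * Gwt g ν n d|
      ≤ (C + 2 * C * max C' 0) * (d.divisors.card : ℝ) * |innerI w x I d| := by
    intro d hd
    have hd1 : 1 ≤ d := (mem_Icc.1 hd).1
    have hd0 : d ≠ 0 := by omega
    rw [sum_window_filter_dvd (fun n => w n * Gwt g ν n d) hx0 hd0]
    have hrw : ∑ k ∈ (Icc 1 ⌊x⌋₊).filter (fun k : ℕ => x / 2 < (d * k : ℝ) ∧ (d * k : ℝ) ≤ x),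
          w (d * k) * Gwt g ν (d * k) d
        = ∑ k ∈ Icc 1 ⌊x⌋₊, w' d k * Gwt g ν (d * k) d := by
      rw [sum_filter]
      refine sum_congr rfl fun k _ => ?_
      simp only [hw']
      split_ifs <;> simp
    rw [hrw, hinner d]
    have hM0 : 0 ≤ |∑ k ∈ Icc 1 (istar d), w' d k| := abs_nonneg _
    have hab := abel_bound (w' d) (fun k => Gwt g ν (d * k) d) ⌊x⌋₊ hM0 (hmax d)
    have hjump := sum_abs_diff_le (fun k => Gwt g ν (d * k) d) ⌊x⌋₊ (fun k => hC _ _)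
    have hJd := hC' d hd1 ⌊x⌋₊
    have hτ : (1 : ℝ) ≤ d.divisors.card := by
      exact_mod_cast Finset.card_pos.2 ⟨d, Nat.mem_divisors_self d hd0⟩
    calc |∑ k ∈ Icc 1 ⌊x⌋₊, w' d k * Gwt g ν (d * k) d|
        ≤ (|Gwt g ν (d * ⌊x⌋₊) d| + ∑ k ∈ Ico 1 ⌊x⌋₊, |Gwt g ν (d * (k + 1)) d - Gwt g ν (d * k) d|)
            * |∑ k ∈ Icc 1 (istar d), w' d k| := hab
      _ ≤ (C + 2 * C * (max C' 0 * (d.divisors.card : ℝ))) * |∑ k ∈ Icc 1 (istar d), w' d k| := by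
          apply mul_le_mul_of_nonneg_right _ hM0
          apply add_le_add (hC _ _)
          refine hjump.trans ?_
          apply mul_le_mul_of_nonneg_left _ (by positivity)
          exact hJd.trans (mul_le_mul_of_nonneg_right (le_max_left _ _) (Nat.cast_nonneg _))
      _ ≤ (C + 2 * C * max C' 0) * (d.divisors.card : ℝ) * |∑ k ∈ Icc 1 (istar d), w' d k| := by
          apply mul_le_mul_of_nonneg_right _ hM0
          nlinarith [hC0, le_max_right C' 0, hτ]
  have hTI : ∑ d ∈ Icc 1 ⌊x ^ (1 / 2 : ℝ)⌋₊, ((d.divisors.card : ℝ) ^ B) * |innerI w x I d|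
      ≤ x / Real.log x ^ B := hT I
  calc |∑ d ∈ Icc 1 ⌊x ^ (1 / 2 : ℝ)⌋₊, ∑ n ∈ (window x).filter (fun n => d ∣ n), w n * Gwt g ν n d|
      ≤ ∑ d ∈ Icc 1 ⌊x ^ (1 / 2 : ℝ)⌋₊, |∑ n ∈ (window x).filter (fun n => d ∣ n), w n * Gwt g ν n d| :=
        abs_sum_le_sum_abs _ _
    _ ≤ ∑ d ∈ Icc 1 ⌊x ^ (1 / 2 : ℝ)⌋₊, (C + 2 * C * max C' 0) * (d.divisors.card : ℝ) * |innerI w x I d| :=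
        sum_le_sum hper
    _ ≤ ∑ d ∈ Icc 1 ⌊x ^ (1 / 2 : ℝ)⌋₊,
          (C + 2 * C * max C' 0) * (((d.divisors.card : ℝ) ^ B) * |innerI w x I d|) := by
        refine sum_le_sum fun d hd => ?_
        rw [mul_assoc]
        apply mul_le_mul_of_nonneg_left _ hK0
        apply mul_le_mul_of_nonneg_right _ (abs_nonneg _)
        have hd0 : d ≠ 0 := by have := (mem_Icc.1 hd).1; omega
        have hτ : (1 : ℝ) ≤ d.divisors.card := by
          exact_mod_cast Finset.card_pos.2 ⟨d, Nat.mem_divisors_self d hd0⟩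
        exact Real.self_le_rpow_of_one_le hτ hB
    _ = (C + 2 * C * max C' 0) *
          ∑ d ∈ Icc 1 ⌊x ^ (1 / 2 : ℝ)⌋₊, ((d.divisors.card : ℝ) ^ B) * |innerI w x I d| := by rw [mul_sum]
    _ ≤ (C + 2 * C * max C' 0) * (x / Real.log x ^ B) := mul_le_mul_of_nonneg_left hTI hK0
    _ = (C + 2 * C * max C' 0) * x / Real.log x ^ B := by ring

def jumpSet {α : Type*} [DecidableEq α] (f : ℕ → α) (N : ℕ) : Finset ℕ :=
  (Ico 1 N).filter (fun k => f (k + 1) ≠ f k)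

theorem mem_jumpSet {α : Type*} [DecidableEq α] {f : ℕ → α} {N k : ℕ} :
    k ∈ jumpSet f N ↔ (1 ≤ k ∧ k < N) ∧ f (k + 1) ≠ f k := by
  unfold jumpSet; rw [mem_filter, mem_Ico]

theorem jumpSet_subset_of_eq {α β : Type*} [DecidableEq α] [DecidableEq β] {f : ℕ → α} {u : ℕ → β}
    (F : β → α) (hF : ∀ k, 1 ≤ k → f k = F (u k)) (N : ℕ) : jumpSet f N ⊆ jumpSet u N := by
  intro k hk
  rw [mem_jumpSet] at hk ⊢
  refine ⟨hk.1, fun h => hk.2 ?_⟩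
  rw [hF k hk.1.1, hF (k + 1) (by omega), h]

theorem jumpSet_pair_subset {α β : Type*} [DecidableEq α] [DecidableEq β] (a : ℕ → α) (b : ℕ → β)
    (N : ℕ) : jumpSet (fun k => (a k, b k)) N ⊆ jumpSet a N ∪ jumpSet b N := by
  intro k hk
  rw [mem_jumpSet] at hk
  rw [mem_union, mem_jumpSet, mem_jumpSet]
  by_cases ha : a (k + 1) = a k
  · right
    refine ⟨hk.1, fun hb => hk.2 ?_⟩
    rw [ha, hb]
  · left
    exact ⟨hk.1, ha⟩

theorem card_jumpSet_le_one_of_monotone {a : ℕ → Bool} (ha : ∀ k, 1 ≤ k → a k = true → a (k + 1) = true)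
    (N : ℕ) : (jumpSet a N).card ≤ 1 := by
  have hmono : ∀ k j, 1 ≤ k → k ≤ j → a k = true → a j = true := by
    intro k j hk hkj hak
    induction j, hkj using Nat.le_induction with
    | base => exact hak
    | succ j hkj ih => exact ha j (by omega) ih
  have hjump : ∀ k ∈ jumpSet a N, a k = false ∧ a (k + 1) = true := by
    intro k hk
    rw [mem_jumpSet] at hk
    by_cases h1 : a k = true
    · exact absurd ((ha k hk.1.1 h1).trans h1.symm) hk.2
    · have h1' : a k = false := by simpa using h1
      by_cases h2 : a (k + 1) = true
      · exact ⟨h1', h2⟩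
      · have h2' : a (k + 1) = false := by simpa using h2
        exact absurd (h2'.trans h1'.symm) hk.2
  refine Finset.card_le_one.2 fun k₁ hk₁ k₂ hk₂ => ?_
  by_contra hne
  rcases lt_or_gt_of_ne hne with h | h
  · have := hmono (k₁ + 1) k₂ (by omega) h (hjump k₁ hk₁).2
    rw [(hjump k₂ hk₂).1] at this
    exact Bool.false_ne_true this
  · have := hmono (k₂ + 1) k₁ (by omega) h (hjump k₂ hk₂).2
    rw [(hjump k₁ hk₁).1] at this
    exact Bool.false_ne_true this

theorem jumpSet_not (a : ℕ → Bool) (N : ℕ) : jumpSet (fun k => !a k) N = jumpSet a N := by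
  unfold jumpSet
  refine filter_congr fun k _ => ?_
  cases h1 : a (k + 1) <;> cases h2 : a k <;> simp [h1, h2]

theorem card_jumpSet_le_one_of_antitone {a : ℕ → Bool} (ha : ∀ k, 1 ≤ k → a (k + 1) = true → a k = true)
    (N : ℕ) : (jumpSet a N).card ≤ 1 := by
  rw [← jumpSet_not]
  apply card_jumpSet_le_one_of_monotone
  intro k hk h
  by_cases h1 : a (k + 1) = true
  · have h2 := ha k hk h1
    simp [h2] at h
  · simpa using h1

theorem card_jumpSet_le_of_antitone {f : ℕ → ℕ} {D : Finset ℕ} (hf : ∀ k, 1 ≤ k → f (k + 1) ≤ f k)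
    (hD : ∀ k, 1 ≤ k → f k ∈ D) (N : ℕ) : (jumpSet f N).card ≤ D.card := by
  have hanti : ∀ k j, 1 ≤ k → k ≤ j → f j ≤ f k := by
    intro k j hk hkj
    induction j, hkj using Nat.le_induction with
    | base => exact le_rfl
    | succ j hkj ih => exact (hf j (by omega)).trans ih
  have H : ∀ {k₁ k₂}, k₁ ∈ jumpSet f N → k₂ ∈ jumpSet f N → f k₁ = f k₂ → ¬ k₁ < k₂ := by
    intro k₁ k₂ hk₁ hk₂ hfe hlt
    rw [mem_jumpSet] at hk₁ hk₂
    have h1 : f (k₁ + 1) < f k₁ := lt_of_le_of_ne (hf k₁ hk₁.1.1) hk₁.2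
    have h2 : f k₂ ≤ f (k₁ + 1) := hanti (k₁ + 1) k₂ (by omega) hlt
    omega
  have hmaps : Set.MapsTo f ↑(jumpSet f N) ↑D := by
    intro k hk
    exact Finset.mem_coe.2 (hD k (mem_jumpSet.1 (Finset.mem_coe.1 hk)).1.1)
  have hinj : Set.InjOn f ↑(jumpSet f N) := by
    intro k₁ hk₁ k₂ hk₂ hfe
    rcases lt_trichotomy k₁ k₂ with h | h | h
    · exact absurd h (H (Finset.mem_coe.1 hk₁) (Finset.mem_coe.1 hk₂) hfe)
    · exact h
    · exact absurd h (H (Finset.mem_coe.1 hk₂) (Finset.mem_coe.1 hk₁) hfe.symm)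
  exact Finset.card_le_card_of_injOn f hmaps hinj

theorem card_jumpSet_le_two_of_ordConvex {s : ℕ → Bool}
    (hS : ∀ k₁ k₂ k₃, 1 ≤ k₁ → k₁ ≤ k₂ → k₂ ≤ k₃ → s k₁ = true → s k₃ = true → s k₂ = true) (N : ℕ) :
    (jumpSet s N).card ≤ 2 := by
  classical
  set α : ℕ → Bool := fun k => decide (∃ j, 1 ≤ j ∧ j ≤ k ∧ s j = true) with hα
  set β : ℕ → Bool := fun k => decide (∃ j, k ≤ j ∧ s j = true) with hβ
  have hF : ∀ k, 1 ≤ k → s k = ((α k, β k).1 && (α k, β k).2) := by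
    intro k hk
    simp only [hα, hβ]
    by_cases h : s k = true
    · have h1 : ∃ j, 1 ≤ j ∧ j ≤ k ∧ s j = true := ⟨k, hk, le_rfl, h⟩
      have h2 : ∃ j, k ≤ j ∧ s j = true := ⟨k, le_rfl, h⟩
      rw [h, decide_eq_true h1, decide_eq_true h2]; rfl
    · have h' : s k = false := by simpa using h
      rw [h']
      by_cases h1 : ∃ j, 1 ≤ j ∧ j ≤ k ∧ s j = true
      · have h2 : ¬ ∃ j, k ≤ j ∧ s j = true := by
          rintro ⟨j₂, hj₂, hS₂⟩
          obtain ⟨j₁, hj₁, hj₁k, hS₁⟩ := h1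
          exact h (hS j₁ k j₂ hj₁ hj₁k hj₂ hS₁ hS₂)
        rw [decide_eq_true h1, decide_eq_false h2]; rfl
      · rw [decide_eq_false h1]; rfl
  have hsub := jumpSet_subset_of_eq (f := s) (u := fun k => (α k, β k))
    (fun p : Bool × Bool => p.1 && p.2) hF N
  have hα1 : (jumpSet α N).card ≤ 1 := by
    apply card_jumpSet_le_one_of_monotone
    intro k hk h
    simp only [hα, decide_eq_true_eq] at h ⊢
    obtain ⟨j, hj, hjk, hSj⟩ := h
    exact ⟨j, hj, by omega, hSj⟩
  have hβ1 : (jumpSet β N).card ≤ 1 := by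
    apply card_jumpSet_le_one_of_antitone
    intro k hk h
    simp only [hβ, decide_eq_true_eq] at h ⊢
    obtain ⟨j, hj, hSj⟩ := h
    exact ⟨j, by omega, hSj⟩
  calc (jumpSet s N).card ≤ (jumpSet (fun k => (α k, β k)) N).card := card_le_card hsub
    _ ≤ (jumpSet α N ∪ jumpSet β N).card := card_le_card (jumpSet_pair_subset α β N)
    _ ≤ (jumpSet α N).card + (jumpSet β N).card := card_union_le _ _
    _ ≤ 2 := by omega

def gval (g : VecFn) (n e : ℕ) : ℝ := g e.primeFactorsList.length (pvec n e)

theorem Gwt_eq_gval (g : VecFn) (ν : ℝ) (n m : ℕ) :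
    Gwt g ν n m = if (m : ℝ) ≤ (n : ℝ) ^ (1 / 2 : ℝ) then
      ((ArithmeticFunction.moebius (m / roughPart ((n : ℝ) ^ ν) m) : ℤ) : ℝ) *
        gval g n (roughPart ((n : ℝ) ^ ν) m)
      else 0 := rfl

theorem roughPart_dvd_of_le {y y' : ℝ} (h : y ≤ y') (d : ℕ) : roughPart y' d ∣ roughPart y d := by
  unfold roughPart
  apply Finset.prod_dvd_prod_of_subset
  intro p hp
  rw [mem_filter] at hp ⊢
  exact ⟨hp.1, h.trans hp.2⟩

theorem pvec_mem_between {e : ℕ} {Pj : Set (Fin e.primeFactorsList.length → ℝ)} (hP : IsConvexPolytope Pj)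
    {n₁ n₂ n₃ : ℕ} (h1 : 1 < n₁) (h12 : n₁ ≤ n₂) (h23 : n₂ ≤ n₃)
    (hm1 : pvec n₁ e ∈ Pj) (hm3 : pvec n₃ e ∈ Pj) : pvec n₂ e ∈ Pj := by
  obtain ⟨-, S, T, rfl⟩ := hP
  simp only [Set.mem_setOf_eq] at hm1 hm3 ⊢
  have hL1 : 0 < Real.log n₁ := Real.log_pos (by exact_mod_cast h1)
  have hL12 : Real.log n₁ ≤ Real.log n₂ := Real.log_le_log (by positivity) (by exact_mod_cast h12)
  have hL23 : Real.log n₂ ≤ Real.log n₃ :=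
    Real.log_le_log (by exact_mod_cast (show 0 < n₂ by omega)) (by exact_mod_cast h23)
  have hL2 : 0 < Real.log n₂ := lt_of_lt_of_le hL1 hL12
  have hL3 : 0 < Real.log n₃ := lt_of_lt_of_le hL2 hL23
  have key : ∀ (cv : Fin e.primeFactorsList.length → ℝ) (n : ℕ),
      ∑ i, cv i * pvec n e i = (∑ i, cv i * Real.log (e.primeFactorsList.get i)) / Real.log n := by
    intro cv n
    rw [Finset.sum_div]
    refine sum_congr rfl fun i _ => ?_
    simp only [pvec]
    ring
  have mono : ∀ (A : ℝ), A / Real.log n₂ ≤ A / Real.log n₁ ∨ A / Real.log n₂ ≤ A / Real.log n₃ := by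
    intro A
    rcases le_or_gt 0 A with hA | hA
    · exact Or.inl (div_le_div_of_nonneg_left hA hL1 hL12)
    · right
      rw [div_le_div_iff₀ hL2 hL3]
      nlinarith [mul_nonneg (neg_nonneg.2 hA.le) (sub_nonneg.2 hL23)]
  constructor
  · intro cv hc
    have a1 := hm1.1 cv hc
    have a3 := hm3.1 cv hc
    rw [key] at a1 a3 ⊢
    rcases mono (∑ i, cv.1 i * Real.log (e.primeFactorsList.get i)) with h | h
    · exact lt_of_le_of_lt h a1
    · exact lt_of_le_of_lt h a3
  · intro cv hc
    have a1 := hm1.2 cv hc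
    have a3 := hm3.2 cv hc
    rw [key] at a1 a3 ⊢
    rcases mono (∑ i, cv.1 i * Real.log (e.primeFactorsList.get i)) with h | h
    · exact h.trans a1
    · exact h.trans a3

theorem weight_jumps : Signature.weightJumps := by
  intro ν hν hν4 g hadm
  have hadm' := hadm
  obtain ⟨-, hpc, hg0, hsupp, -⟩ := hadm
  choose Mnum P c hP hg using hpc
  set K₀ : ℕ := ⌊1 / ν⌋₊ with hK₀
  set Mmax : ℕ := ∑ K ∈ range (K₀ + 1), Mnum K with hMmax
  refine ⟨2 + 2 * (Mmax : ℝ), fun m hm N => ?_⟩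
  classical
  have hm0 : m ≠ 0 := by omega
  have hτ1 : 1 ≤ m.divisors.card := Finset.card_pos.2 ⟨m, Nat.mem_divisors_self m hm0⟩
  rcases eq_or_lt_of_le hm with hm1 | hm2
  · subst hm1
    have h0 : ((Ico 1 N).filter (fun k : ℕ => Gwt g ν (1 * (k + 1)) 1 ≠ Gwt g ν (1 * k) 1)).card = 0 := by
      rw [Finset.card_eq_zero, Finset.filter_eq_empty_iff]
      intro k hk
      rw [mem_Ico] at hk
      rw [not_not, Gwt_one hadm' (by omega), Gwt_one hadm' (by omega)]
    rw [h0]; push_cast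
    have : (0 : ℝ) ≤ Mmax := Nat.cast_nonneg _
    have : (1 : ℝ) ≤ (Nat.divisors 1).card := by exact_mod_cast hτ1
    nlinarith
  set b : ℕ → Bool := fun k => decide ((m : ℝ) ≤ ((m * k : ℕ) : ℝ) ^ (1 / 2 : ℝ)) with hb
  set d₂ : ℕ → ℕ := fun k => roughPart (((m * k : ℕ) : ℝ) ^ ν) m with hd₂
  set χ : (e : ℕ) → Fin (Mnum e.primeFactorsList.length) → ℕ → Bool :=
    fun e j k => decide (pvec (m * k) e ∈ P _ j) with hχ
  have hd₂pos : ∀ k, d₂ k ≠ 0 := fun k h0 =>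
    hm0 (Nat.eq_zero_of_zero_dvd (h0 ▸ roughPart_dvd _ hm0))
  have hgK : ∀ (K : ℕ) (x : Fin K → ℝ), g K x ≠ 0 → K ≤ K₀ := by
    intro K x h
    rcases hsupp K x h with h1 | ⟨h2, h3⟩
    · rw [h1]; exact Nat.zero_le _
    · by_contra hk
      have hkpos : 0 < K := by omega
      have hlt : (K : ℝ) * ν < 1 / 2 := by
        calc (K : ℝ) * ν = ∑ _i : Fin K, ν := by simp
          _ < ∑ i, x i := by
              apply Finset.sum_lt_sum_of_nonempty
              · exact Finset.univ_nonempty_iff.2 ⟨⟨0, hkpos⟩⟩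
              · intro i _; exact h2 i
          _ ≤ 1 / 2 := h3
      apply hk
      apply Nat.le_floor
      rw [le_div_iff₀ hν]
      linarith
  have hG : ∀ k', Gwt g ν (m * k') m = if (m : ℝ) ≤ ((m * k' : ℕ) : ℝ) ^ (1 / 2 : ℝ) then
      ((ArithmeticFunction.moebius (m / d₂ k') : ℤ) : ℝ) * gval g (m * k') (d₂ k') else 0 :=
    fun k' => Gwt_eq_gval g ν (m * k') m
  have hincl : jumpSet (fun k => Gwt g ν (m * k) m) N ⊆
      (jumpSet b N ∪ jumpSet d₂ N) ∪
        (m.divisors.filter (fun e => e.primeFactorsList.length ≤ K₀)).biUnion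
          (fun e => (univ : Finset (Fin (Mnum e.primeFactorsList.length))).biUnion
            (fun j => jumpSet (χ e j) N)) := by
    intro k hk
    rw [mem_jumpSet] at hk
    obtain ⟨⟨hk1, hkN⟩, hne⟩ := hk
    rw [mem_union, mem_union]
    by_cases hbk : b (k + 1) = b k
    swap
    · exact Or.inl (Or.inl (mem_jumpSet.2 ⟨⟨hk1, hkN⟩, hbk⟩))
    by_cases hdk : d₂ (k + 1) = d₂ k
    swap
    · exact Or.inl (Or.inr (mem_jumpSet.2 ⟨⟨hk1, hkN⟩, hdk⟩))
    right
    have hPQ : ((m : ℝ) ≤ ((m * (k + 1) : ℕ) : ℝ) ^ (1 / 2 : ℝ)) ↔ ((m : ℝ) ≤ ((m * k : ℕ) : ℝ) ^ (1 / 2 : ℝ)) := by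
      simpa [hb] using hbk
    rw [hG, hG, hdk] at hne
    by_cases hQ : (m : ℝ) ≤ ((m * k : ℕ) : ℝ) ^ (1 / 2 : ℝ)
    swap
    · rw [if_neg hQ, if_neg (fun h => hQ (hPQ.1 h))] at hne
      exact absurd rfl hne
    rw [if_pos hQ, if_pos (hPQ.2 hQ)] at hne
    have hgne : gval g (m * (k + 1)) (d₂ k) ≠ gval g (m * k) (d₂ k) := fun h => hne (by rw [h])
    have hediv : d₂ k ∈ m.divisors := Nat.mem_divisors.2 ⟨roughPart_dvd _ hm0, hm0⟩
    have hK : (d₂ k).primeFactorsList.length ≤ K₀ := by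
      by_cases h1 : gval g (m * k) (d₂ k) = 0
      · have h2 : gval g (m * (k + 1)) (d₂ k) ≠ 0 := by rw [h1] at hgne; exact hgne
        exact hgK _ _ h2
      · exact hgK _ _ h1
    rw [mem_biUnion]
    refine ⟨d₂ k, mem_filter.2 ⟨hediv, hK⟩, ?_⟩
    rw [mem_biUnion]
    have hex : ∀ n, gval g n (d₂ k) = ∑ j, if pvec n (d₂ k) ∈ P _ j then c _ j else 0 := fun n =>
      hg _ (pvec n (d₂ k)) (pvec_monotone_all n (d₂ k))
    rw [hex, hex] at hgne
    by_contra hall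
    apply hgne
    refine sum_congr rfl fun j _ => ?_
    have hj' : χ (d₂ k) j (k + 1) = χ (d₂ k) j k := by
      by_contra h
      exact hall ⟨j, mem_univ j, mem_jumpSet.2 ⟨⟨hk1, hkN⟩, h⟩⟩
    have hiff : pvec (m * (k + 1)) (d₂ k) ∈ P _ j ↔ pvec (m * k) (d₂ k) ∈ P _ j := by
      simpa [hχ] using hj'
    by_cases hp : pvec (m * k) (d₂ k) ∈ P _ j
    · rw [if_pos hp, if_pos (hiff.2 hp)]
    · rw [if_neg hp, if_neg (fun h => hp (hiff.1 h))]
  have hb1 : (jumpSet b N).card ≤ 1 := by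
    apply card_jumpSet_le_one_of_monotone
    intro k hk h
    simp only [hb, decide_eq_true_eq] at h ⊢
    refine h.trans ?_
    apply Real.rpow_le_rpow (Nat.cast_nonneg _) _ (by norm_num)
    exact_mod_cast Nat.mul_le_mul_left m (Nat.le_succ k)
  have hd1 : (jumpSet d₂ N).card ≤ m.divisors.card := by
    apply card_jumpSet_le_of_antitone
    · intro k hk
      have hdvd : d₂ (k + 1) ∣ d₂ k := by
        simp only [hd₂]
        apply roughPart_dvd_of_le
        apply Real.rpow_le_rpow (Nat.cast_nonneg _) _ hν.le
        exact_mod_cast Nat.mul_le_mul_left m (Nat.le_succ k)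
      exact Nat.le_of_dvd (Nat.pos_of_ne_zero (hd₂pos k)) hdvd
    · intro k hk
      exact Nat.mem_divisors.2 ⟨roughPart_dvd _ hm0, hm0⟩
  have hχ2 : ∀ e ∈ m.divisors, ∀ j : Fin (Mnum e.primeFactorsList.length),
      (jumpSet (χ e j) N).card ≤ 2 := by
    intro e he j
    apply card_jumpSet_le_two_of_ordConvex
    intro k₁ k₂ k₃ hk₁ h12 h23 hS₁ hS₃
    simp only [hχ, decide_eq_true_eq] at hS₁ hS₃ ⊢
    have hn1 : 1 < m * k₁ := by nlinarith
    exact pvec_mem_between (hP _ j).1 hn1 (Nat.mul_le_mul_left m h12) (Nat.mul_le_mul_left m h23) hS₁ hS₃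
  have hMle : ∀ e ∈ m.divisors.filter (fun e => e.primeFactorsList.length ≤ K₀),
      ((univ : Finset (Fin (Mnum e.primeFactorsList.length))).biUnion (fun j => jumpSet (χ e j) N)).card
        ≤ 2 * Mmax := by
    intro e he
    rw [mem_filter] at he
    calc _ ≤ ∑ j : Fin (Mnum e.primeFactorsList.length), (jumpSet (χ e j) N).card := card_biUnion_le
      _ ≤ ∑ _j : Fin (Mnum e.primeFactorsList.length), 2 := sum_le_sum fun j _ => hχ2 e he.1 j
      _ = 2 * Mnum e.primeFactorsList.length := by simp [mul_comm]
      _ ≤ 2 * Mmax := by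
          apply Nat.mul_le_mul_left
          exact single_le_sum (f := Mnum) (fun K _ => Nat.zero_le _)
            (mem_range.2 (Nat.lt_succ_of_le he.2))
  have hcardN : (jumpSet (fun k => Gwt g ν (m * k) m) N).card
      ≤ 1 + m.divisors.card + m.divisors.card * (2 * Mmax) := by
    calc _ ≤ ((jumpSet b N ∪ jumpSet d₂ N) ∪
          (m.divisors.filter (fun e => e.primeFactorsList.length ≤ K₀)).biUnion
            (fun e => (univ : Finset (Fin (Mnum e.primeFactorsList.length))).biUnion
              (fun j => jumpSet (χ e j) N))).card := card_le_card hincl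
      _ ≤ (jumpSet b N ∪ jumpSet d₂ N).card +
          ((m.divisors.filter (fun e => e.primeFactorsList.length ≤ K₀)).biUnion
            (fun e => (univ : Finset (Fin (Mnum e.primeFactorsList.length))).biUnion
              (fun j => jumpSet (χ e j) N))).card := card_union_le _ _
      _ ≤ ((jumpSet b N).card + (jumpSet d₂ N).card) +
          ∑ e ∈ m.divisors.filter (fun e => e.primeFactorsList.length ≤ K₀),
            ((univ : Finset (Fin (Mnum e.primeFactorsList.length))).biUnion
              (fun j => jumpSet (χ e j) N)).card := add_le_add (card_union_le _ _) card_biUnion_le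
      _ ≤ (1 + m.divisors.card) +
          ∑ _e ∈ m.divisors.filter (fun e => e.primeFactorsList.length ≤ K₀), 2 * Mmax :=
          add_le_add (add_le_add hb1 hd1) (sum_le_sum hMle)
      _ ≤ 1 + m.divisors.card + m.divisors.card * (2 * Mmax) := by
          rw [sum_const, smul_eq_mul]
          apply Nat.add_le_add_left
          exact Nat.mul_le_mul_right _ (card_filter_le _ _)
  have hreal : ((jumpSet (fun k => Gwt g ν (m * k) m) N).card : ℝ)
      ≤ 1 + m.divisors.card + m.divisors.card * (2 * Mmax) := by exact_mod_cast hcardN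
  have hτ : (1 : ℝ) ≤ m.divisors.card := by exact_mod_cast hτ1
  have hM0 : (0 : ℝ) ≤ Mmax := Nat.cast_nonneg _
  calc (((Ico 1 N).filter (fun k : ℕ => Gwt g ν (m * (k + 1)) m ≠ Gwt g ν (m * k) m)).card : ℝ)
      = ((jumpSet (fun k => Gwt g ν (m * k) m) N).card : ℝ) := by rfl
    _ ≤ 1 + m.divisors.card + m.divisors.card * (2 * Mmax) := hreal
    _ ≤ (2 + 2 * (Mmax : ℝ)) * (m.divisors.card : ℝ) := by nlinarith

theorem typeI_term : Signature.typeITerm := typeITerm_of_jumps weight_jumps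

theorem sieve_lower {ν x M : ℝ} {g : VecFn} {a : ℕ → ℝ}
    (hP : ∀ p : ℕ, p.Prime → Hwt g ν p = 1)
    (hN : ∀ n : ℕ, 2 ≤ n → ¬ n.Prime → IsRough ν n → ¬ IsExc n → Hwt g ν n ≤ 0)
    (hM : ∀ n : ℕ, 2 ≤ n → IsRough ν n → |Hwt g ν n| ≤ M)
    (ha : ∀ n, 0 ≤ a n) :
    ((windowPrimes x).card : ℝ) + ∑ n ∈ Nset ν x, Hwt g ν n
      - |∑ n ∈ window x, (a n - 1) * Hwt g ν n| - |∑ n ∈ Rset ν x, (a n - 1) * Hwt g ν n|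
      - M * ∑ n ∈ Eset ν x, a n ≤ ∑ p ∈ windowPrimes x, a p := by
  classical
  set H := Hwt g ν with hH
  set f : ℕ → ℝ := fun n => (a n - 1) * H n with hf
  have hsplit1 := (sum_filter_add_sum_filter_not (window x) Nat.Prime f)
  rw [filter_prime_window] at hsplit1
  have hNeq : ((window x).filter (fun n => ¬ n.Prime)).filter (fun n => 2 ≤ n ∧ IsRough ν n) = Nset ν x := by
    ext n; rw [mem_filter, mem_filter, mem_Nset]; tauto
  have hReq : ((window x).filter (fun n => ¬ n.Prime)).filter (fun n => ¬ (2 ≤ n ∧ IsRough ν n)) = Rset ν x := by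
    ext n; rw [mem_filter, mem_filter, mem_Rset]; tauto
  have hsplit2 := (sum_filter_add_sum_filter_not ((window x).filter (fun n => ¬ n.Prime))
    (fun n => 2 ≤ n ∧ IsRough ν n) f)
  rw [hNeq, hReq] at hsplit2
  have hprime : ∑ p ∈ windowPrimes x, f p = ∑ p ∈ windowPrimes x, a p - ((windowPrimes x).card : ℝ) := by
    have : ∀ p ∈ windowPrimes x, f p = a p - 1 := by
      intro p hp
      rw [mem_windowPrimes] at hp
      simp [hf, hP p hp.1]
    rw [sum_congr rfl this, sum_sub_distrib, sum_const, nsmul_eq_mul, mul_one]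
  have hNsum : ∑ n ∈ Nset ν x, f n = ∑ n ∈ Nset ν x, a n * H n - ∑ n ∈ Nset ν x, H n := by
    rw [← sum_sub_distrib]
    exact sum_congr rfl fun n _ => by simp [hf]; ring
  have hEeq : (Nset ν x).filter IsExc = Eset ν x := by
    ext n; rw [mem_filter, mem_Eset]
  have hNa : ∑ n ∈ Nset ν x, a n * H n ≤ M * ∑ n ∈ Eset ν x, a n := by
    rw [← sum_filter_add_sum_filter_not (Nset ν x) IsExc, hEeq, mul_sum]
    have h1 : ∑ n ∈ Eset ν x, a n * H n ≤ ∑ n ∈ Eset ν x, M * a n := by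
      refine sum_le_sum fun n hn => ?_
      obtain ⟨hnN, -⟩ := mem_Eset.1 hn
      obtain ⟨-, h2, -, hr⟩ := mem_Nset.1 hnN
      have := hM n h2 hr
      rw [mul_comm M]
      exact mul_le_mul_of_nonneg_left (le_of_abs_le this) (ha n)
    have h2 : ∑ n ∈ (Nset ν x).filter (fun n => ¬ IsExc n), a n * H n ≤ 0 := by
      refine sum_nonpos fun n hn => ?_
      rw [mem_filter, mem_Nset] at hn
      obtain ⟨⟨-, h2, hp, hr⟩, he⟩ := hn
      exact mul_nonpos_of_nonneg_of_nonpos (ha n) (hN n h2 hp hr he)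
    linarith
  have habsW := neg_abs_le (∑ n ∈ window x, f n)
  have habsR := le_abs_self (∑ n ∈ Rset ν x, f n)
  linarith

def symmExt (g₀ : VecFn) : VecFn := fun k x => g₀ k (x ∘ ⇑(Tuple.sort x))

theorem symmExt_perm (g₀ : VecFn) (k : ℕ) (σ : Equiv.Perm (Fin k)) (x : Fin k → ℝ) :
    symmExt g₀ k (x ∘ σ) = symmExt g₀ k x := by
  simp only [symmExt]
  rw [Tuple.comp_perm_comp_sort_eq_comp_sort]

theorem isSymmetric_symmExt (g₀ : VecFn) : (symmExt g₀).IsSymmetric :=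
  fun k σ x => symmExt_perm g₀ k σ x

theorem symmExt_of_monotone (g₀ : VecFn) {k : ℕ} {x : Fin k → ℝ} (hx : Monotone x) :
    symmExt g₀ k x = g₀ k x := by
  simp only [symmExt]
  rw [Tuple.sort_eq_refl_iff_monotone.mpr hx]
  simp

theorem starSum_symmExt_of_monotone (g₀ : VecFn) {k : ℕ} {x : Fin k → ℝ} (hx : Monotone x) :
    starSum (symmExt g₀) k x = starSum g₀ k x := by
  unfold starSum
  refine Finset.sum_congr rfl fun A _ => ?_
  exact symmExt_of_monotone g₀ (hx.comp (A.orderEmbOfFin rfl).monotone)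

theorem sieveBoundG1_symmExt (ν : ℝ) (g₀ : VecFn) :
    sieveBoundG1 ν (symmExt g₀) = sieveBoundG1 ν g₀ := by
  unfold sieveBoundG1
  congr 1
  refine Finset.sum_congr rfl fun k _ => ?_
  congr 1
  funext x
  split_ifs with h
  · rw [starSum_symmExt_of_monotone g₀ h.2]
  · rfl

theorem isPiecewiseConstOnCone_symmExt {g₀ : VecFn} (h : IsPiecewiseConstOnCone g₀) :
    IsPiecewiseConstOnCone (symmExt g₀) := by
  intro k
  obtain ⟨m, P, c, hP, hg⟩ := h k
  exact ⟨m, P, c, hP, fun x hx => by rw [symmExt_of_monotone g₀ hx]; exact hg x hx⟩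

theorem supportClosed_symmExt {ν : ℝ} {g₀ : VecFn}
    (h : ∀ (k : ℕ) (x : Fin k → ℝ), Monotone x → g₀ k x ≠ 0 →
      k = 0 ∨ ((∀ i, ν < x i) ∧ ∑ i, x i ≤ 1 / 2)) :
    ∀ (k : ℕ) (x : Fin k → ℝ), symmExt g₀ k x ≠ 0 →
      k = 0 ∨ ((∀ i, ν < x i) ∧ ∑ i, x i ≤ 1 / 2) := by
  intro k x hne
  have hmono : Monotone (x ∘ ⇑(Tuple.sort x)) := Tuple.monotone_sort x
  rcases h k _ hmono hne with h0 | ⟨hall, hsum⟩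
  · exact Or.inl h0
  · refine Or.inr ⟨fun i => ?_, ?_⟩
    · simpa using hall ((Tuple.sort x).symm i)
    · have : (∑ i, (x ∘ ⇑(Tuple.sort x)) i) = ∑ i, x i := by
        simp only [Function.comp_apply]
        exact Equiv.sum_comp (Tuple.sort x) x
      rwa [this] at hsum

theorem apply_orderEmb_cast (g : VecFn) {k : ℕ} (x : Fin k → ℝ) (B : Finset (Fin k)) {n : ℕ}
    (h : B.card = n) :
    g n (fun i => x (B.orderEmbOfFin h i)) = g B.card (fun i => x (B.orderEmbOfFin rfl i)) := by
  subst h; rfl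

theorem apply_comp_eq_of_range {g : VecFn} (hs : g.IsSymmetric) {k : ℕ} (x : Fin k → ℝ)
    (B : Finset (Fin k)) {n : ℕ} (hB : B.card = n) (f : Fin n → Fin k)
    (hf : Function.Injective f) (hmem : ∀ i, f i ∈ B) :
    g n (x ∘ f) = g n (fun i => x (B.orderEmbOfFin hB i)) := by
  let π₀ : Fin n → Fin n := fun i => (B.orderIsoOfFin hB).symm ⟨f i, hmem i⟩
  have hπ₀ : Function.Injective π₀ := by
    intro i j hij
    have h1 := congrArg (fun t => ((B.orderIsoOfFin hB) t : Fin k)) hij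
    simp only [π₀, OrderIso.apply_symm_apply] at h1
    exact hf h1
  let π : Equiv.Perm (Fin n) := Equiv.ofBijective π₀ (Finite.injective_iff_bijective.mp hπ₀)
  have hcomp : (fun i => x (B.orderEmbOfFin hB i)) ∘ ⇑π = x ∘ f := by
    funext i
    simp only [Function.comp_apply, π, Equiv.ofBijective_apply, π₀]
    rw [← Finset.coe_orderIsoOfFin_apply, OrderIso.apply_symm_apply]
  rw [← hcomp, hs n π]

theorem starSum_perm {g : VecFn} (hs : g.IsSymmetric) (k : ℕ) (σ : Equiv.Perm (Fin k))
    (x : Fin k → ℝ) : starSum g k (x ∘ σ) = starSum g k x := by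
  unfold starSum
  rw [← Equiv.sum_comp (Equiv.finsetCongr σ)
    (fun B : Finset (Fin k) => g B.card (fun i => x (B.orderEmbOfFin rfl i)))]
  refine Finset.sum_congr rfl fun A _ => ?_
  have hB : ((Equiv.finsetCongr σ) A).card = A.card := by
    simp only [Equiv.finsetCongr_apply, Finset.card_map]
  have hmem : ∀ i, (⇑σ ∘ ⇑(A.orderEmbOfFin rfl)) i ∈ (Equiv.finsetCongr σ) A := by
    intro i
    simp only [Function.comp_apply, Equiv.finsetCongr_apply, Finset.mem_map_equiv,
      Equiv.symm_apply_apply]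
    exact A.orderEmbOfFin_mem rfl i
  have key := apply_comp_eq_of_range hs x ((Equiv.finsetCongr σ) A) hB
    (⇑σ ∘ ⇑(A.orderEmbOfFin rfl)) (σ.injective.comp (A.orderEmbOfFin rfl).injective) hmem
  rw [apply_orderEmb_cast g x ((Equiv.finsetCongr σ) A) hB] at key
  exact key

theorem dim_le_six {k : ℕ} {x : Fin k → ℝ} (hbox : ∀ i, (1651 / 10000 : ℝ) < x i)
    (hsum : ∑ i, x i = 1) : k ≤ 6 := by
  by_contra hk
  have hk7 : 7 ≤ k := by omega
  have hlt : ∑ _i : Fin k, (1651 / 10000 : ℝ) < ∑ i, x i := by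
    haveI : Nonempty (Fin k) := ⟨⟨0, by omega⟩⟩
    exact Finset.sum_lt_sum_of_nonempty Finset.univ_nonempty fun i _ => hbox i
  rw [Finset.sum_const, Finset.card_univ, Fintype.card_fin, nsmul_eq_mul, hsum] at hlt
  have : (7 : ℝ) ≤ k := by exact_mod_cast hk7
  nlinarith

theorem starSum_nonpos_of_cone {g₀ : VecFn}
    (hH : ∀ k : ℕ, 2 ≤ k → k ≤ 6 → ∀ x : Fin k → ℝ, Monotone x →
      (∀ i, (1651 / 10000 : ℝ) < x i ∧ x i < 1 - 1651 / 10000) → ∑ i, x i = 1 →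
        starSum g₀ k x ≤ 0) :
    ∀ k : ℕ, 2 ≤ k → ∀ x : Fin k → ℝ,
      (∀ i, (1651 / 10000 : ℝ) < x i ∧ x i < 1 - 1651 / 10000) → ∑ i, x i = 1 →
        starSum (symmExt g₀) k x ≤ 0 := by
  intro k hk x hbox hsum
  have hk6 : k ≤ 6 := dim_le_six (fun i => (hbox i).1) hsum
  rw [← starSum_perm (isSymmetric_symmExt g₀) k (Tuple.sort x) x,
    starSum_symmExt_of_monotone g₀ (Tuple.monotone_sort x)]
  refine hH k hk hk6 _ (Tuple.monotone_sort x) (fun i => hbox _) ?_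
  have : (∑ i, (x ∘ ⇑(Tuple.sort x)) i) = ∑ i, x i := by
    simp only [Function.comp_apply]
    exact Equiv.sum_comp (Tuple.sort x) x
  rw [this, hsum]

theorem card_windowPrimes_eq {x : ℝ} (hx : 0 ≤ x) :
    ((windowPrimes x).card : ℝ) = (Nat.primeCounting ⌊x⌋₊ : ℝ) - (Nat.primeCounting ⌊x / 2⌋₊ : ℝ) := by
  have hsplit := card_filter_add_card_filter_not (s := Nat.primesLE ⌊x⌋₊)
    (fun p : ℕ => x / 2 < (p : ℝ))
  have hneg : (Nat.primesLE ⌊x⌋₊).filter (fun p : ℕ => ¬ (x / 2 < (p : ℝ))) = Nat.primesLE ⌊x / 2⌋₊ := by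
    ext p
    simp only [mem_filter, Nat.mem_primesLE, not_lt]
    constructor
    · rintro ⟨⟨-, hp⟩, hle⟩
      exact ⟨Nat.le_floor hle, hp⟩
    · rintro ⟨hle, hp⟩
      have h2 : (p : ℝ) ≤ x / 2 := (Nat.cast_le.2 hle).trans (Nat.floor_le (by positivity))
      exact ⟨⟨Nat.le_floor (h2.trans (by linarith)), hp⟩, h2⟩
  rw [hneg, Nat.primesLE_card_eq_primeCounting, Nat.primesLE_card_eq_primeCounting] at hsplit
  have : ((windowPrimes x).card : ℝ) + (Nat.primeCounting ⌊x / 2⌋₊ : ℝ) = (Nat.primeCounting ⌊x⌋₊ : ℝ) := by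
    rw [windowPrimes]; exact_mod_cast hsplit
  linarith

theorem chebyshev_window : ∃ x₀ : ℝ, ∀ x : ℝ, x₀ ≤ x → x / (3 * Real.log x) ≤ ((windowPrimes x).card : ℝ) := by
  obtain ⟨x₁, hx₁⟩ :=
    Literature.Barriers.Parity.FriedlanderGranville.primeCounting_bounds (ε := 1 / 20) (by norm_num)
  refine ⟨max (2 * x₁) ((2 : ℝ) ^ 16), fun x hx => ?_⟩
  have hbig : (2 : ℝ) ^ 16 ≤ x := (le_max_right _ _).trans hx
  have h2x₁ : 2 * x₁ ≤ x := (le_max_left _ _).trans hx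
  have hx0 : 0 < x := lt_of_lt_of_le (by norm_num) hbig
  have hx1 : x₁ ≤ x := by
    rcases le_or_gt 0 x₁ with h | h
    · linarith
    · linarith
  have hx1' : x₁ ≤ x / 2 := by linarith
  have hlog2 : 0 < Real.log 2 := Real.log_pos (by norm_num)
  have hL : 16 * Real.log 2 ≤ Real.log x := by
    have h := Real.log_le_log (by positivity) hbig
    rw [Real.log_pow] at h
    push_cast at h
    exact h
  have hLx : 0 < Real.log x := by linarith
  have hsub : Real.log (x / 2) = Real.log x - Real.log 2 := Real.log_div hx0.ne' two_ne_zero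
  have hL2pos : 0 < Real.log x - Real.log 2 := by linarith
  set X : ℝ := x / Real.log x with hX
  have hX0 : 0 ≤ X := div_nonneg hx0.le hLx.le
  set Y : ℝ := x / 2 / Real.log (x / 2) with hY
  have hA := abs_le.1 (hx₁ x hx1)
  have hB := abs_le.1 (hx₁ (x / 2) hx1')
  have hYX : Y ≤ 8 / 15 * X := by
    rw [hY, hsub, div_le_iff₀ hL2pos, hX]
    have h1516 : 15 / 16 * Real.log x ≤ Real.log x - Real.log 2 := by linarith
    calc x / 2 = 8 / 15 * (x / Real.log x) * (15 / 16 * Real.log x) := by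
          field_simp; ring
      _ ≤ 8 / 15 * (x / Real.log x) * (Real.log x - Real.log 2) :=
          mul_le_mul_of_nonneg_left h1516 (by positivity)
  have hcard := card_windowPrimes_eq hx0.le
  have hX3 : x / (3 * Real.log x) = X / 3 := by rw [hX]; ring
  rw [hX3, hcard]
  linarith [hA.1, hB.2]

theorem eventually_small {ν η : ℝ} (hν : 0 < ν) (hη : 0 < η) :
    ∃ x₁ : ℝ, ∀ x : ℝ, x₁ ≤ x → 4 ≤ x ∧ 1 ≤ Real.log x ∧
      x ^ (1 - ν) ≤ η * x / Real.log x ∧ x / Real.log x ^ (2 : ℕ) ≤ η * x / Real.log x := by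
  have h1 : ∀ᶠ x : ℝ in Filter.atTop, ‖Real.log x‖ ≤ η * ‖x ^ ν‖ :=
    (isLittleO_log_rpow_atTop hν).bound hη
  have h2 : ∀ᶠ x : ℝ in Filter.atTop, (4 : ℝ) ≤ x := Filter.eventually_ge_atTop 4
  have h3 : ∀ᶠ x : ℝ in Filter.atTop, Real.exp 1 ≤ x := Filter.eventually_ge_atTop _
  have h4 : ∀ᶠ x : ℝ in Filter.atTop, Real.exp (1 / η) ≤ x := Filter.eventually_ge_atTop _
  obtain ⟨x₁, hx₁⟩ := Filter.eventually_atTop.1 (h1.and (h2.and (h3.and h4)))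
  refine ⟨x₁, fun x hx => ?_⟩
  obtain ⟨hlog, h4x, hex, heη⟩ := hx₁ x hx
  have hx0 : 0 < x := by linarith
  have hL1 : 1 ≤ Real.log x := by
    rw [← Real.log_exp 1]; exact Real.log_le_log (Real.exp_pos 1) hex
  have hL0 : 0 < Real.log x := by linarith
  refine ⟨h4x, hL1, ?_, ?_⟩
  · rw [le_div_iff₀ hL0]
    rw [Real.norm_eq_abs, Real.norm_eq_abs, abs_of_pos hL0, abs_of_pos (Real.rpow_pos_of_pos hx0 ν)] at hlog
    have hsplit : x ^ (1 - ν) * x ^ ν = x := by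
      rw [← Real.rpow_add hx0]; norm_num
    calc x ^ (1 - ν) * Real.log x ≤ x ^ (1 - ν) * (η * x ^ ν) :=
          mul_le_mul_of_nonneg_left hlog (Real.rpow_nonneg hx0.le _)
      _ = η * (x ^ (1 - ν) * x ^ ν) := by ring
      _ = η * x := by rw [hsplit]
  · have hL2 : 1 / η ≤ Real.log x := by
      rw [← Real.log_exp (1 / η)]; exact Real.log_le_log (Real.exp_pos _) heη
    have hinv : 1 / Real.log x ≤ η := by
      rw [div_le_iff₀ hL0]
      rw [div_le_iff₀ hη] at hL2
      linarith
    have hsplit : x / Real.log x ^ (2 : ℕ) = (x / Real.log x) * (1 / Real.log x) := by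
      rw [div_mul_div_comm, mul_one, pow_two]
    rw [hsplit]
    calc x / Real.log x * (1 / Real.log x) ≤ x / Real.log x * η :=
          mul_le_mul_of_nonneg_left hinv (div_nonneg hx0.le hL0.le)
      _ = η * x / Real.log x := by ring

theorem sum_log_eq_log_prod : ∀ (l : List ℕ), (∀ p ∈ l, 0 < p) →
    (l.map (fun p : ℕ => Real.log p)).sum = Real.log ((l.prod : ℕ) : ℝ)
  | [], _ => by simp
  | (p :: l), h => by
      have hp : 0 < p := h p (by simp)
      have hl : ∀ q ∈ l, 0 < q := fun q hq => h q (by simp [hq])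
      have hprod : 0 < l.prod := List.prod_pos hl
      rw [List.map_cons, List.sum_cons, List.prod_cons, Nat.cast_mul,
        Real.log_mul (by exact_mod_cast hp.ne') (by exact_mod_cast hprod.ne'), sum_log_eq_log_prod l hl]

theorem sum_pvec {n d : ℕ} (hd : d ≠ 0) : ∑ i, pvec n d i = Real.log d / Real.log n := by
  unfold pvec
  rw [← Finset.sum_div]
  congr 1
  have h1 : ∑ i : Fin d.primeFactorsList.length, Real.log ((d.primeFactorsList.get i : ℕ) : ℝ)
      = (d.primeFactorsList.map (fun p : ℕ => Real.log p)).sum := by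
    simp only [List.get_eq_getElem]
    exact Fin.sum_univ_fun_getElem d.primeFactorsList (fun p : ℕ => Real.log p)
  rw [h1, sum_log_eq_log_prod _ (fun p hp => Nat.pos_of_mem_primeFactorsList hp), Nat.prod_primeFactorsList hd]

theorem roughPart_eq_self_of_rough {ν : ℝ} {n d : ℕ} (hn : n ≠ 0) (hr : IsRough ν n) (hdvd : d ∣ n)
    (hd : d ≠ 0) : roughPart ((n : ℝ) ^ ν) d = d := by
  unfold roughPart
  have hfilter : d.primeFactors.filter (fun p : ℕ => (n : ℝ) ^ ν ≤ (p : ℝ)) = d.primeFactors := by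
    apply Finset.filter_true_of_mem
    intro p hp
    exact (hr p (Nat.primeFactors_mono hdvd hn hp)).le
  rw [hfilter]
  have h := Nat.prod_factorization_pow_eq_self hd
  rwa [Finsupp.prod, Nat.support_factorization] at h

theorem smoothPart_eq_one_of_rough {ν : ℝ} {n d : ℕ} (hn : n ≠ 0) (hr : IsRough ν n) (hdvd : d ∣ n)
    (hd : d ≠ 0) : smoothPart ((n : ℝ) ^ ν) d = 1 := by
  rw [smoothPart, roughPart_eq_self_of_rough hn hr hdvd hd, Nat.div_self (Nat.pos_of_ne_zero hd)]

theorem apply_pvec_eq_zero_of_sqrt_lt {ν : ℝ} {g : VecFn} (hadm : Admissible ν g) {n d : ℕ} (hn : 2 ≤ n)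
    (hd0 : d ≠ 0) (hlt : (n : ℝ) ^ (1 / 2 : ℝ) < d) : g d.primeFactorsList.length (pvec n d) = 0 := by
  obtain ⟨-, -, -, hsupp, -⟩ := hadm
  by_contra hne
  rcases hsupp _ _ hne with h0 | ⟨-, hsum⟩
  · have hnil : d.primeFactorsList = [] := List.eq_nil_of_length_eq_zero h0
    rcases (Nat.primeFactorsList_eq_nil d).1 hnil with h | h
    · exact hd0 h
    · subst h
      simp only [Nat.cast_one] at hlt
      have h1n : (1 : ℝ) ≤ (n : ℝ) ^ (1 / 2 : ℝ) :=
        Real.one_le_rpow (by exact_mod_cast (by omega : 1 ≤ n)) (by norm_num)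
      linarith
  · rw [sum_pvec hd0] at hsum
    have hlogn : 0 < Real.log n := Real.log_pos (by exact_mod_cast (by omega : 1 < n))
    have h1 : Real.log d ≤ (1 / 2 : ℝ) * Real.log n := by rwa [div_le_iff₀ hlogn] at hsum
    have hnpos : (0 : ℝ) < n := by exact_mod_cast (by omega : 0 < n)
    have h2 := Real.log_lt_log (Real.rpow_pos_of_pos hnpos _) hlt
    rw [Real.log_rpow hnpos] at h2
    linarith

theorem Gwt_eq_of_rough {ν : ℝ} {g : VecFn} (hadm : Admissible ν g) {n d : ℕ} (hn : 2 ≤ n) (hr : IsRough ν n)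
    (hdvd : d ∣ n) : Gwt g ν n d = g d.primeFactorsList.length (pvec n d) := by
  have hn0 : n ≠ 0 := by omega
  have hd0 : d ≠ 0 := ne_zero_of_dvd_ne_zero hn0 hdvd
  have key : ∀ d' : ℕ, d' = d →
      g d'.primeFactorsList.length (pvec n d') = g d.primeFactorsList.length (pvec n d) := by
    intro d' h; subst h; rfl
  unfold Gwt
  split_ifs with hle
  · rw [smoothPart_eq_one_of_rough hn0 hr hdvd hd0, ArithmeticFunction.moebius_apply_one,
      key _ (roughPart_eq_self_of_rough hn0 hr hdvd hd0)]
    push_cast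
    ring
  · exact (apply_pvec_eq_zero_of_sqrt_lt hadm hn hd0 (not_le.1 hle)).symm

theorem Hwt_eq_sum_of_rough {ν : ℝ} {g : VecFn} (hadm : Admissible ν g) {n : ℕ} (hn : 2 ≤ n) (hr : IsRough ν n) :
    Hwt g ν n = ∑ d ∈ n.divisors, g d.primeFactorsList.length (pvec n d) :=
  Finset.sum_congr rfl fun d hd => Gwt_eq_of_rough hadm hn hr (Nat.dvd_of_mem_divisors hd)

theorem apply_congr_ofFn (g : VecFn) {m m' : ℕ} {f : Fin m → ℝ} {f' : Fin m' → ℝ}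
    (h : List.ofFn f = List.ofFn f') : g m f = g m' f' := by
  rw [List.ofFn_inj'] at h
  cases h
  rfl

theorem ofFn_pvec (n d : ℕ) :
    List.ofFn (pvec n d) = d.primeFactorsList.map (fun q : ℕ => Real.log q / Real.log n) := by
  unfold pvec
  simp only [List.get_eq_getElem]
  exact List.ofFn_getElem_eq_map d.primeFactorsList (fun q : ℕ => Real.log q / Real.log n)

def idxProd (n : ℕ) (A : Finset (Fin n.primeFactorsList.length)) : ℕ := ∏ i ∈ A, n.primeFactorsList.get i

theorem idxProd_dvd {n : ℕ} (hn : n ≠ 0) (A : Finset (Fin n.primeFactorsList.length)) : idxProd n A ∣ n := by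
  have h : ∏ i, n.primeFactorsList.get i = n := by
    simp only [List.get_eq_getElem, Fin.prod_univ_getElem, Nat.prod_primeFactorsList hn]
  unfold idxProd
  conv_rhs => rw [← h]
  exact Finset.prod_dvd_prod_of_subset _ _ _ (Finset.subset_univ A)

theorem primeFactorsList_idxProd (n : ℕ) (A : Finset (Fin n.primeFactorsList.length)) :
    (idxProd n A).primeFactorsList = List.ofFn (fun i => n.primeFactorsList.get (A.orderEmbOfFin rfl i)) := by
  symm
  apply List.Perm.eq_of_sortedLE
  · apply Monotone.sortedLE_ofFn
    exact (List.sortedLE_iff_monotone_get.1 (Nat.primeFactorsList_sorted n)).comp (A.orderEmbOfFin rfl).monotone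
  · exact Nat.primeFactorsList_sorted _
  · apply Nat.primeFactorsList_unique
    · calc (List.ofFn fun i => n.primeFactorsList.get (A.orderEmbOfFin rfl i)).prod
          = ∏ i, n.primeFactorsList.get (A.orderEmbOfFin rfl i) := List.prod_ofFn
        _ = ∏ x ∈ Finset.univ.image (A.orderEmbOfFin rfl), n.primeFactorsList.get x :=
            (Finset.prod_image fun i _ j _ h => (A.orderEmbOfFin rfl).injective h).symm
        _ = idxProd n A := by rw [Finset.image_orderEmbOfFin_univ]; rfl
    · intro p hp
      rw [List.mem_ofFn'] at hp
      obtain ⟨i, rfl⟩ := hp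
      exact Nat.prime_of_mem_primeFactorsList (List.get_mem _ _)

theorem apply_idxProd_eq (N n : ℕ) (g : VecFn) (A : Finset (Fin n.primeFactorsList.length)) :
    g (idxProd n A).primeFactorsList.length (pvec N (idxProd n A))
      = g A.card (fun i => pvec N n (A.orderEmbOfFin rfl i)) := by
  apply apply_congr_ofFn
  rw [ofFn_pvec, primeFactorsList_idxProd n A, List.map_ofFn]
  rfl

theorem idxProd_injective {n : ℕ} (hn : n ≠ 0) (hsq : Squarefree n) : Function.Injective (idxProd n) := by
  intro A B hAB
  have hnd : n.primeFactorsList.Nodup := (Nat.squarefree_iff_nodup_primeFactorsList hn).1 hsq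
  have hinj : Function.Injective n.primeFactorsList.get := List.nodup_iff_injective_get.1 hnd
  have key : ∀ C : Finset (Fin n.primeFactorsList.length),
      (idxProd n C).primeFactors = C.image n.primeFactorsList.get := by
    intro C
    have hC : idxProd n C = ∏ p ∈ C.image n.primeFactorsList.get, p := by
      unfold idxProd
      exact (Finset.prod_image (f := fun p : ℕ => p) fun i _ j _ h => hinj h).symm
    rw [hC]
    apply Nat.primeFactors_prod
    intro p hp
    obtain ⟨i, -, rfl⟩ := Finset.mem_image.1 hp
    exact Nat.prime_of_mem_primeFactorsList (List.get_mem _ _)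
  have h := key A
  rw [hAB, key B] at h
  exact Finset.image_injective hinj h.symm

theorem card_divisors_of_squarefree {n : ℕ} (hn : n ≠ 0) (hsq : Squarefree n) :
    n.divisors.card = 2 ^ n.primeFactorsList.length := by
  have hnd : n.primeFactorsList.Nodup := (Nat.squarefree_iff_nodup_primeFactorsList hn).1 hsq
  have h1 := Nat.sum_divisors_filter_squarefree hn (f := fun _ : ℕ => (1 : ℕ))
  rw [Nat.divisors_filter_squarefree_of_squarefree hsq] at h1
  simp only [Finset.sum_const, smul_eq_mul, mul_one, Finset.card_powerset] at h1
  rw [h1, Nat.factors_eq, ← List.toFinset_card_of_nodup hnd]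
  rfl

theorem sum_divisors_eq_starSum (N : ℕ) {n : ℕ} (hn : n ≠ 0) (hsq : Squarefree n) (g : VecFn) :
    ∑ d ∈ n.divisors, g d.primeFactorsList.length (pvec N d)
      = starSum g n.primeFactorsList.length (pvec N n) := by
  classical
  have hinj := idxProd_injective hn hsq
  have himg : (Finset.univ : Finset (Finset (Fin n.primeFactorsList.length))).image (idxProd n)
      = n.divisors := by
    apply Finset.eq_of_subset_of_card_le
    · intro d hd
      obtain ⟨A, -, rfl⟩ := Finset.mem_image.1 hd
      exact Nat.mem_divisors.2 ⟨idxProd_dvd hn A, hn⟩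
    · rw [Finset.card_image_of_injective _ hinj, Finset.card_univ, Fintype.card_finset, Fintype.card_fin,
        card_divisors_of_squarefree hn hsq]
  rw [← himg, Finset.sum_image fun A _ B _ h => hinj h]
  unfold starSum
  exact Finset.sum_congr rfl fun A _ => apply_idxProd_eq N n g A

theorem two_le_length_of_not_prime {n : ℕ} (hn : 2 ≤ n) (hp : ¬ n.Prime) : 2 ≤ n.primeFactorsList.length := by
  have hn0 : n ≠ 0 := by omega
  have hprod := Nat.prod_primeFactorsList hn0
  have hmem : ∀ p ∈ n.primeFactorsList, p.Prime := fun p hp => Nat.prime_of_mem_primeFactorsList hp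
  rcases hL : n.primeFactorsList with _ | ⟨p, _ | ⟨q, t⟩⟩
  · rw [hL] at hprod
    simp at hprod
    omega
  · rw [hL] at hprod hmem
    simp at hprod
    exact absurd (hprod ▸ hmem p (by simp)) hp
  · simp

theorem nu_lt_pvec {ν : ℝ} {n : ℕ} (hn : 2 ≤ n) (hr : IsRough ν n) {d : ℕ} (hd : d ∣ n)
    (i : Fin d.primeFactorsList.length) : ν < pvec n d i := by
  have hn0 : n ≠ 0 := by omega
  have hnpos : (0 : ℝ) < n := by exact_mod_cast (by omega : 0 < n)
  have hlogn : 0 < Real.log n := Real.log_pos (by exact_mod_cast (by omega : 1 < n))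
  unfold pvec
  rw [lt_div_iff₀ hlogn]
  have hq : d.primeFactorsList.get i ∈ n.primeFactors := by
    have hqd : d.primeFactorsList.get i ∈ d.primeFactorsList := List.get_mem _ _
    rw [Nat.mem_primeFactors]
    exact ⟨Nat.prime_of_mem_primeFactorsList hqd, (Nat.dvd_of_mem_primeFactorsList hqd).trans hd, hn0⟩
  calc ν * Real.log n = Real.log ((n : ℝ) ^ ν) := (Real.log_rpow hnpos ν).symm
    _ < Real.log (d.primeFactorsList.get i : ℝ) := Real.log_lt_log (Real.rpow_pos_of_pos hnpos ν) (hr _ hq)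

theorem pvec_nonneg {n : ℕ} (hn : 2 ≤ n) (d : ℕ) (i : Fin d.primeFactorsList.length) : 0 ≤ pvec n d i := by
  have hlogn : 0 < Real.log n := Real.log_pos (by exact_mod_cast (by omega : 1 < n))
  unfold pvec
  apply div_nonneg _ hlogn.le
  apply Real.log_nonneg
  exact_mod_cast Nat.pos_of_mem_primeFactorsList (List.get_mem _ i)

theorem entries_of_sum_eq_one {ν : ℝ} {K : ℕ} (hK : 2 ≤ K) {z : Fin K → ℝ} (hpos : ∀ l, 0 ≤ z l)
    (hlow : ∀ i, ν < z i) (hsum : ∑ i, z i = 1) : ∀ i, ν < z i ∧ z i < 1 - ν := by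
  intro i
  refine ⟨hlow i, ?_⟩
  obtain ⟨j, hj⟩ : ∃ j : Fin K, j ≠ i := by
    by_cases hi : (i : ℕ) = 0
    · exact ⟨⟨1, by omega⟩, fun h => by rw [Fin.ext_iff] at h; simp at h; omega⟩
    · exact ⟨⟨0, by omega⟩, fun h => by rw [Fin.ext_iff] at h; simp at h; omega⟩
  have h1 : z i + z j ≤ ∑ l, z l := by
    rw [← Finset.add_sum_erase _ _ (Finset.mem_univ i)]
    have : z j ≤ ∑ l ∈ Finset.univ.erase i, z l :=
      Finset.single_le_sum (f := fun l => z l) (fun l _ => hpos l) (Finset.mem_erase.2 ⟨hj, Finset.mem_univ j⟩)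
    linarith
  linarith [hlow j]

theorem sign_of_squarefree {ν : ℝ} {g : VecFn} (hadm : Admissible ν g) {n : ℕ} (hn : 2 ≤ n) (hp : ¬ n.Prime)
    (hr : IsRough ν n) (hsq : Squarefree n) :
    ∑ d ∈ n.divisors, g d.primeFactorsList.length (pvec n d) ≤ 0 := by
  have hn0 : n ≠ 0 := by omega
  rw [sum_divisors_eq_starSum n hn0 hsq]
  have hlogn : 0 < Real.log n := Real.log_pos (by exact_mod_cast (by omega : 1 < n))
  have hsum : ∑ i, pvec n n i = 1 := by rw [sum_pvec hn0, div_self hlogn.ne']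
  have hk2 := two_le_length_of_not_prime hn hp
  exact hadm.2.2.2.2 _ hk2 _
    (entries_of_sum_eq_one hk2 (fun l => pvec_nonneg hn n l) (fun i => nu_lt_pvec hn hr dvd_rfl i) hsum) hsum

theorem apply_eq_of_perm_ofFn {g : VecFn} (hs : g.IsSymmetric) {m m' : ℕ} {f : Fin m → ℝ} {f' : Fin m' → ℝ}
    (h : (List.ofFn f).Perm (List.ofFn f')) : g m f = g m' f' := by
  rw [← hs m (Tuple.sort f) f, ← hs m' (Tuple.sort f') f']
  apply apply_congr_ofFn
  apply List.Perm.eq_of_sortedLE (Tuple.monotone_sort f).sortedLE_ofFn (Tuple.monotone_sort f').sortedLE_ofFn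
  exact ((Equiv.Perm.ofFn_comp_perm _ _).trans h).trans (Equiv.Perm.ofFn_comp_perm _ _).symm

def gam (g : VecFn) (s : Multiset ℝ) : ℝ := g s.toList.length s.toList.get

theorem gam_coe_ofFn {g : VecFn} (hs : g.IsSymmetric) {m : ℕ} (f : Fin m → ℝ) :
    gam g (↑(List.ofFn f) : Multiset ℝ) = g m f := by
  unfold gam
  apply apply_eq_of_perm_ofFn hs
  rw [List.ofFn_get]
  exact Multiset.coe_eq_coe.1 (Multiset.coe_toList _)

theorem gam_eq_zero {ν : ℝ} {g : VecFn} (hadm : Admissible ν g) {s : Multiset ℝ} (hs0 : s ≠ 0)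
    (hsum : 1 / 2 < s.sum) : gam g s = 0 := by
  obtain ⟨-, -, -, hsupp, -⟩ := hadm
  by_contra hne
  rcases hsupp _ _ hne with h0 | ⟨-, hle⟩
  · apply hs0
    have : s.toList = [] := List.eq_nil_of_length_eq_zero h0
    rw [← Multiset.coe_toList s, this]
    rfl
  · have hsum' : ∑ i, s.toList.get i = s.sum := by
      simp only [List.get_eq_getElem, Fin.sum_univ_getElem, Multiset.sum_toList]
    linarith

theorem coe_ofFn_orderEmb {K : ℕ} (x : Fin K → ℝ) (B : Finset (Fin K)) :
    (↑(List.ofFn fun i => x (B.orderEmbOfFin rfl i)) : Multiset ℝ) = B.val.map x := by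
  have h1 : (List.ofFn fun i => x (B.orderEmbOfFin rfl i)) = (List.ofFn (B.orderEmbOfFin rfl)).map x := by
    rw [List.map_ofFn]
    rfl
  rw [h1, ← Multiset.map_coe]
  congr 1
  have h2 := congrArg Finset.val (Finset.map_orderEmbOfFin_univ B rfl)
  rw [Finset.map_val, Finset.val_univ_fin] at h2
  rw [← h2, Multiset.map_coe, ← List.ofFn_eq_map]
  rfl

theorem starSum_eq_sum_gam {g : VecFn} (hs : g.IsSymmetric) (K : ℕ) (x : Fin K → ℝ) :
    starSum g K x = ∑ B : Finset (Fin K), gam g (B.val.map x) := by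
  unfold starSum
  refine Finset.sum_congr rfl fun B _ => ?_
  rw [← coe_ofFn_orderEmb, gam_coe_ofFn hs]

theorem sum_finset_fin_succ (K : ℕ) (F : Finset (Fin (K + 1)) → ℝ) :
    ∑ B : Finset (Fin (K + 1)), F B
      = ∑ B' : Finset (Fin K), F (B'.map Fin.castSuccEmb)
        + ∑ B' : Finset (Fin K), F (insert (Fin.last K) (B'.map Fin.castSuccEmb)) := by
  classical
  have huniv : (Finset.univ : Finset (Fin (K + 1)))
      = insert (Fin.last K) ((Finset.univ : Finset (Fin K)).image Fin.castSucc) := by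
    ext i
    refine ⟨fun _ => ?_, fun _ => Finset.mem_univ _⟩
    rcases Fin.eq_castSucc_or_eq_last i with ⟨j, rfl⟩ | rfl
    · exact Finset.mem_insert_of_mem (Finset.mem_image_of_mem _ (Finset.mem_univ _))
    · exact Finset.mem_insert_self _ _
  have hnot : Fin.last K ∉ (Finset.univ : Finset (Fin K)).image Fin.castSucc := by
    intro h
    obtain ⟨a, -, ha⟩ := Finset.mem_image.1 h
    exact (Fin.castSucc_lt_last a).ne ha
  have hinj : Function.Injective (fun B' : Finset (Fin K) => B'.image Fin.castSucc) :=
    Finset.image_injective (Fin.castSucc_injective K)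
  have hmap : ∀ B' : Finset (Fin K), B'.map Fin.castSuccEmb = B'.image Fin.castSucc := fun B' =>
    Finset.map_eq_image _ _
  simp only [hmap]
  calc ∑ B : Finset (Fin (K + 1)), F B
      = ∑ B ∈ (Finset.univ : Finset (Fin (K + 1))).powerset, F B := by rw [Finset.powerset_univ]
    _ = ∑ B ∈ ((Finset.univ : Finset (Fin K)).image Fin.castSucc).powerset, F B
          + ∑ B ∈ ((Finset.univ : Finset (Fin K)).image Fin.castSucc).powerset, F (insert (Fin.last K) B) := by
        rw [huniv, Finset.sum_powerset_insert hnot]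
    _ = _ := by
        rw [Finset.powerset_image, Finset.sum_image fun a _ b _ h => hinj h,
          Finset.sum_image fun a _ b _ h => hinj h, Finset.powerset_univ]

theorem map_val_map_castSucc {K : ℕ} (B' : Finset (Fin K)) (x : Fin (K + 1) → ℝ) :
    (B'.map Fin.castSuccEmb).val.map x = B'.val.map (fun j => x (Fin.castSucc j)) := by
  rw [Finset.map_val, Multiset.map_map]
  rfl

theorem map_val_insert_last {K : ℕ} (B' : Finset (Fin K)) (x : Fin (K + 1) → ℝ) :
    (insert (Fin.last K) (B'.map Fin.castSuccEmb)).val.map x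
      = x (Fin.last K) ::ₘ B'.val.map (fun j => x (Fin.castSucc j)) := by
  classical
  have hnot : Fin.last K ∉ B'.map Fin.castSuccEmb := by
    intro h
    obtain ⟨a, -, ha⟩ := Finset.mem_map.1 h
    exact (Fin.castSucc_lt_last a).ne ha
  rw [Finset.insert_val_of_notMem hnot, Multiset.map_cons, map_val_map_castSucc]

theorem sum_gam_snoc (g : VecFn) {K : ℕ} (v : Fin K → ℝ) (t : ℝ) (Φ : Multiset ℝ → Multiset ℝ) :
    ∑ B : Finset (Fin (K + 1)), gam g (Φ (B.val.map (Fin.snoc v t : Fin (K + 1) → ℝ)))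
      = ∑ B' : Finset (Fin K), gam g (Φ (B'.val.map v))
        + ∑ B' : Finset (Fin K), gam g (Φ (t ::ₘ B'.val.map v)) := by
  rw [sum_finset_fin_succ]
  simp only [map_val_map_castSucc, map_val_insert_last, Fin.snoc_castSucc, Fin.snoc_last]

theorem starSum_snoc_of_half_lt {ν : ℝ} {g : VecFn} (hadm : Admissible ν g) {K : ℕ} (v : Fin K → ℝ)
    (hv : ∀ i, 0 ≤ v i) {t : ℝ} (ht : 1 / 2 < t) :
    starSum g (K + 1) (Fin.snoc v t) = starSum g K v := by
  have hs : g.IsSymmetric := hadm.1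
  have hsplit := sum_gam_snoc g v t id
  simp only [id] at hsplit
  rw [starSum_eq_sum_gam hs, starSum_eq_sum_gam hs, hsplit]
  have hzero : ∀ B' : Finset (Fin K), gam g (t ::ₘ B'.val.map v) = 0 := by
    intro B'
    apply gam_eq_zero hadm (Multiset.cons_ne_zero)
    rw [Multiset.sum_cons]
    have : 0 ≤ (B'.val.map v).sum :=
      Multiset.sum_nonneg fun y hy => by
        obtain ⟨i, -, rfl⟩ := Multiset.mem_map.1 hy
        exact hv i
    linarith
  simp [hzero]

theorem exists_perm_eq_comp {K : ℕ} {f f' : Fin K → ℝ} (h : (List.ofFn f).Perm (List.ofFn f')) :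
    ∃ σ : Equiv.Perm (Fin K), f' = f ∘ σ := by
  have heq : List.ofFn (f ∘ Tuple.sort f) = List.ofFn (f' ∘ Tuple.sort f') := by
    apply List.Perm.eq_of_sortedLE (Tuple.monotone_sort f).sortedLE_ofFn (Tuple.monotone_sort f').sortedLE_ofFn
    exact ((Equiv.Perm.ofFn_comp_perm _ _).trans h).trans (Equiv.Perm.ofFn_comp_perm _ _).symm
  have hfun : f ∘ Tuple.sort f = f' ∘ Tuple.sort f' := List.ofFn_injective heq
  refine ⟨(Tuple.sort f').symm.trans (Tuple.sort f), ?_⟩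
  funext x
  have := congrFun hfun ((Tuple.sort f').symm x)
  simp only [Function.comp_apply, Equiv.apply_symm_apply] at this
  simp only [Function.comp_apply, Equiv.trans_apply]
  exact this.symm

theorem sum_gam_comp_perm (g : VecFn) {K : ℕ} (x : Fin K → ℝ) (σ : Equiv.Perm (Fin K))
    (Φ : Multiset ℝ → Multiset ℝ) :
    ∑ B : Finset (Fin K), gam g (Φ (B.val.map (x ∘ σ))) = ∑ B : Finset (Fin K), gam g (Φ (B.val.map x)) := by
  have h : ∀ B : Finset (Fin K), B.val.map (x ∘ σ) = (B.map σ.toEmbedding).val.map x := by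
    intro B
    rw [Finset.map_val, Multiset.map_map]
    rfl
  simp_rw [h]
  exact Equiv.sum_comp (Equiv.finsetCongr σ) (fun B : Finset (Fin K) => gam g (Φ (B.val.map x)))

theorem sum_gam_eq_of_coe_eq (g : VecFn) {K K' : ℕ} {f : Fin K → ℝ} {f' : Fin K' → ℝ}
    (h : (↑(List.ofFn f) : Multiset ℝ) = ↑(List.ofFn f')) (Φ : Multiset ℝ → Multiset ℝ) :
    ∑ B : Finset (Fin K), gam g (Φ (B.val.map f)) = ∑ B : Finset (Fin K'), gam g (Φ (B.val.map f')) := by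
  have hK : K = K' := by simpa using congrArg Multiset.card h
  subst hK
  obtain ⟨σ, rfl⟩ := exists_perm_eq_comp (Multiset.coe_eq_coe.1 h)
  exact (sum_gam_comp_perm g f σ Φ).symm

theorem forall_snoc_lt {K : ℕ} {v : Fin K → ℝ} {t ν : ℝ} (hv : ∀ i, ν < v i) (ht : ν < t) :
    ∀ i, ν < (Fin.snoc v t : Fin (K + 1) → ℝ) i := by
  intro i
  rcases Fin.eq_castSucc_or_eq_last i with ⟨j, rfl⟩ | rfl
  · simpa using hv j
  · simpa using ht

theorem dvd_mul_of_not_sq_dvd {p a m d : ℕ} (hp : p.Prime) (hpm : ¬ p ∣ m) (hm : m ≠ 0) (hd : d ∣ p ^ a * m)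
    (h2 : ¬ p ^ 2 ∣ d) : d ∣ p * m := by
  have hpa : p ^ a * m ≠ 0 := mul_ne_zero (pow_ne_zero _ hp.ne_zero) hm
  have hd0 : d ≠ 0 := ne_zero_of_dvd_ne_zero hpa hd
  rw [← Nat.factorization_le_iff_dvd hd0 (mul_ne_zero hp.ne_zero hm)]
  have hle := (Nat.factorization_le_iff_dvd hd0 hpa).2 hd
  intro q
  have hq := hle q
  rw [Nat.factorization_mul (pow_ne_zero _ hp.ne_zero) hm, Finsupp.add_apply, Nat.factorization_pow,
    Finsupp.smul_apply, smul_eq_mul] at hq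
  rw [Nat.factorization_mul hp.ne_zero hm, Finsupp.add_apply]
  by_cases hqp : q = p
  · subst hqp
    rw [hp.factorization_self]
    have h1 : d.factorization q < 2 := by
      by_contra hge
      exact h2 ((hp.pow_dvd_iff_le_factorization hd0).2 (not_lt.1 hge))
    omega
  · have h0 : p.factorization q = 0 := by
      rw [hp.factorization, Finsupp.single_apply, if_neg (Ne.symm hqp)]
    rw [h0] at hq ⊢
    simpa using hq

theorem sum_divisors_eq_sum_divisors_mul {ν : ℝ} {g : VecFn} (hadm : Admissible ν g) {n p a m : ℕ} (hn : 2 ≤ n)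
    (hp : p.Prime) (hpm : ¬ p ∣ m) (hm : m ≠ 0) (ha : 1 ≤ a) (hnpam : n = p ^ a * m)
    (hp4 : (n : ℝ) ^ (1 / 4 : ℝ) < p) :
    ∑ d ∈ n.divisors, g d.primeFactorsList.length (pvec n d)
      = ∑ d ∈ (p * m).divisors, g d.primeFactorsList.length (pvec n d) := by
  have hn0 : n ≠ 0 := by omega
  symm
  apply Finset.sum_subset
  · apply Nat.divisors_subset_of_dvd hn0
    rw [hnpam]
    exact mul_dvd_mul_right (dvd_pow_self p (by omega)) m
  · intro d hd hd'
    have hdn : d ∣ n := Nat.dvd_of_mem_divisors hd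
    have hd0 : d ≠ 0 := ne_zero_of_dvd_ne_zero hn0 hdn
    have hndvd : ¬ d ∣ p * m := fun h => hd' (Nat.mem_divisors.2 ⟨h, mul_ne_zero hp.ne_zero hm⟩)
    have hp2 : p ^ 2 ∣ d := by
      by_contra h2
      exact hndvd (dvd_mul_of_not_sq_dvd hp hpm hm (hnpam ▸ hdn) h2)
    apply apply_pvec_eq_zero_of_sqrt_lt hadm hn hd0
    have hnpos : (0 : ℝ) ≤ n := by positivity
    have hp2le : ((p : ℝ)) ^ 2 ≤ d := by exact_mod_cast Nat.le_of_dvd (Nat.pos_of_ne_zero hd0) hp2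
    have h14 : 0 ≤ (n : ℝ) ^ (1 / 4 : ℝ) := Real.rpow_nonneg hnpos _
    calc (n : ℝ) ^ (1 / 2 : ℝ) = ((n : ℝ) ^ (1 / 4 : ℝ)) ^ 2 := by
            rw [← Real.rpow_mul_natCast hnpos]; norm_num
      _ < (p : ℝ) ^ 2 := pow_lt_pow_left₀ hp4 h14 (by norm_num)
      _ ≤ d := hp2le

theorem coe_ofFn_pvec_mul (n : ℕ) {p m : ℕ} (hp : p.Prime) (hm : m ≠ 0) :
    (↑(List.ofFn (pvec n (p * m))) : Multiset ℝ)
      = ↑(List.ofFn (Fin.snoc (pvec n m) (Real.log p / Real.log n) :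
          Fin (m.primeFactorsList.length + 1) → ℝ)) := by
  rw [Multiset.coe_eq_coe]
  have h2 : List.ofFn (Fin.snoc (pvec n m) (Real.log p / Real.log n) : Fin (m.primeFactorsList.length + 1) → ℝ)
      = (m.primeFactorsList ++ [p]).map (fun q : ℕ => Real.log q / Real.log n) := by
    rw [List.ofFn_succ', List.concat_eq_append, List.map_append, List.map_singleton, ← ofFn_pvec]
    congr 1
    · congr 1
      funext i
      simp [Fin.snoc_castSucc]
    · simp [Fin.snoc_last]
  rw [h2, ofFn_pvec]
  apply List.Perm.map
  refine (Nat.perm_primeFactorsList_mul hp.ne_zero hm).trans ?_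
  rw [Nat.primeFactorsList_prime hp]
  exact List.perm_append_comm

theorem structure_of_not_squarefree {n : ℕ} (hn : 2 ≤ n) (hexc : ¬ IsExc n) (hsq : ¬ Squarefree n) :
    ∃ p m a : ℕ, p.Prime ∧ ¬ p ∣ m ∧ Squarefree m ∧ m ≠ 0 ∧ (a = 2 ∧ 1 < m ∨ a = 3) ∧ n = p ^ a * m ∧
      (n : ℝ) ^ (1 / 4 : ℝ) < p := by
  have hn0 : n ≠ 0 := by omega
  rw [Nat.squarefree_iff_prime_squarefree] at hsq
  push Not at hsq
  obtain ⟨p, hp, hpp⟩ := hsq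
  have hp2 : p ^ 2 ∣ n := by rwa [pow_two]
  have hpn : p ∣ n := (dvd_mul_right p p).trans hpp
  have hpf : p ∈ n.primeFactors := Nat.mem_primeFactors.2 ⟨hp, hpn, hn0⟩
  unfold IsExc at hexc
  push Not at hexc
  obtain ⟨h1, h2⟩ := hexc
  have hp4 : (n : ℝ) ^ (1 / 4 : ℝ) < p := h1 p hpf hp2
  have hdecomp : p ^ n.factorization p * (n / p ^ n.factorization p) = n := Nat.ordProj_mul_ordCompl_eq_self n p
  have hpm : ¬ p ∣ n / p ^ n.factorization p := Nat.not_dvd_ordCompl hp hn0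
  have hm0 : n / p ^ n.factorization p ≠ 0 := (Nat.ordCompl_pos p hn0).ne'
  have ha2 : 2 ≤ n.factorization p := (hp.pow_dvd_iff_le_factorization hn0).1 hp2
  have hnpos : (0 : ℝ) ≤ n := by positivity
  have h14 : 0 ≤ (n : ℝ) ^ (1 / 4 : ℝ) := Real.rpow_nonneg hnpos _
  have hn4 : ((n : ℝ) ^ (1 / 4 : ℝ)) ^ 4 = n := by rw [← Real.rpow_mul_natCast hnpos]; norm_num
  have ha3 : n.factorization p ≤ 3 := by
    by_contra h4
    have h4' : p ^ 4 ∣ n := (hp.pow_dvd_iff_le_factorization hn0).2 (by omega)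
    have h4'' : ((p : ℝ)) ^ 4 ≤ n := by exact_mod_cast Nat.le_of_dvd (by omega) h4'
    have : ((n : ℝ) ^ (1 / 4 : ℝ)) ^ 4 < (p : ℝ) ^ 4 := pow_lt_pow_left₀ hp4 h14 (by norm_num)
    linarith
  have hmdvd : n / p ^ n.factorization p ∣ n := Dvd.intro_left _ hdecomp
  have hmsq : Squarefree (n / p ^ n.factorization p) := by
    rw [Nat.squarefree_iff_prime_squarefree]
    intro q hq hqq
    have hqm : q ∣ n / p ^ n.factorization p := (dvd_mul_right q q).trans hqq
    have hq2n : q ^ 2 ∣ n := by rw [pow_two]; exact hqq.trans hmdvd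
    have hqf : q ∈ n.primeFactors := Nat.mem_primeFactors.2 ⟨hq, hqm.trans hmdvd, hn0⟩
    have hq4 : (n : ℝ) ^ (1 / 4 : ℝ) < q := h1 q hqf hq2n
    have hdiv : p ^ 2 * (q * q) ∣ n := by
      rw [← hdecomp]
      exact mul_dvd_mul (pow_dvd_pow p ha2) hqq
    have hle : ((p : ℝ)) ^ 2 * ((q : ℝ) * q) ≤ n := by exact_mod_cast Nat.le_of_dvd (by omega) hdiv
    have hpp2 : ((n : ℝ) ^ (1 / 4 : ℝ)) ^ 2 < (p : ℝ) ^ 2 := pow_lt_pow_left₀ hp4 h14 (by norm_num)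
    have hqq2 : ((n : ℝ) ^ (1 / 4 : ℝ)) ^ 2 < (q : ℝ) * q := by
      rw [← pow_two]; exact pow_lt_pow_left₀ hq4 h14 (by norm_num)
    have hprod : ((n : ℝ) ^ (1 / 4 : ℝ)) ^ 2 * ((n : ℝ) ^ (1 / 4 : ℝ)) ^ 2 < (p : ℝ) ^ 2 * ((q : ℝ) * q) :=
      mul_lt_mul'' hpp2 hqq2 (by positivity) (by positivity)
    have h44 : ((n : ℝ) ^ (1 / 4 : ℝ)) ^ 2 * ((n : ℝ) ^ (1 / 4 : ℝ)) ^ 2 = n := by rw [← pow_add]; exact hn4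
    linarith
  refine ⟨p, n / p ^ n.factorization p, n.factorization p, hp, hpm, hmsq, hm0, ?_, hdecomp.symm, hp4⟩
  rcases (by omega : n.factorization p = 2 ∨ n.factorization p = 3) with h | h
  · left
    refine ⟨h, ?_⟩
    by_contra hm1
    apply h2 p hpf
    have hm1' : n / p ^ n.factorization p = 1 := by
      rcases Nat.lt_or_ge 1 (n / p ^ n.factorization p) with h' | h'
      · exact absurd h' hm1
      · exact le_antisymm h' (Nat.pos_of_ne_zero hm0)
    rw [← hdecomp, hm1', h, mul_one]
  · right
    exact h

theorem sign_p3 {ν : ℝ} (hν : 0 < ν) (hν4 : ν < 1 / 4) {g : VecFn} (hadm : Admissible ν g) {n p m : ℕ}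
    (hn : 2 ≤ n) (hr : IsRough ν n) (hp : p.Prime) (hpm : ¬ p ∣ m) (hm : m ≠ 0) (hmsq : Squarefree m)
    (hnpm : n = p ^ 3 * m) (hp4 : (n : ℝ) ^ (1 / 4 : ℝ) < p) :
    ∑ d ∈ n.divisors, g d.primeFactorsList.length (pvec n d) ≤ 0 := by
  have hpm0 : p * m ≠ 0 := mul_ne_zero hp.ne_zero hm
  have hpmsq : Squarefree (p * m) := by
    rw [Nat.squarefree_mul ((Nat.Prime.coprime_iff_not_dvd hp).2 hpm)]
    exact ⟨Irreducible.squarefree hp, hmsq⟩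
  rw [sum_divisors_eq_sum_divisors_mul hadm hn hp hpm hm (by norm_num) hnpm hp4,
    sum_divisors_eq_starSum n hpm0 hpmsq]
  have hnpos : (0 : ℝ) < n := by exact_mod_cast (by omega : 0 < n)
  have hlogn : 0 < Real.log n := Real.log_pos (by exact_mod_cast (by omega : 1 < n))
  have hlogp : Real.log n < 4 * Real.log p := by
    have h := Real.log_lt_log (Real.rpow_pos_of_pos hnpos _) hp4
    rw [Real.log_rpow hnpos] at h
    linarith
  have hxp : 1 / 4 < Real.log p / Real.log n := by rw [lt_div_iff₀ hlogn]; linarith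
  have hdvd : p * m ∣ n := by rw [hnpm]; exact mul_dvd_mul_right (dvd_pow_self p (by norm_num)) m
  have hwpos : ∀ i, 0 ≤ pvec n (p * m) i := fun i => pvec_nonneg hn _ i
  have hwlow : ∀ i, ν < pvec n (p * m) i := fun i => nu_lt_pvec hn hr hdvd i
  have hsumw : ∑ i, pvec n (p * m) i = Real.log (p * m : ℕ) / Real.log n := sum_pvec hpm0
  have hlogpm : Real.log (p * m : ℕ) = Real.log p + Real.log m := by
    push_cast
    exact Real.log_mul (by exact_mod_cast hp.ne_zero) (by exact_mod_cast hm)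
  have hlognn : Real.log n = 3 * Real.log p + Real.log m := by
    rw [hnpm]
    push_cast
    rw [Real.log_mul (pow_ne_zero _ (by exact_mod_cast hp.ne_zero)) (by exact_mod_cast hm), Real.log_pow]
    push_cast
    ring
  have hK1 : 1 ≤ (p * m).primeFactorsList.length :=
    List.length_pos_of_mem ((Nat.mem_primeFactorsList hpm0).2 ⟨hp, dvd_mul_right p m⟩)
  have hsum1 : ∑ i, (Fin.snoc (pvec n (p * m)) (2 * (Real.log p / Real.log n)) :
      Fin ((p * m).primeFactorsList.length + 1) → ℝ) i = 1 := by
    rw [Fin.sum_snoc, hsumw, hlogpm]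
    have : (Real.log p + Real.log m) / Real.log n + 2 * (Real.log p / Real.log n)
        = (3 * Real.log p + Real.log m) / Real.log n := by ring
    rw [this, ← hlognn, div_self hlogn.ne']
  rw [← starSum_snoc_of_half_lt hadm (pvec n (p * m)) hwpos (t := 2 * (Real.log p / Real.log n)) (by linarith)]
  exact hadm.2.2.2.2 _ (by omega) _
    (entries_of_sum_eq_one (by omega) (fun l => hν.le.trans (forall_snoc_lt hwlow (by linarith) l).le)
      (forall_snoc_lt hwlow (by linarith)) hsum1) hsum1

theorem sign_p2 {ν : ℝ} (hν : 0 < ν) (hν4 : ν < 1 / 4) {g : VecFn} (hadm : Admissible ν g) {n p m : ℕ}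
    (hn : 2 ≤ n) (hr : IsRough ν n) (hp : p.Prime) (hpm : ¬ p ∣ m) (hm1 : 1 < m) (hmsq : Squarefree m)
    (hnpm : n = p ^ 2 * m) (hp4 : (n : ℝ) ^ (1 / 4 : ℝ) < p) :
    ∑ d ∈ n.divisors, g d.primeFactorsList.length (pvec n d) ≤ 0 := by
  have hm : m ≠ 0 := by omega
  have hpm0 : p * m ≠ 0 := mul_ne_zero hp.ne_zero hm
  have hpmsq : Squarefree (p * m) := by
    rw [Nat.squarefree_mul ((Nat.Prime.coprime_iff_not_dvd hp).2 hpm)]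
    exact ⟨Irreducible.squarefree hp, hmsq⟩
  have hs : g.IsSymmetric := hadm.1
  rw [sum_divisors_eq_sum_divisors_mul hadm hn hp hpm hm (by norm_num) hnpm hp4,
    sum_divisors_eq_starSum n hpm0 hpmsq, starSum_eq_sum_gam hs]
  have hQ := sum_gam_eq_of_coe_eq g (coe_ofFn_pvec_mul n hp hm) id
  simp only [id] at hQ
  rw [hQ]
  have hnpos : (0 : ℝ) < n := by exact_mod_cast (by omega : 0 < n)
  have hlogn : 0 < Real.log n := Real.log_pos (by exact_mod_cast (by omega : 1 < n))
  have hlogp : Real.log n < 4 * Real.log p := by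
    have h := Real.log_lt_log (Real.rpow_pos_of_pos hnpos _) hp4
    rw [Real.log_rpow hnpos] at h
    linarith
  have hxp : 1 / 4 < Real.log p / Real.log n := by rw [lt_div_iff₀ hlogn]; linarith
  have hxpν : ν < Real.log p / Real.log n := by linarith
  have hmdvd : m ∣ n := by rw [hnpm]; exact dvd_mul_left m _
  have hypos : ∀ i, 0 ≤ pvec n m i := fun i => pvec_nonneg hn _ i
  have hylow : ∀ i, ν < pvec n m i := fun i => nu_lt_pvec hn hr hmdvd i
  have hsumy : ∑ i, pvec n m i = Real.log m / Real.log n := sum_pvec hm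
  have hlognn : Real.log n = 2 * Real.log p + Real.log m := by
    rw [hnpm]
    push_cast
    rw [Real.log_mul (pow_ne_zero _ (by exact_mod_cast hp.ne_zero)) (by exact_mod_cast hm), Real.log_pow]
    push_cast
    ring
  have hk1 : 1 ≤ m.primeFactorsList.length := by
    obtain ⟨q, hq, hqm⟩ := Nat.exists_prime_and_dvd (by omega : m ≠ 1)
    exact List.length_pos_of_mem ((Nat.mem_primeFactorsList hm).2 ⟨hq, hqm⟩)
  have hsum2 : ∑ i, (Fin.snoc (pvec n m) (2 * (Real.log p / Real.log n)) :
      Fin (m.primeFactorsList.length + 1) → ℝ) i = 1 := by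
    rw [Fin.sum_snoc, hsumy]
    have : Real.log m / Real.log n + 2 * (Real.log p / Real.log n)
        = (2 * Real.log p + Real.log m) / Real.log n := by ring
    rw [this, ← hlognn, div_self hlogn.ne']
  have hA0 : ∑ B' : Finset (Fin m.primeFactorsList.length), gam g (B'.val.map (pvec n m)) ≤ 0 := by
    rw [← starSum_eq_sum_gam hs,
      ← starSum_snoc_of_half_lt hadm (pvec n m) hypos (t := 2 * (Real.log p / Real.log n)) (by linarith)]
    exact hadm.2.2.2.2 _ (by omega) _
      (entries_of_sum_eq_one (by omega) (fun l => hν.le.trans (forall_snoc_lt hylow (by linarith) l).le)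
        (forall_snoc_lt hylow (by linarith)) hsum2) hsum2
  have hsum3 : ∑ i, (Fin.snoc (Fin.snoc (pvec n m) (Real.log p / Real.log n) :
      Fin (m.primeFactorsList.length + 1) → ℝ) (Real.log p / Real.log n) :
      Fin (m.primeFactorsList.length + 1 + 1) → ℝ) i = 1 := by
    rw [Fin.sum_snoc, Fin.sum_snoc, hsumy]
    have : Real.log m / Real.log n + Real.log p / Real.log n + Real.log p / Real.log n
        = (2 * Real.log p + Real.log m) / Real.log n := by ring
    rw [this, ← hlognn, div_self hlogn.ne']
  have hS1 := hadm.2.2.2.2 _ (by omega) _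
    (entries_of_sum_eq_one (by omega)
      (fun l => hν.le.trans (forall_snoc_lt (forall_snoc_lt hylow hxpν) hxpν l).le)
      (forall_snoc_lt (forall_snoc_lt hylow hxpν) hxpν) hsum3) hsum3
  rw [starSum_eq_sum_gam hs] at hS1
  have hB := sum_gam_snoc g (Fin.snoc (pvec n m) (Real.log p / Real.log n) :
      Fin (m.primeFactorsList.length + 1) → ℝ) (Real.log p / Real.log n) id
  simp only [id] at hB
  have hC := sum_gam_snoc g (pvec n m) (Real.log p / Real.log n) (fun s => (Real.log p / Real.log n) ::ₘ s)
  have hzero : ∀ B' : Finset (Fin m.primeFactorsList.length),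
      gam g ((Real.log p / Real.log n) ::ₘ ((Real.log p / Real.log n) ::ₘ B'.val.map (pvec n m))) = 0 := by
    intro B'
    apply gam_eq_zero hadm (Multiset.cons_ne_zero)
    rw [Multiset.sum_cons, Multiset.sum_cons]
    have : 0 ≤ (B'.val.map (pvec n m)).sum :=
      Multiset.sum_nonneg fun r hr' => by
        obtain ⟨i, -, rfl⟩ := Multiset.mem_map.1 hr'
        exact hypos i
    linarith
  simp only [hzero, Finset.sum_const_zero, add_zero] at hC
  have hA := sum_gam_snoc g (pvec n m) (Real.log p / Real.log n) id
  simp only [id] at hA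
  rw [hB, hC, hA] at hS1
  rw [hA]
  linarith

theorem sign_of_not_squarefree {ν : ℝ} (hν : 0 < ν) (hν4 : ν < 1 / 4) {g : VecFn} (hadm : Admissible ν g)
    {n : ℕ} (hn : 2 ≤ n) (hr : IsRough ν n) (hexc : ¬ IsExc n) (hsq : ¬ Squarefree n) :
    ∑ d ∈ n.divisors, g d.primeFactorsList.length (pvec n d) ≤ 0 := by
  obtain ⟨p, m, a, hp, hpm, hmsq, hm0, hcase, hnpam, hp4⟩ := structure_of_not_squarefree hn hexc hsq
  rcases hcase with ⟨rfl, hm1⟩ | rfl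
  · exact sign_p2 hν hν4 hadm hn hr hp hpm hm1 hmsq hnpam hp4
  · exact sign_p3 hν hν4 hadm hn hr hp hpm hm0 hmsq hnpam hp4

theorem sign_lemma : Signature.signLemma := by
  intro ν hν hν4 g hadm n hn hp hr hexc
  by_cases hsq : Squarefree n
  · exact sign_of_squarefree hadm hn hp hr hsq
  · exact sign_of_not_squarefree hν hν4 hadm hn hr hexc hsq

theorem mem_SFset {ν x : ℝ} {n : ℕ} : n ∈ SFset ν x ↔ n ∈ Nset ν x ∧ Squarefree n := by
  unfold SFset; simp [mem_filter]

theorem mem_NSFset {ν x : ℝ} {n : ℕ} : n ∈ NSFset ν x ↔ n ∈ Nset ν x ∧ ¬ Squarefree n := by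
  unfold NSFset; simp [mem_filter]

theorem sum_Nset_eq_SF_add_NSF {ν x : ℝ} (f : ℕ → ℝ) :
    ∑ n ∈ Nset ν x, f n = ∑ n ∈ SFset ν x, f n + ∑ n ∈ NSFset ν x, f n := by
  classical
  have h1 : (Nset ν x).filter Squarefree = SFset ν x := by ext n; rw [mem_filter, mem_SFset]
  have h2 : (Nset ν x).filter (fun n => ¬ Squarefree n) = NSFset ν x := by ext n; rw [mem_filter, mem_NSFset]
  rw [← sum_filter_add_sum_filter_not (Nset ν x) Squarefree f, h1, h2]

theorem sum_Ioc_inv_sq_le {Y : ℕ} (hY : 1 ≤ Y) (X : ℕ) :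
    ∑ q ∈ Ioc Y X, (1 : ℝ) / ((q : ℝ) ^ 2) ≤ 1 / (Y : ℝ) := by
  rcases Nat.lt_or_ge X Y with hXY | hYX
  swap
  · have key : ∀ X', Y ≤ X' → ∑ q ∈ Ioc Y X', (1 : ℝ) / ((q : ℝ) ^ 2) ≤ 1 / (Y : ℝ) - 1 / (X' : ℝ) := by
      intro X' hYX'
      induction X', hYX' using Nat.le_induction with
      | base => simp
      | succ X' hYX' ih =>
        have hIoc : Ioc Y (X' + 1) = insert (X' + 1) (Ioc Y X') := by
          ext q; simp only [mem_Ioc, mem_insert]; omega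
        have hnot : X' + 1 ∉ Ioc Y X' := by simp
        rw [hIoc, sum_insert hnot]
        have hX'pos : (0 : ℝ) < X' := by exact_mod_cast (show 0 < X' by omega)
        have hstep : (1 : ℝ) / (((X' + 1 : ℕ) : ℝ) ^ 2) ≤ 1 / (X' : ℝ) - 1 / ((X' + 1 : ℕ) : ℝ) := by
          push_cast
          rw [div_sub_div _ _ hX'pos.ne' (by positivity), div_le_div_iff₀ (by positivity) (by positivity)]
          nlinarith
        linarith
    have hXpos : (0 : ℝ) < X := by exact_mod_cast (show 0 < X by omega)
    linarith [key X hYX, one_div_pos.2 hXpos]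
  · rw [Finset.Ioc_eq_empty (by omega), sum_empty]
    positivity

theorem card_NSFset_le {ν x : ℝ} (hν : 0 < ν) (hx : 2 ≤ x) {Y : ℕ} (hY1 : 1 ≤ Y) (hY : (Y : ℝ) ≤ (x / 2) ^ ν) :
    ((NSFset ν x).card : ℝ) ≤ x / Y := by
  classical
  have hx0 : 0 ≤ x := by linarith
  have hsub : NSFset ν x ⊆ (Ioc Y ⌊x⌋₊).biUnion (fun q => (Ioc 0 ⌊x⌋₊).filter (fun n => q ^ 2 ∣ n)) := by
    intro n hn
    rw [mem_NSFset, mem_Nset, mem_window] at hn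
    obtain ⟨⟨⟨⟨hn1, hnx⟩, hxn⟩, hn2, -, hr⟩, hnsq⟩ := hn
    rw [Nat.squarefree_iff_prime_squarefree] at hnsq
    push Not at hnsq
    obtain ⟨q, hq, hqn⟩ := hnsq
    have hn0 : n ≠ 0 := by omega
    have hqpf : q ∈ n.primeFactors := Nat.mem_primeFactors.2 ⟨hq, dvd_trans (dvd_mul_right q q) hqn, hn0⟩
    have hqgt : (n : ℝ) ^ ν < q := hr q hqpf
    have hYq : Y < q := by
      have h1 : (x / 2) ^ ν ≤ (n : ℝ) ^ ν := Real.rpow_le_rpow (by positivity) hxn.le hν.le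
      exact_mod_cast (hY.trans_lt (h1.trans_lt hqgt))
    have hqle : q ≤ ⌊x⌋₊ := (Nat.le_of_dvd (by omega) (dvd_trans (dvd_mul_right q q) hqn)).trans hnx
    rw [mem_biUnion]
    refine ⟨q, mem_Ioc.2 ⟨hYq, hqle⟩, mem_filter.2 ⟨mem_Ioc.2 ⟨by omega, hnx⟩, ?_⟩⟩
    rw [pow_two]; exact hqn
  calc ((NSFset ν x).card : ℝ)
      ≤ (((Ioc Y ⌊x⌋₊).biUnion (fun q => (Ioc 0 ⌊x⌋₊).filter (fun n => q ^ 2 ∣ n))).card : ℝ) := by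
        exact_mod_cast card_le_card hsub
    _ ≤ ∑ q ∈ Ioc Y ⌊x⌋₊, ((((Ioc 0 ⌊x⌋₊).filter (fun n => q ^ 2 ∣ n)).card : ℕ) : ℝ) := by
        exact_mod_cast card_biUnion_le
    _ = ∑ q ∈ Ioc Y ⌊x⌋₊, (((⌊x⌋₊ / q ^ 2 : ℕ)) : ℝ) := by
        refine sum_congr rfl fun q _ => ?_
        rw [Nat.Ioc_filter_dvd_card_eq_div]
    _ ≤ ∑ q ∈ Ioc Y ⌊x⌋₊, x * (1 / ((q : ℝ) ^ 2)) := by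
        refine sum_le_sum fun q hq => ?_
        rw [mem_Ioc] at hq
        have hq0 : (0 : ℝ) < (q : ℝ) ^ 2 := by
          have : (0 : ℝ) < q := by exact_mod_cast (show 0 < q by omega)
          positivity
        calc (((⌊x⌋₊ / q ^ 2 : ℕ)) : ℝ) ≤ (⌊x⌋₊ : ℝ) / ((q ^ 2 : ℕ) : ℝ) := Nat.cast_div_le
          _ = (⌊x⌋₊ : ℝ) / ((q : ℝ) ^ 2) := by push_cast; ring
          _ ≤ x / ((q : ℝ) ^ 2) := div_le_div_of_nonneg_right (Nat.floor_le hx0) hq0.le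
          _ = x * (1 / ((q : ℝ) ^ 2)) := by ring
    _ = x * ∑ q ∈ Ioc Y ⌊x⌋₊, (1 / ((q : ℝ) ^ 2)) := by rw [mul_sum]
    _ ≤ x * (1 / (Y : ℝ)) := mul_le_mul_of_nonneg_left (sum_Ioc_inv_sq_le hY1 _) hx0
    _ = x / Y := by ring

theorem rpow_half_le_half_rpow {ν x : ℝ} (hν : 0 < ν) (hx : 4 ≤ x) : x ^ (ν / 2) ≤ (x / 2) ^ ν := by
  have hx0 : 0 ≤ x := by linarith
  have h4 : (4 : ℝ) ^ (1 / 2 : ℝ) = 2 := by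
    rw [show (4 : ℝ) = (2 : ℝ) ^ (2 : ℝ) by norm_num, ← Real.rpow_mul (by norm_num)]
    norm_num
  have hsqrt2 : (2 : ℝ) ≤ x ^ (1 / 2 : ℝ) := by
    have := Real.rpow_le_rpow (by norm_num : (0 : ℝ) ≤ 4) hx (by norm_num : (0 : ℝ) ≤ 1 / 2)
    rwa [h4] at this
  have hsq : x ^ (1 / 2 : ℝ) * x ^ (1 / 2 : ℝ) = x := by
    rw [← Real.rpow_add (by linarith : (0 : ℝ) < x)]; norm_num
  have hle : x ^ (1 / 2 : ℝ) ≤ x / 2 := by nlinarith [Real.rpow_nonneg hx0 (1 / 2 : ℝ)]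
  calc x ^ (ν / 2) = (x ^ (1 / 2 : ℝ)) ^ ν := by rw [← Real.rpow_mul hx0]; congr 1; ring
    _ ≤ (x / 2) ^ ν := Real.rpow_le_rpow (Real.rpow_nonneg hx0 _) hle hν.le

theorem sum_SFset_Hwt_eq {ν : ℝ} {g : VecFn} (hadm : Admissible ν g) (x : ℝ) :
    ∑ n ∈ SFset ν x, Hwt g ν n = ∑ n ∈ SFset ν x, starSum g n.primeFactorsList.length (pvec n n) := by
  refine sum_congr rfl fun n hn => ?_
  rw [mem_SFset, mem_Nset] at hn
  obtain ⟨⟨-, hn2, -, hr⟩, hsq⟩ := hn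
  rw [Hwt_eq_sum_of_rough hadm hn2 hr, sum_divisors_eq_starSum n (by omega) hsq g]

theorem mainTerm_of_sqfree (hT : Signature.sqfreeMainTerm) : Signature.mainTerm := by
  intro ν hν hν4 g hadm ε hε
  obtain ⟨M, hM⟩ := Hwt_abs_le hν hadm.2.1
  set M' : ℝ := |M| + 1 with hM'
  have hM'pos : 0 < M' := by positivity
  have hMM' : M ≤ M' := by rw [hM']; linarith [le_abs_self M]
  obtain ⟨x₁, hx₁⟩ := hT ν hν hν4 g hadm (ε / 2) (by positivity)
  set c : ℝ := ε / (4 * M') with hc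
  have hcpos : 0 < c := by positivity
  have hν2 : 0 < ν / 2 := by positivity
  have hev : ∀ᶠ x : ℝ in Filter.atTop,
      ((2 : ℝ) ≤ x ^ (ν / 2) ∧ Real.log x ≤ c * x ^ (ν / 2)) ∧ (4 : ℝ) ≤ x := by
    refine ((Filter.Tendsto.eventually_ge_atTop (tendsto_rpow_atTop hν2) 2).and ?_).and
      (Filter.eventually_ge_atTop 4)
    have hlo := (isLittleO_log_rpow_atTop hν2).def hcpos
    filter_upwards [hlo, Filter.eventually_ge_atTop (1 : ℝ)] with x hx hx1
    rw [Real.norm_eq_abs, Real.norm_eq_abs, abs_of_nonneg (Real.log_nonneg hx1),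
      abs_of_nonneg (Real.rpow_nonneg (by linarith) _)] at hx
    exact hx
  obtain ⟨x₂, hx₂⟩ := Filter.eventually_atTop.1 hev
  refine ⟨max x₁ x₂, fun x hx => ?_⟩
  obtain ⟨⟨hpow2, hlog⟩, hx4⟩ := hx₂ x (le_trans (le_max_right _ _) hx)
  have hxx₁ : x₁ ≤ x := le_trans (le_max_left _ _) hx
  have hx0 : 0 ≤ x := by linarith
  have hlogpos : 0 < Real.log x := Real.log_pos (by linarith)
  set Y : ℕ := ⌊x ^ (ν / 2)⌋₊ with hYdef
  have hY1 : 1 ≤ Y := Nat.le_floor (by push_cast; linarith)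
  have hYle : (Y : ℝ) ≤ (x / 2) ^ ν :=
    (Nat.floor_le (Real.rpow_nonneg hx0 _)).trans (rpow_half_le_half_rpow hν hx4)
  have hYge : x ^ (ν / 2) / 2 ≤ Y := by
    have := Nat.lt_floor_add_one (x ^ (ν / 2))
    push_cast at this
    linarith
  have hYpos : (0 : ℝ) < Y := by exact_mod_cast (show 0 < Y by omega)
  have hNSF : |∑ n ∈ NSFset ν x, Hwt g ν n| ≤ M' * (x / Y) := by
    calc |∑ n ∈ NSFset ν x, Hwt g ν n| ≤ ∑ n ∈ NSFset ν x, |Hwt g ν n| := abs_sum_le_sum_abs _ _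
      _ ≤ ∑ _n ∈ NSFset ν x, M' := by
          refine sum_le_sum fun n hn => ?_
          rw [mem_NSFset, mem_Nset] at hn
          exact (hM n hn.1.2.1 hn.1.2.2.2).trans hMM'
      _ = M' * (NSFset ν x).card := by rw [sum_const, nsmul_eq_mul]; ring
      _ ≤ M' * (x / Y) := mul_le_mul_of_nonneg_left (card_NSFset_le hν (by linarith) hY1 hYle) hM'pos.le
  have hsmall : M' * (x / Y) ≤ ε / 2 * x / Real.log x := by
    rw [show M' * (x / Y) = M' * x / Y by ring, div_le_div_iff₀ hYpos hlogpos]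
    have h1 : Real.log x ≤ c * (2 * Y) := hlog.trans (by nlinarith)
    have h2 : M' * Real.log x ≤ ε / 2 * Y := by
      calc M' * Real.log x ≤ M' * (c * (2 * Y)) := mul_le_mul_of_nonneg_left h1 hM'pos.le
        _ = ε / 2 * Y := by rw [hc]; field_simp; ring
    nlinarith
  have hSF := hx₁ x hxx₁
  rw [sum_Nset_eq_SF_add_NSF, sum_SFset_Hwt_eq hadm]
  calc |∑ n ∈ SFset ν x, starSum g n.primeFactorsList.length (pvec n n) + ∑ n ∈ NSFset ν x, Hwt g ν n -
          (sieveBoundG1 ν g - 1) * ((windowPrimes x).card : ℝ)|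
      = |(∑ n ∈ SFset ν x, starSum g n.primeFactorsList.length (pvec n n) -
          (sieveBoundG1 ν g - 1) * ((windowPrimes x).card : ℝ)) + ∑ n ∈ NSFset ν x, Hwt g ν n| := by
        congr 1; ring
    _ ≤ |∑ n ∈ SFset ν x, starSum g n.primeFactorsList.length (pvec n n) -
          (sieveBoundG1 ν g - 1) * ((windowPrimes x).card : ℝ)| + |∑ n ∈ NSFset ν x, Hwt g ν n| := abs_add_le _ _
    _ ≤ ε / 2 * x / Real.log x + ε / 2 * x / Real.log x := add_le_add hSF (hNSF.trans hsmall)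
    _ = ε * x / Real.log x := by ring

theorem mem_SFkset {ν x : ℝ} {k n : ℕ} : n ∈ SFkset ν x k ↔ n ∈ SFset ν x ∧ n.primeFactorsList.length = k := by
  unfold SFkset; simp [mem_filter]

theorem sieveBoundG1_eq (ν : ℝ) (g : VecFn) :
    sieveBoundG1 ν g = 1 + ∑ k ∈ Icc 2 ⌊1 / ν⌋₊, sliceIntegral k 1 (sliceTest ν g k) := rfl

theorem starSum_vk_eq (g : VecFn) {k n : ℕ} (hk : n.primeFactorsList.length = k) :
    starSum g k (vk k n) = starSum g n.primeFactorsList.length (pvec n n) := by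
  subst hk
  congr 1
  funext i
  simp only [vk, pvec, List.getD_eq_getElem?_getD, List.getElem?_eq_getElem i.isLt, Option.getD_some,
    List.get_eq_getElem]

theorem sum_SFset_fiberwise {ν x : ℝ} (hν : 0 < ν) (F : ℕ → ℝ) :
    ∑ n ∈ SFset ν x, F n = ∑ k ∈ Icc 2 ⌊1 / ν⌋₊, ∑ n ∈ SFkset ν x k, F n := by
  classical
  have hmaps : ∀ n ∈ SFset ν x, n.primeFactorsList.length ∈ Icc 2 ⌊1 / ν⌋₊ := by
    intro n hn
    rw [mem_SFset, mem_Nset] at hn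
    obtain ⟨⟨-, hn2, hnp, hr⟩, -⟩ := hn
    rw [mem_Icc]
    refine ⟨two_le_length_of_not_prime hn2 hnp, ?_⟩
    apply Nat.le_floor
    rw [le_div_iff₀ hν]
    exact (length_mul_lt_one_of_rough hn2 hr).le
  rw [← sum_fiberwise_of_maps_to hmaps F]
  refine sum_congr rfl fun k _ => ?_
  apply sum_congr _ (fun _ _ => rfl)
  ext n
  rw [mem_filter, mem_SFkset]

theorem sqfreeMainTerm_of_slice (hS : Signature.sliceMainTerm) : Signature.sqfreeMainTerm := by
  intro ν hν hν4 g hadm ε hε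
  classical
  set K : ℕ := ⌊1 / ν⌋₊ with hK
  have hε' : 0 < ε / ((K : ℝ) + 1) := by positivity
  have hk : ∀ k ∈ Icc 2 K, ∃ x₀ : ℝ, ∀ x : ℝ, x₀ ≤ x →
      |∑ n ∈ SFkset ν x k, starSum g k (vk k n) - sliceIntegral k 1 (sliceTest ν g k) * ((windowPrimes x).card : ℝ)|
        ≤ ε / ((K : ℝ) + 1) * x / Real.log x := by
    intro k hk
    rw [mem_Icc] at hk
    exact hS ν hν hν4 g hadm k hk.1 hk.2 _ hε'
  choose! x₀ hx₀ using hk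
  refine ⟨(∑ k ∈ Icc 2 K, |x₀ k|) + 2, fun x hx => ?_⟩
  have hsum0 : 0 ≤ ∑ k ∈ Icc 2 K, |x₀ k| := sum_nonneg fun k _ => abs_nonneg _
  have hx2 : 2 ≤ x := by linarith
  have hx0 : 0 ≤ x := by linarith
  have hlogpos : 0 < Real.log x := Real.log_pos (by linarith)
  have hxk : ∀ k ∈ Icc 2 K, x₀ k ≤ x := by
    intro k hk
    have h1 : |x₀ k| ≤ ∑ j ∈ Icc 2 K, |x₀ j| := single_le_sum (fun j _ => abs_nonneg (x₀ j)) hk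
    linarith [le_abs_self (x₀ k)]
  have hL : ∑ n ∈ SFset ν x, starSum g n.primeFactorsList.length (pvec n n)
      = ∑ k ∈ Icc 2 K, ∑ n ∈ SFkset ν x k, starSum g k (vk k n) := by
    rw [sum_SFset_fiberwise hν]
    refine sum_congr rfl fun k _ => sum_congr rfl fun n hn => ?_
    rw [mem_SFkset] at hn
    exact (starSum_vk_eq g hn.2).symm
  have hV : sieveBoundG1 ν g - 1 = ∑ k ∈ Icc 2 K, sliceIntegral k 1 (sliceTest ν g k) := by
    rw [sieveBoundG1_eq]; ring
  rw [hL, hV, sum_mul, ← sum_sub_distrib]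
  have hK1 : (K : ℝ) + 1 ≠ 0 := by positivity
  have hcard : ((Icc 2 K).card : ℝ) ≤ (K : ℝ) + 1 := by
    have : (Icc 2 K).card ≤ K + 1 := by rw [Nat.card_Icc]; omega
    exact_mod_cast this
  have hterm0 : 0 ≤ ε / ((K : ℝ) + 1) * x / Real.log x := div_nonneg (mul_nonneg hε'.le hx0) hlogpos.le
  calc |∑ k ∈ Icc 2 K, (∑ n ∈ SFkset ν x k, starSum g k (vk k n)
          - sliceIntegral k 1 (sliceTest ν g k) * ((windowPrimes x).card : ℝ))|
      ≤ ∑ k ∈ Icc 2 K, |∑ n ∈ SFkset ν x k, starSum g k (vk k n)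
          - sliceIntegral k 1 (sliceTest ν g k) * ((windowPrimes x).card : ℝ)| := abs_sum_le_sum_abs _ _
    _ ≤ ∑ _k ∈ Icc 2 K, ε / ((K : ℝ) + 1) * x / Real.log x := sum_le_sum fun k hk => hx₀ k hk x (hxk k hk)
    _ = ((Icc 2 K).card : ℝ) * (ε / ((K : ℝ) + 1) * x / Real.log x) := by rw [sum_const, nsmul_eq_mul]
    _ ≤ ((K : ℝ) + 1) * (ε / ((K : ℝ) + 1) * x / Real.log x) := mul_le_mul_of_nonneg_right hcard hterm0
    _ = ε * x / Real.log x := by field_simp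

theorem isSymmetric_hfun {ν : ℝ} {g : VecFn} (hs : g.IsSymmetric) (k : ℕ) : (hfun ν g k).IsSymmetric := by
  intro K σ v
  unfold hfun
  have hiff : (∀ i, ν < (v ∘ σ) i) ↔ ∀ i, ν < v i := by
    constructor
    · intro h i
      have := h (σ.symm i)
      simpa using this
    · intro h i
      exact h (σ i)
  by_cases hc : K = k ∧ ∀ i, ν < v i
  · rw [if_pos hc, if_pos (⟨hc.1, hiff.2 hc.2⟩ : K = k ∧ ∀ i, ν < (v ∘ σ) i), starSum_perm hs]
  · rw [if_neg hc, if_neg (fun h => hc ⟨h.1, hiff.1 h.2⟩)]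

theorem rpow_lt_iff_lt_log_div {ν : ℝ} {n p : ℕ} (hn : 2 ≤ n) (hp : 0 < p) :
    (n : ℝ) ^ ν < (p : ℝ) ↔ ν < Real.log p / Real.log n := by
  have hn0 : (0 : ℝ) < n := by exact_mod_cast (show 0 < n by omega)
  have hlogn : 0 < Real.log n := Real.log_pos (by exact_mod_cast (show 1 < n by omega))
  have hp0 : (0 : ℝ) < p := by exact_mod_cast hp
  rw [lt_div_iff₀ hlogn, ← Real.log_rpow hn0, Real.log_lt_log_iff (Real.rpow_pos_of_pos hn0 ν) hp0]

theorem wseq_hfun_eq {ν x : ℝ} {g : VecFn} (hs : g.IsSymmetric) {k : ℕ} (hk : 2 ≤ k) {n : ℕ}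
    (hn : n ∈ window x) :
    wseq (hfun ν g k) n = if n ∈ SFkset ν x k then starSum g k (vk k n) else 0 := by
  classical
  by_cases hsq : Squarefree n
  swap
  · rw [wseq_of_not_squarefree _ hsq, if_neg]
    rw [mem_SFkset, mem_SFset]
    exact fun h => hsq h.1.2
  have hn0 : n ≠ 0 := hsq.ne_zero
  set L := n.primeFactorsList with hL
  have hnd : L.Nodup := (Nat.squarefree_iff_nodup_primeFactorsList hn0).1 hsq
  let e : Fin L.length ≃ ↥n.primeFactors :=
    (hnd.getEquiv L).trans (Equiv.subtypeEquivRight (fun p => by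
      rw [hL, ← Nat.mem_primeFactors_iff_mem_primeFactorsList]))
  have he : ∀ i, ((e i : ℕ) : ℝ) = (L.get i : ℝ) := by
    intro i; rfl
  rw [wseq_eq_of_equiv (isSymmetric_hfun hs k) hsq e]
  simp only [he]
  unfold hfun
  by_cases hlen : L.length = k
  · -- dimension `k`: the roughness condition is `IsRough`, the value is `(𝟙⋆g)(𝐯ₖ(n))`
    have hn2 : 2 ≤ n := by
      by_contra hlt
      have hn1 : n = 1 := by omega
      have : L.length = 0 := by rw [hL, hn1, Nat.primeFactorsList_one]; rfl
      omega
    have hnp : ¬ n.Prime := by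
      intro hpr
      have : L.length = 1 := by rw [hL, Nat.primeFactorsList_prime hpr]; rfl
      omega
    have hrough : (∀ i : Fin L.length, ν < Real.log (L.get i : ℝ) / Real.log n) ↔ IsRough ν n := by
      constructor
      · intro h p hp
        have hpL : p ∈ L := by rwa [hL, ← Nat.mem_primeFactors_iff_mem_primeFactorsList]
        obtain ⟨i, hi⟩ := List.mem_iff_get.1 hpL
        have hp0 : 0 < p := (Nat.prime_of_mem_primeFactorsList (by rwa [hL] at hpL)).pos
        rw [rpow_lt_iff_lt_log_div hn2 hp0, ← hi]
        exact h i
      · intro h i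
        have hpL : L.get i ∈ L := List.get_mem L i
        have hpr : (L.get i).Prime := Nat.prime_of_mem_primeFactorsList (n := n) hpL
        have hpF : L.get i ∈ n.primeFactors := by
          rw [Nat.mem_primeFactors_iff_mem_primeFactorsList, ← hL]; exact hpL
        rw [← rpow_lt_iff_lt_log_div hn2 hpr.pos]
        exact h _ hpF
    have hval : starSum g L.length (fun i => Real.log (L.get i : ℝ) / Real.log n) = starSum g k (vk k n) := by
      rw [starSum_vk_eq g hlen]
      rfl
    by_cases hr : IsRough ν n
    · rw [if_pos ⟨hlen, hrough.2 hr⟩, hval, if_pos]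
      rw [mem_SFkset, mem_SFset, mem_Nset]
      exact ⟨⟨⟨hn, hn2, hnp, hr⟩, hsq⟩, hlen⟩
    · rw [if_neg (fun h => hr (hrough.1 h.2)), if_neg]
      rw [mem_SFkset, mem_SFset, mem_Nset]
      exact fun h => hr h.1.1.2.2.2
  · rw [if_neg (fun h => hlen h.1), if_neg]
    rw [mem_SFkset]
    exact fun h => hlen h.2

theorem SFkset_subset_window {ν x : ℝ} {k : ℕ} : SFkset ν x k ⊆ window x := by
  intro n hn
  rw [mem_SFkset, mem_SFset, mem_Nset] at hn
  exact hn.1.1.1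

theorem sum_SFkset_eq_Vsum {ν x : ℝ} {g : VecFn} (hs : g.IsSymmetric) {k : ℕ} (hk : 2 ≤ k) :
    ∑ n ∈ SFkset ν x k, starSum g k (vk k n) = Vsum (hfun ν g k) x 1 ⌊x⌋₊ := by
  classical
  unfold Vsum
  have hW : (Icc 1 ⌊x⌋₊).filter (fun r : ℕ => x / 2 < ((1 * r : ℕ) : ℝ)) = window x := by
    ext r
    rw [mem_filter, mem_window, mem_Icc, one_mul]
  rw [hW]
  calc ∑ n ∈ SFkset ν x k, starSum g k (vk k n)
      = ∑ n ∈ (window x).filter (fun n => n ∈ SFkset ν x k), starSum g k (vk k n) := by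
        apply sum_congr _ (fun _ _ => rfl)
        ext n
        rw [mem_filter]
        exact ⟨fun h => ⟨SFkset_subset_window h, h⟩, fun h => h.2⟩
    _ = ∑ n ∈ window x, (if n ∈ SFkset ν x k then starSum g k (vk k n) else 0) := sum_filter _ _
    _ = ∑ n ∈ window x, wseq (hfun ν g k) (1 * n) := by
        refine sum_congr rfl fun n hn => ?_
        rw [one_mul, wseq_hfun_eq hs hk hn]

theorem sliceMainTerm_of_Vsum (hV : Signature.VsumMainTerm) : Signature.sliceMainTerm := by
  intro ν hν hν4 g hadm k hk hkK ε hε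
  obtain ⟨x₀, hx₀⟩ := hV ν hν hν4 g hadm k hk hkK ε hε
  refine ⟨x₀, fun x hx => ?_⟩
  rw [sum_SFkset_eq_Vsum hadm.1 hk]
  exact hx₀ x hx

/-- The summand of the tree's `injSum h x 1 ⌊x⌋ k` is literally `mainG1` (definitional check, `rfl`). -/
example (ν : ℝ) (g : VecFn) (k : ℕ) (x : ℝ) :
    injSum (hfun ν g k) x 1 ⌊x⌋₊ k =
      ∑ q ∈ (Fintype.piFinset fun _ : Fin k => Nat.primesLE ⌊x⌋₊).filter
          (fun q => Function.Injective q ∧ ∀ i, q i ∉ (1 : ℕ).primeFactors),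
        mainG1 ν g k x (logVec x q) := rfl

/-- **The per-dimension main term in §6.2 form from its two halves** (`ε/2 + ε/2`). -/
theorem VsumMainTerm_of (hA : Signature.VsumIntegral) (hB : Signature.integralMainTerm) :
    Signature.VsumMainTerm := by
  intro ν hν hν4 g hadm k hk hkK ε hε
  have hε2 : 0 < ε / 2 := by linarith
  obtain ⟨x₁, hx₁⟩ := hA ν hν hν4 g hadm k hk hkK (ε / 2) hε2
  obtain ⟨x₂, hx₂⟩ := hB ν hν hν4 g hadm k hk hkK (ε / 2) hε2
  refine ⟨max x₁ x₂, fun x hx => ?_⟩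
  have h1 := hx₁ x (le_trans (le_max_left _ _) hx)
  have h2 := hx₂ x (le_trans (le_max_right _ _) hx)
  calc |Vsum (hfun ν g k) x 1 ⌊x⌋₊ - sliceIntegral k 1 (sliceTest ν g k) * ((windowPrimes x).card : ℝ)|
      = |(Vsum (hfun ν g k) x 1 ⌊x⌋₊ - (1 / (k.factorial : ℝ)) * primeTupleIntegral k x (mainG1 ν g k x))
          + ((1 / (k.factorial : ℝ)) * primeTupleIntegral k x (mainG1 ν g k x)
              - sliceIntegral k 1 (sliceTest ν g k) * ((windowPrimes x).card : ℝ))| := by congr 1; ring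
    _ ≤ |Vsum (hfun ν g k) x 1 ⌊x⌋₊ - (1 / (k.factorial : ℝ)) * primeTupleIntegral k x (mainG1 ν g k x)|
          + |(1 / (k.factorial : ℝ)) * primeTupleIntegral k x (mainG1 ν g k x)
              - sliceIntegral k 1 (sliceTest ν g k) * ((windowPrimes x).card : ℝ)| := abs_add_le _ _
    _ ≤ ε / 2 * x / Real.log x + ε / 2 * x / Real.log x := add_le_add h1 h2
    _ = ε * x / Real.log x := by ring

/-- Only the dimension `s = k` survives in `Σ_s (1/s!) injSum_s` for `h = hfun ν g k` (`#primeFactors 1 = 0`). -/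
theorem injSum_hfun_of_ne {ν x : ℝ} {g : VecFn} {k s : ℕ} (hs : s ≠ k) : injSum (hfun ν g k) x 1 ⌊x⌋₊ s = 0 := by
  classical
  unfold injSum
  refine sum_eq_zero fun q _ => ?_
  unfold mainG
  have ht : (1 : ℕ).primeFactors.card + s ≠ k := by
    rw [Nat.primeFactors_one, card_empty, zero_add]; exact hs
  split_ifs
  · exact hfun_of_ne ht _
  · rfl

/-- **`Vsum (hfun ν g k) x 1 ⌊x⌋ = (1/k!)·injSum (hfun ν g k) x 1 ⌊x⌋ k`** (`x ≥ 2`), from the tree's `Vsum_eq_sum_injSum`. -/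
theorem Vsum_hfun_eq {ν x : ℝ} {g : VecFn} (hs : g.IsSymmetric) {k : ℕ} (hk : 2 ≤ k) (hx : 2 ≤ x) :
    Vsum (hfun ν g k) x 1 ⌊x⌋₊ = (1 / (k.factorial : ℝ)) * injSum (hfun ν g k) x 1 ⌊x⌋₊ k := by
  have hvan : ∀ K, k < K → ∀ v, hfun ν g k K v = 0 := fun K hK v => hfun_of_ne (by omega) v
  have hmx : ((1 : ℕ) : ℝ) ≤ x / 2 := by rw [Nat.cast_one]; linarith
  have hR : ((⌊x⌋₊ : ℕ) : ℝ) ≤ x / ((1 : ℕ) : ℝ) := by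
    rw [Nat.cast_one, div_one]; exact Nat.floor_le (by linarith)
  rw [Vsum_eq_sum_injSum (isSymmetric_hfun hs k) hvan (by linarith : (1 : ℝ) < x) (m := 1) squarefree_one hmx hR
    (Smax := k) le_rfl]
  rw [sum_eq_single_of_mem k (by rw [mem_Icc]; omega)]
  intro s _ hsk
  rw [injSum_hfun_of_ne hsk, mul_zero]

/-- **Stub 1a from the injective-tuple form** (the factor `1/k! ≤ 1`). -/
theorem VsumIntegral_of_injSum (h : Signature.injSumIntegral) : Signature.VsumIntegral := by
  intro ν hν hν4 g hadm k hk hkK ε hε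
  obtain ⟨x₀, hx₀⟩ := h ν hν hν4 g hadm k hk hkK ε hε
  refine ⟨max x₀ 2, fun x hx => ?_⟩
  have hx2 : 2 ≤ x := le_trans (le_max_right _ _) hx
  have h1 := hx₀ x (le_trans (le_max_left _ _) hx)
  have hkpos : (0 : ℝ) < 1 / (k.factorial : ℝ) := by positivity
  rw [Vsum_hfun_eq hadm.1 hk hx2, ← mul_sub, abs_mul, abs_of_pos hkpos]
  have hfac : 1 / (k.factorial : ℝ) ≤ 1 := by
    rw [div_le_one (by positivity)]
    have : (1 : ℕ) ≤ k.factorial := Nat.succ_le_of_lt (Nat.factorial_pos k)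
    exact_mod_cast this
  have h0 : 0 ≤ ε * x / Real.log x :=
    div_nonneg (mul_nonneg hε.le (by linarith)) (Real.log_nonneg (by linarith))
  calc 1 / (k.factorial : ℝ) * |injSum (hfun ν g k) x 1 ⌊x⌋₊ k - primeTupleIntegral k x (mainG1 ν g k x)|
      ≤ 1 * (ε * x / Real.log x) := mul_le_mul hfac h1 (abs_nonneg _) zero_le_one
    _ = ε * x / Real.log x := one_mul _

/-- A symmetric piecewise-constant-on-the-cone `g` is bounded in each dimension (all inputs, by sorting). -/
theorem exists_abs_apply_le {g : VecFn} (hs : g.IsSymmetric) (hpc : IsPiecewiseConstOnCone g) (K : ℕ) :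
    ∃ C : ℝ, ∀ v : Fin K → ℝ, |g K v| ≤ C := by
  classical
  obtain ⟨m, P, c, hP, hg⟩ := hpc K
  refine ⟨∑ j, |c j|, fun v => ?_⟩
  have hmono : Monotone (v ∘ Tuple.sort v) := Tuple.monotone_sort v
  rw [← hs K (Tuple.sort v) v, hg _ hmono]
  calc |∑ j, (if (v ∘ Tuple.sort v) ∈ P j then c j else 0)|
      ≤ ∑ j, |if (v ∘ Tuple.sort v) ∈ P j then c j else 0| := abs_sum_le_sum_abs _ _
    _ ≤ ∑ j, |c j| := sum_le_sum fun j _ => by split_ifs <;> simp [abs_nonneg]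

theorem exists_abs_starSum_le {g : VecFn} (hs : g.IsSymmetric) (hpc : IsPiecewiseConstOnCone g) (K : ℕ) :
    ∃ S : ℝ, ∀ v : Fin K → ℝ, |starSum g K v| ≤ S := by
  classical
  have hC := fun j => exists_abs_apply_le hs hpc j
  choose C hC using hC
  refine ⟨∑ A : Finset (Fin K), C A.card, fun v => ?_⟩
  unfold starSum
  calc |∑ A : Finset (Fin K), g A.card (fun i => v (A.orderEmbOfFin rfl i))|
      ≤ ∑ A : Finset (Fin K), |g A.card (fun i => v (A.orderEmbOfFin rfl i))| := abs_sum_le_sum_abs _ _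
    _ ≤ ∑ A : Finset (Fin K), C A.card := sum_le_sum fun A _ => hC _ _

theorem hfun_ne_zero_imp {ν : ℝ} {g : VecFn} {k K : ℕ} {v : Fin K → ℝ} (h : hfun ν g k K v ≠ 0) : ∀ i, ν ≤ v i := by
  unfold hfun at h
  by_cases hc : K = k ∧ ∀ i, ν < v i
  · exact fun i => (hc.2 i).le
  · rw [if_neg hc] at h; exact absurd rfl h

theorem exists_abs_hfun_le {g : VecFn} (hs : g.IsSymmetric) (hpc : IsPiecewiseConstOnCone g) (ν : ℝ) (k : ℕ) :
    ∃ Hb : ℝ, ∀ (K : ℕ) (v : Fin K → ℝ), |hfun ν g k K v| ≤ Hb := by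
  obtain ⟨S, hS⟩ := exists_abs_starSum_le hs hpc k
  refine ⟨max S 0, fun K v => ?_⟩
  unfold hfun
  by_cases hc : K = k ∧ ∀ i, ν < v i
  · rw [if_pos hc]
    obtain ⟨rfl, -⟩ := hc
    exact (hS v).trans (le_max_left _ _)
  · rw [if_neg hc, abs_zero]; exact le_max_right _ _

/-- The range condition `hρ` of the tree lemmas at `m = 1`: `1/2 ≤ 0 + log(x/2)/log x` for `x ≥ 4`. -/
theorem hrho_one {x : ℝ} (hx : 4 ≤ x) :
    1 / 2 ≤ (∑ i, uvec x 1 i) + Real.log (x / (2 * ((1 : ℕ) : ℝ))) / Real.log x := by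
  have ht : (1 : ℕ).primeFactors.card = 0 := by rw [Nat.primeFactors_one, card_empty]
  have hsum : (∑ i, uvec x 1 i) = 0 :=
    sum_eq_zero fun i _ => by exfalso; have hi := i.isLt; omega
  have hx0 : 0 < x := by linarith
  have hlogpos : 0 < Real.log x := Real.log_pos (by linarith)
  have hlog4 : Real.log 4 ≤ Real.log x := Real.log_le_log (by norm_num) hx
  have hlog22 : Real.log 4 = Real.log 2 + Real.log 2 := by
    rw [show (4 : ℝ) = 2 * 2 by norm_num, Real.log_mul (by norm_num) (by norm_num)]
  rw [hsum, zero_add, Nat.cast_one, mul_one, Real.log_div hx0.ne' (by norm_num), le_div_iff₀ hlogpos]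
  linarith

/-- **Stub 1a from the full-tuple form**: the tuples with a repeated prime contribute `O(x^{1−ν/2})` (the … -/
theorem injSumIntegral_of_tupleSum (h : Signature.tupleSumIntegral) : Signature.injSumIntegral := by
  intro ν hν hν4 g hadm k hk hkK ε hε
  obtain ⟨d, rfl⟩ : ∃ d, k = d + 1 := ⟨k - 1, by omega⟩
  have hs : g.IsSymmetric := hadm.1
  have hν2 : 0 < ν / 2 := by positivity
  have hν21 : ν / 2 ≤ 1 := by linarith
  have hε2 : 0 < ε / 2 := by linarith
  obtain ⟨x₀, hx₀⟩ := h ν hν hν4 g hadm (d + 1) hk hkK (ε / 2) hε2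
  obtain ⟨Hb, hHb⟩ := exists_abs_hfun_le hs hadm.2.1 ν (d + 1)
  have hHb0 : 0 ≤ Hb := (abs_nonneg _).trans (hHb 0 fun i => i.elim0)
  obtain ⟨C, hC0, X, hX2, hcorner⟩ := exists_primeTupleSum_cornerInd_le (ν / 2) hν2 hν21 d
  set Lf : ℝ := Hb * ((d : ℝ) + 1) * ((d : ℝ) + 1 + ((1 : ℕ).primeFactors.card : ℝ)) with hLf
  have hLf0 : 0 ≤ Lf := by rw [hLf]; positivity
  set c : ℝ := ε / (4 * (Lf * C + 1)) with hcdef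
  have hLC0 : 0 ≤ Lf * C := mul_nonneg hLf0 hC0
  have hcpos : 0 < c := by rw [hcdef]; positivity
  have hev : ∀ᶠ x : ℝ in Filter.atTop, Real.log x ≤ c * x ^ (ν / 2) := by
    have hlo := (isLittleO_log_rpow_atTop hν2).def hcpos
    filter_upwards [hlo, Filter.eventually_ge_atTop (1 : ℝ)] with x hx hx1
    rw [Real.norm_eq_abs, Real.norm_eq_abs, abs_of_nonneg (Real.log_nonneg hx1),
      abs_of_nonneg (Real.rpow_nonneg (by linarith) _)] at hx
    exact hx
  obtain ⟨N, hN⟩ := Filter.eventually_atTop.1 hev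
  refine ⟨max (max x₀ X) (max 4 N), fun x hx => ?_⟩
  have hxx₀ : x₀ ≤ x := le_trans (le_trans (le_max_left _ _) (le_max_left _ _)) hx
  have hxX : X ≤ x := le_trans (le_trans (le_max_right _ _) (le_max_left _ _)) hx
  have hx4 : 4 ≤ x := le_trans (le_trans (le_max_left _ _) (le_max_right _ _)) hx
  have hxN : N ≤ x := le_trans (le_trans (le_max_right _ _) (le_max_right _ _)) hx
  have hlog := hN x hxN
  have hx1 : 1 ≤ x := by linarith
  have hx0 : 0 < x := by linarith
  have hlogpos : 0 < Real.log x := Real.log_pos (by linarith)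
  set c₁ : ℝ := Real.log ((⌊x⌋₊ : ℕ) : ℝ) / Real.log x with hc₁
  have hsupp : ∀ (K : ℕ) (v : Fin K → ℝ), hfun ν g (d + 1) K v ≠ 0 → ∀ i, ν ≤ v i :=
    fun K v hv => hfun_ne_zero_imp hv
  have hrep : |primeTupleSum (d + 1) x (mainG1 ν g (d + 1) x) - injSum (hfun ν g (d + 1)) x 1 ⌊x⌋₊ (d + 1)|
      ≤ Lf * primeTupleSum d x (cornerInd d (ν / 2) (c₁ - ν / 2)) := by
    have := abs_primeTupleSum_sub_injSum_le (isSymmetric_hfun hs (d + 1)) hν hsupp hHb ⌊x⌋₊ (hrho_one hx4) hc₁ d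
    rw [hLf]
    exact this
  have hfloor1 : (1 : ℝ) ≤ ((⌊x⌋₊ : ℕ) : ℝ) := by exact_mod_cast Nat.le_floor (by simpa using hx1)
  have hc₁le : c₁ ≤ 1 := by
    rw [hc₁, div_le_one hlogpos]
    exact Real.log_le_log (by linarith) (Nat.floor_le hx0.le)
  have hcor : primeTupleSum d x (cornerInd d (ν / 2) (c₁ - ν / 2)) ≤ C * (x ^ (1 - ν / 2) + 1) := by
    have h1 := hcorner x hxX (c₁ - ν / 2) (by linarith)
    have h2 : x ^ (c₁ - ν / 2) ≤ x ^ (1 - ν / 2) := Real.rpow_le_rpow_of_exponent_le hx1 (by linarith)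
    nlinarith
  have hpow : x ^ (1 - ν / 2) * x ^ (ν / 2) = x := by
    rw [← Real.rpow_add hx0]; norm_num
  have hsmall : x ^ (ν / 2) ≤ x := by
    have := Real.rpow_le_rpow_of_exponent_le hx1 hν21
    rwa [Real.rpow_one] at this
  have hkey : (x ^ (1 - ν / 2) + 1) * Real.log x ≤ 2 * c * x := by
    have hp0 : 0 ≤ x ^ (1 - ν / 2) := Real.rpow_nonneg hx0.le _
    calc (x ^ (1 - ν / 2) + 1) * Real.log x ≤ (x ^ (1 - ν / 2) + 1) * (c * x ^ (ν / 2)) :=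
          mul_le_mul_of_nonneg_left hlog (by positivity)
      _ = c * (x ^ (1 - ν / 2) * x ^ (ν / 2)) + c * x ^ (ν / 2) := by ring
      _ ≤ c * x + c * x := by rw [hpow]; exact add_le_add le_rfl (mul_le_mul_of_nonneg_left hsmall hcpos.le)
      _ = 2 * c * x := by ring
  have hcLC : 2 * c * (Lf * C) ≤ ε / 2 := by
    rw [hcdef]
    have h1 : Lf * C < Lf * C + 1 := by linarith
    have h4 : 0 < 4 * (Lf * C + 1) := by positivity
    rw [show 2 * (ε / (4 * (Lf * C + 1))) * (Lf * C) = (ε / 2) * ((Lf * C) / (Lf * C + 1)) by field_simp; ring]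
    have : (Lf * C) / (Lf * C + 1) ≤ 1 := by rw [div_le_one (by linarith)]; linarith
    calc ε / 2 * (Lf * C / (Lf * C + 1)) ≤ ε / 2 * 1 := mul_le_mul_of_nonneg_left this hε2.le
      _ = ε / 2 := mul_one _
  have hA : Lf * primeTupleSum d x (cornerInd d (ν / 2) (c₁ - ν / 2)) ≤ ε / 2 * x / Real.log x := by
    rw [le_div_iff₀ hlogpos]
    calc Lf * primeTupleSum d x (cornerInd d (ν / 2) (c₁ - ν / 2)) * Real.log x
        ≤ Lf * (C * (x ^ (1 - ν / 2) + 1)) * Real.log x :=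
          mul_le_mul_of_nonneg_right (mul_le_mul_of_nonneg_left hcor hLf0) hlogpos.le
      _ = (Lf * C) * ((x ^ (1 - ν / 2) + 1) * Real.log x) := by ring
      _ ≤ (Lf * C) * (2 * c * x) := mul_le_mul_of_nonneg_left hkey hLC0
      _ = (2 * c * (Lf * C)) * x := by ring
      _ ≤ (ε / 2) * x := mul_le_mul_of_nonneg_right hcLC hx0.le
  have hB := hx₀ x hxx₀
  calc |injSum (hfun ν g (d + 1)) x 1 ⌊x⌋₊ (d + 1) - primeTupleIntegral (d + 1) x (mainG1 ν g (d + 1) x)|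
      ≤ |injSum (hfun ν g (d + 1)) x 1 ⌊x⌋₊ (d + 1) - primeTupleSum (d + 1) x (mainG1 ν g (d + 1) x)|
          + |primeTupleSum (d + 1) x (mainG1 ν g (d + 1) x) - primeTupleIntegral (d + 1) x (mainG1 ν g (d + 1) x)| :=
        abs_sub_le _ _ _
    _ ≤ ε / 2 * x / Real.log x + ε / 2 * x / Real.log x := by
        refine add_le_add ?_ hB
        rw [abs_sub_comm]
        exact hrep.trans hA
    _ = ε * x / Real.log x := by ring

/-- A convex polytope (finitely many strict / non-strict linear constraints) is measurable. -/
theorem measurableSet_of_isConvexPolytope {m : ℕ} {P : Set (Fin m → ℝ)} (hP : IsConvexPolytope P) :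
    MeasurableSet P := by
  obtain ⟨-, S, T, hPeq⟩ := hP
  have hf : ∀ c : (Fin m → ℝ) × ℝ, Measurable (fun x : Fin m → ℝ => ∑ i, c.1 i * x i) :=
    fun c => Finset.measurable_sum _ fun i _ => measurable_const.mul (measurable_pi_apply i)
  have : P = (⋂ c ∈ S, {x | ∑ i, c.1 i * x i < c.2}) ∩ (⋂ c ∈ T, {x | ∑ i, c.1 i * x i ≤ c.2}) := by
    rw [hPeq]; ext x; simp only [Set.mem_setOf_eq, Set.mem_inter_iff, Set.mem_iInter]
  rw [this]
  exact (S.measurableSet_biInter fun c _ => measurableSet_lt (hf c) measurable_const).inter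
    (T.measurableSet_biInter fun c _ => measurableSet_le (hf c) measurable_const)

/-- The chamber `{v | v ∘ σ monotone}` is measurable. -/
theorem measurableSet_monotone_comp (m : ℕ) (σ : Equiv.Perm (Fin m)) :
    MeasurableSet {v : Fin m → ℝ | Monotone (v ∘ σ)} := by
  have : {v : Fin m → ℝ | Monotone (v ∘ σ)} = ⋂ i, ⋂ j, {v | i ≤ j → v (σ i) ≤ v (σ j)} := by
    ext v; simp [Monotone, Set.mem_iInter]
  rw [this]
  refine MeasurableSet.iInter fun i => MeasurableSet.iInter fun j => ?_
  by_cases hij : i ≤ j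
  · simp only [hij, true_implies]; exact measurableSet_le (measurable_pi_apply _) (measurable_pi_apply _)
  · simp [hij]

/-- **Each `g_m` is measurable** (symmetric + piecewise constant on the cone): … -/
theorem measurable_apply_dim {g : VecFn} (hs : g.IsSymmetric) (hpc : IsPiecewiseConstOnCone g) (m : ℕ) :
    Measurable (g m) := by
  classical
  obtain ⟨n, P, c, hP, hg⟩ := hpc m
  have hrepr : g m = fun v => ∑ j, if (∃ σ : Equiv.Perm (Fin m), Monotone (v ∘ σ) ∧ v ∘ σ ∈ P j) then c j else 0 := by
    funext v
    rw [← hs m (Tuple.sort v) v, hg _ (Tuple.monotone_sort v)]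
    refine sum_congr rfl fun j _ => ?_
    have hiff : (v ∘ Tuple.sort v ∈ P j) ↔ ∃ σ : Equiv.Perm (Fin m), Monotone (v ∘ σ) ∧ v ∘ σ ∈ P j := by
      constructor
      · exact fun h => ⟨Tuple.sort v, Tuple.monotone_sort v, h⟩
      · rintro ⟨σ, hσ, hσP⟩
        rwa [Tuple.unique_monotone (Tuple.monotone_sort v) hσ]
    simp only [hiff]
  rw [hrepr]
  refine Finset.measurable_sum _ fun j _ => Measurable.ite ?_ measurable_const measurable_const
  have hset : {v : Fin m → ℝ | ∃ σ : Equiv.Perm (Fin m), Monotone (v ∘ σ) ∧ v ∘ σ ∈ P j}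
      = ⋃ σ : Equiv.Perm (Fin m), ({v | Monotone (v ∘ σ)} ∩ (fun v => v ∘ σ) ⁻¹' (P j)) := by
    ext v; simp [Set.mem_iUnion]
  rw [hset]
  exact MeasurableSet.iUnion fun σ => (measurableSet_monotone_comp m σ).inter
    ((measurable_pi_lambda _ (fun i => measurable_pi_apply (σ i))) (measurableSet_of_isConvexPolytope (hP j).1))

/-- **`starSum g k` is measurable.** -/
theorem measurable_starSum {g : VecFn} (hs : g.IsSymmetric) (hpc : IsPiecewiseConstOnCone g) (k : ℕ) :
    Measurable (starSum g k) := by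
  unfold starSum
  exact Finset.measurable_sum _ fun A _ =>
    (measurable_apply_dim hs hpc A.card).comp (measurable_pi_lambda _ fun i => measurable_pi_apply _)

/-- **`h_k = hfun ν g k` is measurable in every dimension** (the `hmeas` hypothesis of the tree's
`integrable_mainG_mul_tupleWeight`). -/
theorem measurable_hfun {g : VecFn} (hs : g.IsSymmetric) (hpc : IsPiecewiseConstOnCone g) (ν : ℝ) (k K : ℕ) :
    Measurable (hfun ν g k K) := by
  classical
  unfold hfun
  refine Measurable.ite ?_ (measurable_starSum hs hpc K) measurable_const
  have : {v : Fin K → ℝ | K = k ∧ ∀ i, ν < v i} = {v | K = k} ∩ ⋂ i, {v | ν < v i} := by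
    ext v; simp [Set.mem_iInter]
  rw [this]
  exact (MeasurableSet.const _).inter (MeasurableSet.iInter fun i => measurableSet_lt measurable_const (measurable_pi_apply i))

/-- `c₁ = log ⌊x⌋ / log x ≤ 1` for `x > 1`. -/
theorem c1_le_one {x : ℝ} (hx : 1 < x) : Real.log ((⌊x⌋₊ : ℕ) : ℝ) / Real.log x ≤ 1 := by
  have hlogpos : 0 < Real.log x := Real.log_pos hx
  have hfloor1 : (1 : ℝ) ≤ ((⌊x⌋₊ : ℕ) : ℝ) := by exact_mod_cast Nat.le_floor (by simpa using hx.le)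
  rw [div_le_one hlogpos]
  exact Real.log_le_log (by linarith) (Nat.floor_le (by linarith))

open scoped Classical in
/-- Former stub 1a′ (LANDED BY NAME: `…StubHkPieces.stub_hkPieces`, p828729). -/
def Signature.stub_hkPieces : Prop :=
  ∀ ν : ℝ, 0 < ν → ν < 1 / 4 → ∀ g : VecFn, Admissible ν g → ∀ k m : ℕ,
    ∃ (n : ℕ) (Pc : Fin n → Set (Fin m → ℝ)) (c : Fin n → ℝ),
      (∀ j, Convex ℝ (Pc j) ∧ MeasurableSet (Pc j)) ∧
      ∀ v, hfun ν g k m v = ∑ j, if v ∈ Pc j then c j else 0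

open scoped Classical in
/-- **Stub 1a from the piece decomposition** (v20): ONE instantiation of the tree's `abs_primeTupleSum_mainG_sub_integral_le`
with `hF2 :=` the tree's prime-tuple PNT `exists_primeTupleSum_approx (ν/2) _ _ 2 k`; error `CF·Σ|c_j|·x^{c₁}/log² x ≤ εx/log x`. -/
theorem tupleSumIntegral_of_pieces (hP : Signature.stub_hkPieces) : Signature.tupleSumIntegral := by
  intro ν hν hν4 g hadm k hk hkν ε hε
  have hadm' := hadm
  obtain ⟨hs, hpc, -, -, -⟩ := hadm'
  -- the pieces in dimension `t + k`
  obtain ⟨n, Pc, c, hPc, hsum⟩ := hP ν hν hν4 g hadm k ((1 : ℕ).primeFactors.card + k)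
  -- the prime-tuple PNT on convex sets (tree, PROVED)
  obtain ⟨CF, hCF0, X, hX2, hF2⟩ :=
    exists_primeTupleSum_approx (ν / 2) (by positivity) (by linarith) 2 k
  set S : ℝ := ∑ j, |c j| with hSdef
  have hS0 : 0 ≤ S := Finset.sum_nonneg fun j _ => abs_nonneg _
  refine ⟨max (max X 4) (Real.exp (CF * S / ε)), fun x hx => ?_⟩
  have hxX : X ≤ x := le_trans (le_trans (le_max_left _ _) (le_max_left _ _)) hx
  have hx4 : 4 ≤ x := le_trans (le_trans (le_max_right _ _) (le_max_left _ _)) hx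
  have hexp : Real.exp (CF * S / ε) ≤ x := le_trans (le_max_right _ _) hx
  have hx1 : 1 < x := by linarith
  have hx0 : 0 < x := by linarith
  have hL : 0 < Real.log x := Real.log_pos hx1
  have hLε : CF * S / ε ≤ Real.log x := by
    have := Real.log_le_log (Real.exp_pos _) hexp
    rwa [Real.log_exp] at this
  -- hypotheses of the tree theorem
  have hsupp : ∀ (K : ℕ) (v : Fin K → ℝ), hfun ν g k K v ≠ 0 → ∀ i, ν ≤ v i :=
    fun K v h => hfun_ne_zero_imp h
  have ht : (1 : ℕ).primeFactors.card = 0 := by rw [Nat.primeFactors_one, card_empty]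
  have hu : ∀ i : Fin (1 : ℕ).primeFactors.card, |uvec x 1 i| ≤ 1 :=
    fun i => by exfalso; have hi := i.isLt; omega
  have hKM : ∀ j : Fin n, 0 ≤ (fun _ : Fin n => (0 : ℝ)) j ∧ 0 ≤ (fun j => |c j|) j :=
    fun j => ⟨le_rfl, abs_nonneg _⟩
  have hpc' : ∀ j : Fin n, Convex ℝ (Pc j) ∧ MeasurableSet (Pc j) ∧
      Measurable (fun v : Fin ((1 : ℕ).primeFactors.card + k) → ℝ => if v ∈ Pc j then c j else 0) ∧
      (∀ v, v ∉ Pc j → (fun v : Fin ((1 : ℕ).primeFactors.card + k) → ℝ => if v ∈ Pc j then c j else 0) v = 0) ∧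
      (∀ v ∈ Pc j, ∀ w ∈ Pc j,
        |(fun v : Fin ((1 : ℕ).primeFactors.card + k) → ℝ => if v ∈ Pc j then c j else 0) v -
          (fun v : Fin ((1 : ℕ).primeFactors.card + k) → ℝ => if v ∈ Pc j then c j else 0) w| ≤
          (fun _ : Fin n => (0 : ℝ)) j * ‖v - w‖) ∧
      ∀ v, |(fun v : Fin ((1 : ℕ).primeFactors.card + k) → ℝ => if v ∈ Pc j then c j else 0) v| ≤
        (fun j => |c j|) j := by
    intro j
    refine ⟨(hPc j).1, (hPc j).2, ?_, ?_, ?_, ?_⟩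
    · exact Measurable.ite (hPc j).2 measurable_const measurable_const
    · intro v hv; simp only [hv, if_false]
    · intro v hv w hw; simp only [hv, hw, if_true, sub_self, abs_zero, zero_mul, le_refl]
    · intro v
      by_cases hv : v ∈ Pc j
      · simp only [hv, if_true, le_refl]
      · simp only [hv, if_false, abs_zero, abs_nonneg]
  have hmain := abs_primeTupleSum_mainG_sub_integral_le (h := hfun ν g k) hν hsupp (s := k) (A := 2)
    (CF := CF) (X := X) (x := x) hF2 hxX hx1 (t := (1 : ℕ).primeFactors.card) (u := uvec x 1) hu
    (c₀ := Real.log (x / (2 * ((1 : ℕ) : ℝ))) / Real.log x) (c₁ := Real.log ((⌊x⌋₊ : ℕ) : ℝ) / Real.log x)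
    (c1_le_one hx1) (hrho_one hx4) hKM hpc' hsum
  -- the error bound
  have hx1le : x ^ (Real.log ((⌊x⌋₊ : ℕ) : ℝ) / Real.log x) ≤ x := by
    have := Real.rpow_le_rpow_of_exponent_le hx1.le (c1_le_one hx1)
    rwa [Real.rpow_one] at this
  have hsumK : (∑ j : Fin n, ((fun _ : Fin n => (0 : ℝ)) j * (8 * (k : ℝ) + 2) + (fun j => |c j|) j)) = S := by
    rw [hSdef]; refine Finset.sum_congr rfl fun j _ => ?_; simp
  unfold mainG1
  refine hmain.trans ?_
  rw [hsumK]
  have hL2 : Real.log x ^ (2 : ℕ) = Real.log x * Real.log x := by ring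
  rw [hL2]
  -- `CF * S * x^{c₁} / (log x * log x) ≤ ε * x / log x`
  rw [div_le_div_iff₀ (by positivity) hL]
  have hCS : CF * S ≤ ε * Real.log x := by
    have := (div_le_iff₀ hε).mp hLε
    linarith
  have hCS0 : 0 ≤ CF * S := mul_nonneg hCF0 hS0
  calc CF * S * x ^ (Real.log ((⌊x⌋₊ : ℕ) : ℝ) / Real.log x) * Real.log x
      ≤ CF * S * x * Real.log x := by gcongr
    _ ≤ ε * Real.log x * x * Real.log x := by gcongr
    _ = ε * x * (Real.log x * Real.log x) := by ring

/-- **Stub 1a** (former stub; v21: the piece decomposition is the LANDED `…StubHkPieces.stub_hkPieces`, p828729, BY NAME). -/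
theorem hk_pieces : Signature.stub_hkPieces := stub_hkPieces

theorem tuple_sum_integral : Signature.tupleSumIntegral := tupleSumIntegral_of_pieces hk_pieces

/-- **Stub 1a, injective form** (former stub). -/
theorem injSum_integral : Signature.injSumIntegral := injSumIntegral_of_tupleSum tuple_sum_integral

/-- **`G_k · tupleWeight` is integrable and supported on positive vectors** (`x ≥ 4`; the tree's
`integrable_mainG_mul_tupleWeight` with … -/
theorem integrable_mainG1 {ν : ℝ} (hν : 0 < ν) {g : VecFn} (hs : g.IsSymmetric) (hpc : IsPiecewiseConstOnCone g) (k : ℕ)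
    {x : ℝ} (hx : 4 ≤ x) :
    MeasureTheory.Integrable (fun y : Fin k → ℝ => mainG1 ν g k x y * tupleWeight x y) ∧
      ∀ y : Fin k → ℝ, mainG1 ν g k x y * tupleWeight x y ≠ 0 → ∀ i, 0 < y i := by
  obtain ⟨Hb, hHb⟩ := exists_abs_hfun_le hs hpc ν k
  have hsupp : ∀ (K : ℕ) (v : Fin K → ℝ), hfun ν g k K v ≠ 0 → ∀ i, ν ≤ v i := fun K v hv => hfun_ne_zero_imp hv
  have hlc₀ : 0 < (∑ i, uvec x 1 i) + Real.log (x / (2 * ((1 : ℕ) : ℝ))) / Real.log x :=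
    lt_of_lt_of_le (by norm_num) (hrho_one hx)
  exact integrable_mainG_mul_tupleWeight hν hsupp hHb (measurable_hfun hs hpc ν k) (by linarith : (1 : ℝ) < x)
    (uvec x 1) (c1_le_one (x := x) (by linarith)) hlc₀ k

/-- **Stub 1b, step (iv) entry: the comparison integral sliced along `Σ y = w`** (the tree's
`integral_eq_integral_sliceIntegral`): … -/
theorem primeTupleIntegral_mainG1_eq_slice {ν : ℝ} (hν : 0 < ν) {g : VecFn} (hs : g.IsSymmetric)
    (hpc : IsPiecewiseConstOnCone g) (d : ℕ) {x : ℝ} (hx : 4 ≤ x) :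
    primeTupleIntegral (d + 1) x (mainG1 ν g (d + 1) x)
      = ∫ w, sliceIntegral (d + 1) w (fun y => mainG1 ν g (d + 1) x y * tupleWeight x y) ∧
    MeasureTheory.Integrable (fun w => sliceIntegral (d + 1) w (fun y => mainG1 ν g (d + 1) x y * tupleWeight x y)) := by
  obtain ⟨hint, hpos⟩ := integrable_mainG1 hν hs hpc (d + 1) hx
  exact integral_eq_integral_sliceIntegral hint hpos

/-- The slice in closed form for `0 < w` (the tree's `sliceIntegral_mainG` at `m = 1`, `t = 0`). -/
theorem sliceIntegral_mainG1_eq {ν : ℝ} {g : VecFn} (d : ℕ) {x : ℝ} (hx : 0 < x) {w : ℝ} (hw : 0 < w) :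
    sliceIntegral (d + 1) w (fun y => mainG1 ν g (d + 1) x y * tupleWeight x y)
      = if Real.log (x / (2 * ((1 : ℕ) : ℝ))) / Real.log x < w ∧ w ≤ Real.log ((⌊x⌋₊ : ℕ) : ℝ) / Real.log x then
          x ^ w / ((∑ i, uvec x 1 i) + w) * ((((d + 1).factorial : ℕ) : ℝ) *
            typeITerm (hfun ν g (d + 1)) (1 : ℕ).primeFactors.card (fun i => uvec x 1 i / ((∑ i, uvec x 1 i) + w)) (d + 1))
        else 0 := by
  have hsum : (∑ i, uvec x 1 i) = 0 := by
    have ht : (1 : ℕ).primeFactors.card = 0 := by rw [Nat.primeFactors_one, card_empty]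
    exact sum_eq_zero fun i _ => by exfalso; have hi := i.isLt; omega
  have hρ : 0 < (∑ i, uvec x 1 i) + w := by rw [hsum, zero_add]; exact hw
  exact sliceIntegral_mainG (hfun ν g (d + 1)) hx (uvec x 1) _ _ d w hρ

theorem sliceIntegral_of_nonpos {d : ℕ} {w : ℝ} (hw : w ≤ 0) (G : (Fin (d + 1) → ℝ) → ℝ) :
    sliceIntegral (d + 1) w G = 0 := by
  show (∫ u : Fin d → ℝ, (if (∀ i, 0 < u i) ∧ ∑ i, u i < w then G (Fin.snoc u (w - ∑ i, u i)) else 0)) = 0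
  have : (fun u : Fin d → ℝ => (if (∀ i, 0 < u i) ∧ ∑ i, u i < w then G (Fin.snoc u (w - ∑ i, u i)) else 0))
      = fun _ => 0 := by
    funext u
    rw [if_neg]
    rintro ⟨hpos, hlt⟩
    have : 0 ≤ ∑ i, u i := sum_nonneg fun i _ => (hpos i).le
    linarith
  rw [this, MeasureTheory.integral_zero]

/-- **The comparison integral in closed form** (`x ≥ 4`): slicing along `Σ y = w` (tree: `integral_eq_integral_sliceIntegral`),
the slice in … -/
theorem primeTupleIntegral_mainG1_eq {ν : ℝ} (hν : 0 < ν) {g : VecFn} (hs : g.IsSymmetric) (hpc : IsPiecewiseConstOnCone g)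
    (d : ℕ) {x : ℝ} (hx : 4 ≤ x) :
    primeTupleIntegral (d + 1) x (mainG1 ν g (d + 1) x)
      = ((((d + 1).factorial : ℕ) : ℝ) * typeITerm (hfun ν g (d + 1)) (1 : ℕ).primeFactors.card (uvec x 1) (d + 1))
        * ∫ w in Set.Ioc (Real.log (x / (2 * ((1 : ℕ) : ℝ))) / Real.log x) (Real.log ((⌊x⌋₊ : ℕ) : ℝ) / Real.log x),
            x ^ w / w := by
  have hx0 : 0 < x := by linarith
  have ht : (1 : ℕ).primeFactors.card = 0 := by rw [Nat.primeFactors_one, card_empty]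
  have hsum : (∑ i, uvec x 1 i) = 0 := sum_eq_zero fun i _ => by exfalso; have hi := i.isLt; omega
  set c₀ : ℝ := Real.log (x / (2 * ((1 : ℕ) : ℝ))) / Real.log x with hc₀
  set c₁ : ℝ := Real.log ((⌊x⌋₊ : ℕ) : ℝ) / Real.log x with hc₁
  set J : ℝ := (((d + 1).factorial : ℕ) : ℝ) * typeITerm (hfun ν g (d + 1)) (1 : ℕ).primeFactors.card (uvec x 1) (d + 1)
    with hJ
  have hc₀pos : 0 < c₀ := by
    rw [hc₀, Nat.cast_one, mul_one]
    exact div_pos (Real.log_pos (by linarith)) (Real.log_pos (by linarith))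
  rw [(primeTupleIntegral_mainG1_eq_slice hν hs hpc d hx).1]
  have hslice : ∀ w, sliceIntegral (d + 1) w (fun y => mainG1 ν g (d + 1) x y * tupleWeight x y)
      = Set.indicator (Set.Ioc c₀ c₁) (fun w => x ^ w / w * J) w := by
    intro w
    rcases le_or_gt w 0 with hw | hw
    · rw [sliceIntegral_of_nonpos hw, Set.indicator_of_notMem]
      rw [Set.mem_Ioc]; rintro ⟨h1, -⟩; linarith
    · rw [sliceIntegral_mainG1_eq d hx0 hw]
      by_cases hmem : c₀ < w ∧ w ≤ c₁
      · rw [if_pos hmem, Set.indicator_of_mem (Set.mem_Ioc.2 hmem), hsum, zero_add, hJ]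
        have hξ : (fun i => uvec x 1 i / w) = uvec x 1 := funext fun i => by exfalso; have hi := i.isLt; omega
        rw [hξ]
      · rw [if_neg hmem, Set.indicator_of_notMem]; rwa [Set.mem_Ioc]
  simp_rw [hslice]
  rw [MeasureTheory.integral_indicator measurableSet_Ioc, MeasureTheory.integral_mul_const]
  ring

open MeasureTheory in
/-- A level set of a non-zero linear functional on `ℝ^d` is Lebesgue-null (v19). -/
theorem volume_levelSet_eq_zero {d : ℕ} (ℓ : (Fin d → ℝ) →ₗ[ℝ] ℝ) (hℓ : ℓ ≠ 0) (c : ℝ) :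
    volume {u : Fin d → ℝ | ℓ u = c} = 0 := by
  by_cases hne : ∃ u₀, ℓ u₀ = c
  · obtain ⟨u₀, hu₀⟩ := hne
    have hker : LinearMap.ker ℓ ≠ ⊤ := by rwa [Ne, LinearMap.ker_eq_top]
    have hset : {u : Fin d → ℝ | ℓ u = c} = (fun u => -u₀ + u) ⁻¹' (LinearMap.ker ℓ : Set (Fin d → ℝ)) := by
      ext u
      simp only [Set.mem_setOf_eq, Set.mem_preimage, SetLike.mem_coe, LinearMap.mem_ker, map_add, map_neg, hu₀]
      constructor
      · intro h; rw [h]; ring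
      · intro h; linarith
    rw [hset, measure_preimage_add]
    exact Measure.addHaar_submodule volume _ hker
  · have : {u : Fin d → ℝ | ℓ u = c} = ∅ := by
      ext u; simp only [Set.mem_setOf_eq, Set.mem_empty_iff_false, iff_false]
      exact fun h => hne ⟨u, h⟩
    rw [this, measure_empty]

open MeasureTheory in
/-- Ties between two free coordinates are null. -/
theorem volume_tie_eq_zero {d : ℕ} {i j : Fin d} (hij : i ≠ j) :
    volume {u : Fin d → ℝ | u i = u j} = 0 := by
  have h := volume_levelSet_eq_zero
    ((LinearMap.proj i : (Fin d → ℝ) →ₗ[ℝ] ℝ) - (LinearMap.proj j : (Fin d → ℝ) →ₗ[ℝ] ℝ)) ?_ 0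
  · have hset : {u : Fin d → ℝ | u i = u j} =
        {u : Fin d → ℝ | ((LinearMap.proj i : (Fin d → ℝ) →ₗ[ℝ] ℝ) - (LinearMap.proj j : (Fin d → ℝ) →ₗ[ℝ] ℝ)) u = 0} := by
      ext u; simp only [Set.mem_setOf_eq, LinearMap.sub_apply, LinearMap.coe_proj, Function.eval, sub_eq_zero]
    rw [hset]; exact h
  · intro h0
    have := LinearMap.congr_fun h0 (Pi.single i (1 : ℝ))
    simp only [LinearMap.sub_apply, LinearMap.coe_proj, Function.eval, Pi.single_eq_same,
      Pi.single_eq_of_ne' hij, LinearMap.zero_apply] at this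
    norm_num at this

open MeasureTheory in
/-- Ties between a free coordinate and the dependent last coordinate are null. -/
theorem volume_tie_last_eq_zero {d : ℕ} (w : ℝ) (j : Fin d) :
    volume {u : Fin d → ℝ | u j = w - ∑ i, u i} = 0 := by
  have h := volume_levelSet_eq_zero
    ((LinearMap.proj j : (Fin d → ℝ) →ₗ[ℝ] ℝ) + ∑ i, (LinearMap.proj i : (Fin d → ℝ) →ₗ[ℝ] ℝ)) ?_ w
  · have hset : {u : Fin d → ℝ | u j = w - ∑ i, u i} =
        {u : Fin d → ℝ | ((LinearMap.proj j : (Fin d → ℝ) →ₗ[ℝ] ℝ) + ∑ i, (LinearMap.proj i : (Fin d → ℝ) →ₗ[ℝ] ℝ)) u = w} := by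
      ext u
      simp only [Set.mem_setOf_eq, LinearMap.add_apply, LinearMap.coe_proj, Function.eval, LinearMap.sum_apply]
      constructor
      · intro h; linarith
      · intro h; linarith
    rw [hset]; exact h
  · intro h0
    have := LinearMap.congr_fun h0 (Pi.single j (1 : ℝ))
    simp only [LinearMap.add_apply, LinearMap.coe_proj, Function.eval, Pi.single_eq_same,
      LinearMap.sum_apply, LinearMap.zero_apply] at this
    rw [Finset.sum_pi_single'] at this
    simp at this

open MeasureTheory in
open scoped Classical in
/-- Former stub (PROVED here; see the card). -/
theorem chamber_symm_all (k : ℕ) (w M : ℝ) (Φ : (Fin k → ℝ) → ℝ) (hΦm : Measurable Φ) (hΦb : ∀ u, |Φ u| ≤ M)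
    (hΦs : ∀ (σ : Equiv.Perm (Fin k)) (u : Fin k → ℝ), Φ (u ∘ σ) = Φ u) :
    sliceIntegral k w Φ = (k.factorial : ℝ) * sliceIntegral k w (fun u => if Monotone u then Φ u else 0) := by
  cases k with
  | zero => simp [sliceIntegral]
  | succ d =>
    have hM0 : 0 ≤ M := (abs_nonneg _).trans (hΦb fun _ => 0)
    -- each chamber has the same integral
    have h1 : ∀ σ : Equiv.Perm (Fin (d + 1)),
        sliceIntegral (d + 1) w (fun v => if Monotone (v ∘ σ) then Φ v else 0) =
          sliceIntegral (d + 1) w (fun u => if Monotone u then Φ u else 0) := by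
      intro σ
      have : (fun v : Fin (d + 1) → ℝ => if Monotone (v ∘ σ) then Φ v else 0) =
          fun v => (fun u : Fin (d + 1) → ℝ => if Monotone u then Φ u else 0) (v ∘ σ) := by
        funext v; simp only [hΦs σ v]
      rw [this]
      exact sliceIntegral_comp_perm w σ (fun u => if Monotone u then Φ u else 0)
    -- the tie set is null
    set T : Set (Fin d → ℝ) :=
      (⋃ p : Fin d × Fin d, if p.1 ≠ p.2 then {u | u p.1 = u p.2} else ∅) ∪ ⋃ j : Fin d, {u | u j = w - ∑ i, u i}
      with hT
    have hT0 : volume T = 0 := by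
      rw [hT]
      refine measure_union_null (measure_iUnion_null fun p => ?_) (measure_iUnion_null fun j => volume_tie_last_eq_zero w j)
      by_cases hp : p.1 ≠ p.2
      · rw [if_pos hp]; exact volume_tie_eq_zero hp
      · rw [if_neg hp]; exact measure_empty
    -- off `T`, the slice point is injective
    have hinj : ∀ u : Fin d → ℝ, u ∉ T → Function.Injective (Fin.snoc u (w - ∑ i, u i) : Fin (d + 1) → ℝ) := by
      intro u hu a b hab
      by_contra hne
      apply hu
      rw [hT]
      -- case analysis on `a`, `b`
      induction a using Fin.lastCases with
      | last =>
        induction b using Fin.lastCases with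
        | last => exact absurd rfl hne
        | cast b' =>
          refine Set.mem_union_right _ (Set.mem_iUnion.mpr ⟨b', ?_⟩)
          simp only [Fin.snoc_last, Fin.snoc_castSucc] at hab
          exact hab.symm
      | cast a' =>
        induction b using Fin.lastCases with
        | last =>
          refine Set.mem_union_right _ (Set.mem_iUnion.mpr ⟨a', ?_⟩)
          simp only [Fin.snoc_last, Fin.snoc_castSucc] at hab
          exact hab
        | cast b' =>
          have hab' : a' ≠ b' := fun h => hne (by rw [h])
          refine Set.mem_union_left _ (Set.mem_iUnion.mpr ⟨(a', b'), ?_⟩)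
          simp only [Fin.snoc_castSucc] at hab
          simp only [ne_eq, hab', not_false_eq_true, if_true, Set.mem_setOf_eq]
          exact hab
    -- pointwise off `T`: the integrand is the sum of the chamber integrands
    have hpt : ∀ u : Fin d → ℝ, u ∉ T →
        sliceIntegrand d w Φ u = ∑ σ : Equiv.Perm (Fin (d + 1)),
          sliceIntegrand d w (fun v => if Monotone (v ∘ σ) then Φ v else 0) u := by
      intro u hu
      unfold sliceIntegrand
      by_cases hc : (∀ i, 0 < u i) ∧ ∑ i, u i < w
      · simp only [if_pos hc]
        set x : Fin (d + 1) → ℝ := Fin.snoc u (w - ∑ i, u i) with hx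
        have hxi : Function.Injective x := hinj u hu
        rw [Finset.sum_eq_single (Tuple.sort x)]
        · rw [if_pos (Tuple.monotone_sort x)]
        · intro τ _ hτ
          rw [if_neg]
          intro hmono
          apply hτ
          have heq := Tuple.unique_monotone hmono (Tuple.monotone_sort x)
          exact Equiv.ext fun i => hxi (congr_fun heq i)
        · intro h; exact absurd (Finset.mem_univ _) h
      · simp only [if_neg hc, Finset.sum_const_zero]
    -- integrability of the chamber integrands
    have hint : ∀ σ : Equiv.Perm (Fin (d + 1)),
        Integrable (sliceIntegrand d w (fun v => if Monotone (v ∘ σ) then Φ v else 0)) := by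
      intro σ
      refine integrable_sliceIntegrand d w ?_ hM0 fun v _ _ => ?_
      · exact Measurable.ite (measurableSet_monotone_comp (d + 1) σ) hΦm measurable_const
      · split_ifs
        · exact hΦb v
        · rw [abs_zero]; exact hM0
    -- assemble
    have h2 : sliceIntegral (d + 1) w Φ = ∑ σ : Equiv.Perm (Fin (d + 1)),
        sliceIntegral (d + 1) w (fun v => if Monotone (v ∘ σ) then Φ v else 0) := by
      simp only [sliceIntegral_succ_eq]
      rw [← integral_finsetSum _ fun σ _ => hint σ]
      refine integral_congr_ae ?_
      have hae : ∀ᵐ u ∂(volume : Measure (Fin d → ℝ)), u ∉ T := by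
        rw [ae_iff]; simpa using hT0
      exact hae.mono fun u hu => hpt u hu
    rw [h2, Finset.sum_congr rfl fun σ _ => h1 σ, Finset.sum_const, Finset.card_univ, Fintype.card_perm,
      Fintype.card_fin, nsmul_eq_mul]

/-- **Stub 1b-β′** (former stub; PROVED in v19). -/
theorem chamber_symm : Signature.chamberSymm := chamber_symm_all

/-- `h_k` on a cast vector. -/
theorem hfun_comp_cast {ν : ℝ} {g : VecFn} {k m : ℕ} (h : m = k) (u : Fin k → ℝ) :
    hfun ν g k m (u ∘ Fin.cast h) = if ∀ i, ν < u i then starSum g k u else 0 := by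
  subst h
  have hu : (u ∘ Fin.cast rfl) = u := funext fun i => rfl
  rw [hu]
  unfold hfun
  simp only [true_and]

/-- `h_k` on the empty append (`t = #primeFactors 1 = 0`). -/
theorem hfun_append_nil {ν : ℝ} {g : VecFn} {k t : ℕ} (ht : t = 0) (ξ : Fin t → ℝ) (u : Fin k → ℝ) :
    hfun ν g k (t + k) (Fin.append ξ u) = if ∀ i, ν < u i then starSum g k u else 0 := by
  rw [Fin.append_left_nil ξ u ht]
  exact hfun_comp_cast _ u

/-- `Φ_k` is permutation invariant. -/
theorem Phi_perm {ν : ℝ} {g : VecFn} (hs : g.IsSymmetric) (k : ℕ) (σ : Equiv.Perm (Fin k)) (u : Fin k → ℝ) :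
    Phi ν g k (u ∘ σ) = Phi ν g k u := by
  unfold Phi
  have h2 : ∏ i, (u ∘ σ) i = ∏ i, u i := Equiv.prod_comp σ u
  rw [starSum_perm hs k σ u, h2]
  by_cases hall : ∀ i, ν < u i
  · have hall' : ∀ i, ν < (u ∘ σ) i := fun i => hall (σ i)
    rw [if_pos hall', if_pos hall]
  · have hall' : ¬ ∀ i, ν < (u ∘ σ) i := fun h => hall fun j => by simpa using h (σ.symm j)
    rw [if_neg hall', if_neg hall]

/-- `Φ_k` is measurable. -/
theorem measurable_Phi {g : VecFn} (hs : g.IsSymmetric) (hpc : IsPiecewiseConstOnCone g) (ν : ℝ) (k : ℕ) :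
    Measurable (Phi ν g k) := by
  unfold Phi
  refine Measurable.div (Measurable.ite ?_ (measurable_starSum hs hpc k) measurable_const)
    (Finset.measurable_prod (f := fun (i : Fin k) (u : Fin k → ℝ) => u i) univ fun i _ => measurable_pi_apply i)
  have : {u : Fin k → ℝ | ∀ i, ν < u i} = ⋂ i, {u | ν < u i} := by ext u; simp
  rw [this]
  exact MeasurableSet.iInter fun i => measurableSet_lt measurable_const (measurable_pi_apply i)

/-- `Φ_k` is bounded (by `sup |𝟙⋆g| / ν^k`). -/
theorem exists_abs_Phi_le {ν : ℝ} (hν : 0 < ν) {g : VecFn} (hs : g.IsSymmetric) (hpc : IsPiecewiseConstOnCone g)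
    (k : ℕ) : ∃ M : ℝ, ∀ u, |Phi ν g k u| ≤ M := by
  obtain ⟨S, hS⟩ := exists_abs_starSum_le hs hpc k
  have hS0 : 0 ≤ S := (abs_nonneg _).trans (hS (fun _ => 0))
  have hνk : 0 < ν ^ k := pow_pos hν k
  refine ⟨S / ν ^ k, fun u => ?_⟩
  unfold Phi
  by_cases hall : ∀ i, ν < u i
  · have hprod : ν ^ k ≤ ∏ i, u i := by
      calc ν ^ k = ∏ _i : Fin k, ν := (Fin.prod_const k ν).symm
        _ ≤ ∏ i, u i := Finset.prod_le_prod (fun i _ => hν.le) (fun i _ => (hall i).le)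
    have hprod_pos : 0 < ∏ i, u i := lt_of_lt_of_le hνk hprod
    rw [if_pos hall, abs_div, abs_of_pos hprod_pos, div_le_div_iff₀ hprod_pos hνk]
    calc |starSum g k u| * ν ^ k ≤ S * ν ^ k := by gcongr; exact hS u
      _ ≤ S * ∏ i, u i := by gcongr
  · rw [if_neg hall, zero_div, abs_zero]; positivity

/-- On the slice `Σ v = 1`, `vᵢ > 0`, `k ≥ 2`: the chamber restriction of `Φ_k` is the `sieveBoundG1` integrand
(`vᵢ < 1 − ν` is automatic). -/
theorem Phi_chamber_eq_sliceTest {ν : ℝ} {g : VecFn} {k : ℕ} (hk : 2 ≤ k) (v : Fin k → ℝ)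
    (hv : ∀ i, 0 < v i) (hv1 : ∑ i, v i = 1) :
    (if Monotone v then Phi ν g k v else 0) = sliceTest ν g k v := by
  unfold Phi sliceTest
  by_cases hmono : Monotone v
  · by_cases hall : ∀ i, ν < v i
    · have hall2 : ∀ i, ν < v i ∧ v i < 1 - ν := by
        intro i
        refine ⟨hall i, ?_⟩
        haveI : Nontrivial (Fin k) := Fin.nontrivial_iff_two_le.mpr hk
        obtain ⟨j, hj⟩ := exists_ne i
        have hpair : v i + v j ≤ ∑ l, v l := by
          rw [← Finset.sum_pair (Ne.symm hj)]
          exact Finset.sum_le_sum_of_subset_of_nonneg (Finset.subset_univ _) fun l _ _ => (hv l).le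
        linarith [hall j]
      rw [if_pos hmono, if_pos hall, if_pos ⟨hall2, hmono⟩]
    · have hn : ¬ ((∀ i, ν < v i ∧ v i < 1 - ν) ∧ Monotone v) := fun h => hall fun i => (h.1 i).1
      rw [if_pos hmono, if_neg hall, if_neg hn, zero_div]
  · have hn : ¬ ((∀ i, ν < v i ∧ v i < 1 - ν) ∧ Monotone v) := fun h => hmono h.2
    rw [if_neg hmono, if_neg hn]

/-- **Stub 1b-β from the chamber symmetrisation** (v18): … -/
theorem sliceSymm_of_chamber (hC : Signature.chamberSymm) : Signature.sliceSymm := by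
  intro ν hν hν4 g hadm k hk hkν x
  obtain ⟨hs, hpc, -, -, -⟩ := hadm
  have ht : (1 : ℕ).primeFactors.card = 0 := by rw [Nat.primeFactors_one, card_empty]
  have hsum : (∑ i, uvec x 1 i) = 0 :=
    sum_eq_zero fun i _ => by exfalso; have hi := i.isLt; omega
  have hI : (fun u : Fin k → ℝ => hfun ν g k ((1 : ℕ).primeFactors.card + k) (Fin.append (uvec x 1) u) / ∏ i, u i)
      = Phi ν g k := by
    funext u; unfold Phi; rw [hfun_append_nil ht]
  obtain ⟨M, hM⟩ := exists_abs_Phi_le hν hs hpc k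
  have hC1 := hC k 1 M (Phi ν g k) (measurable_Phi hs hpc ν k) hM (Phi_perm hs k)
  have hk0 : (k.factorial : ℝ) ≠ 0 := by positivity
  unfold typeITerm
  rw [hsum, sub_zero, hI, hC1, ← mul_assoc, one_div_mul_cancel hk0, one_mul]
  exact sliceIntegral_congr fun v hv hv1 => Phi_chamber_eq_sliceTest hk v hv hv1

/-- **Stub 1b from 1b-β and 1b-γ.** -/
theorem integralMainTerm_of (hβ : Signature.sliceSymm) (hγ : Signature.windowPNT) :
    Signature.integralMainTerm := by
  intro ν hν hν4 g hadm k hk hkK ε hε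
  obtain ⟨d, rfl⟩ : ∃ d, k = d + 1 := ⟨k - 1, by omega⟩
  set sI : ℝ := sliceIntegral (d + 1) 1 (sliceTest ν g (d + 1)) with hsI
  have hε' : 0 < ε / (|sI| + 1) := by positivity
  obtain ⟨x₀, hx₀⟩ := hγ (ε / (|sI| + 1)) hε'
  refine ⟨max x₀ 4, fun x hx => ?_⟩
  have hx4 : 4 ≤ x := le_trans (le_max_right _ _) hx
  have hxx₀ : x₀ ≤ x := le_trans (le_max_left _ _) hx
  have hx0 : 0 < x := by linarith
  have hlogpos : 0 < Real.log x := Real.log_pos (by linarith)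
  have hF : (((d + 1).factorial : ℕ) : ℝ) ≠ 0 := by exact_mod_cast (Nat.factorial_pos (d + 1)).ne'
  rw [primeTupleIntegral_mainG1_eq hν hadm.1 hadm.2.1 d hx4, hβ ν hν hν4 g hadm (d + 1) hk hkK x]
  set I : ℝ := ∫ w in Set.Ioc (Real.log (x / (2 * ((1 : ℕ) : ℝ))) / Real.log x) (Real.log ((⌊x⌋₊ : ℕ) : ℝ) / Real.log x),
    x ^ w / w with hI
  have h1 : 1 / (((d + 1).factorial : ℕ) : ℝ) * ((((d + 1).factorial : ℕ) : ℝ) * sI * I) = sI * I := by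
    field_simp
  have hP := hx₀ x hxx₀
  have h0 : 0 ≤ x / Real.log x := div_nonneg hx0.le hlogpos.le
  rw [h1, ← mul_sub, abs_mul]
  calc |sI| * |I - ((windowPrimes x).card : ℝ)| ≤ |sI| * (ε / (|sI| + 1) * x / Real.log x) :=
        mul_le_mul_of_nonneg_left hP (abs_nonneg _)
    _ = (|sI| / (|sI| + 1)) * ε * (x / Real.log x) := by ring
    _ ≤ 1 * ε * (x / Real.log x) := by
        have : |sI| / (|sI| + 1) ≤ 1 := by rw [div_le_one (by positivity)]; linarith
        exact mul_le_mul_of_nonneg_right (mul_le_mul_of_nonneg_right this hε.le) h0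
    _ = ε * x / Real.log x := by ring

/-- The window integral `∫_{(a,b]} x^w/w dw` with `x^a = x/2`, `x^b = ⌊x⌋`: `= x/(2 log x) + O(x/log² x + 1/log x)`. -/
theorem window_integral_estimate {x a b : ℝ} (hx : 4 ≤ x) (ha : a = Real.log (x / 2) / Real.log x)
    (hb : b = Real.log ((⌊x⌋₊ : ℕ) : ℝ) / Real.log x) :
    |(∫ w in Set.Ioc a b, x ^ w / w) - x / (2 * Real.log x)|
      ≤ x * Real.log 2 / Real.log x ^ 2 + 1 / Real.log x := by
  have hx0 : 0 < x := by linarith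
  have hlog2 : 0 < Real.log 2 := Real.log_pos (by norm_num)
  have hL4 : 2 * Real.log 2 ≤ Real.log x := by
    have h := Real.log_le_log (by norm_num) hx
    rw [show (4 : ℝ) = 2 ^ 2 by norm_num, Real.log_pow] at h
    push_cast at h
    linarith
  have hL : 0 < Real.log x := by linarith
  have hLne : Real.log x ≠ 0 := hL.ne'
  have hF1 : x - 1 < ((⌊x⌋₊ : ℕ) : ℝ) := by
    have := Nat.lt_floor_add_one x
    linarith
  have hFx : ((⌊x⌋₊ : ℕ) : ℝ) ≤ x := Nat.floor_le hx0.le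
  have hF0 : 0 < ((⌊x⌋₊ : ℕ) : ℝ) := by linarith
  have hlogx2 : Real.log (x / 2) = Real.log x - Real.log 2 := Real.log_div hx0.ne' two_ne_zero
  have ha' : a = 1 - Real.log 2 / Real.log x := by
    rw [ha, hlogx2]; field_simp
  have ht : Real.log 2 / Real.log x ≤ 1 / 2 := by rw [div_le_iff₀ hL]; linarith
  have ht0 : 0 ≤ Real.log 2 / Real.log x := by positivity
  have ha0 : 1 / 2 ≤ a := by rw [ha']; linarith
  have ha0pos : 0 < a := by linarith
  have hb1 : b ≤ 1 := by
    rw [hb, div_le_one hL]; exact Real.log_le_log hF0 hFx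
  have hab : a ≤ b := by
    rw [ha, hb]
    exact div_le_div_of_nonneg_right (Real.log_le_log (by positivity) (by linarith)) hL.le
  have hxa : x ^ a = x / 2 := by
    rw [ha, Real.rpow_def_of_pos hx0, mul_comm, div_mul_cancel₀ _ hLne, Real.exp_log (by positivity)]
  have hxb : x ^ b = ((⌊x⌋₊ : ℕ) : ℝ) := by
    rw [hb, Real.rpow_def_of_pos hx0, mul_comm, div_mul_cancel₀ _ hLne, Real.exp_log hF0]
  have hfun : (fun w : ℝ => x ^ w) = fun w => Real.exp (Real.log x * w) := funext fun w => Real.rpow_def_of_pos hx0 w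
  have hcont : Continuous (fun w : ℝ => x ^ w) := by
    rw [hfun]; exact Real.continuous_exp.comp (continuous_const.mul continuous_id)
  have hderiv : ∀ w, HasDerivAt (fun w : ℝ => x ^ w / Real.log x) (x ^ w) w := by
    intro w
    have := ((Real.hasStrictDerivAt_const_rpow hx0 w).hasDerivAt).div_const (Real.log x)
    rwa [mul_div_cancel_right₀ _ hLne] at this
  have hI0 : (∫ w in Set.Ioc a b, x ^ w) = (((⌊x⌋₊ : ℕ) : ℝ) - x / 2) / Real.log x := by
    rw [← intervalIntegral.integral_of_le hab,
      intervalIntegral.integral_eq_sub_of_hasDerivAt (fun w _ => hderiv w) (hcont.intervalIntegrable _ _), hxa, hxb]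
    ring
  have hint1 : MeasureTheory.IntegrableOn (fun w : ℝ => x ^ w) (Set.Ioc a b) :=
    (hcont.continuousOn.integrableOn_Icc).mono_set Set.Ioc_subset_Icc_self
  have hcont2 : ContinuousOn (fun w : ℝ => x ^ w / w) (Set.Icc a b) :=
    hcont.continuousOn.div continuousOn_id fun w hw => (lt_of_lt_of_le ha0pos hw.1).ne'
  have hint2 : MeasureTheory.IntegrableOn (fun w : ℝ => x ^ w / w) (Set.Ioc a b) :=
    hcont2.integrableOn_Icc.mono_set Set.Ioc_subset_Icc_self
  have hint3 : MeasureTheory.IntegrableOn (fun w : ℝ => x ^ w / a) (Set.Ioc a b) :=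
    ((hcont.div_const a).continuousOn.integrableOn_Icc).mono_set Set.Ioc_subset_Icc_self
  have hlow : (∫ w in Set.Ioc a b, x ^ w) ≤ ∫ w in Set.Ioc a b, x ^ w / w := by
    refine MeasureTheory.setIntegral_mono_on hint1 hint2 measurableSet_Ioc fun w hw => ?_
    have hw0 : 0 < w := lt_trans ha0pos hw.1
    rw [le_div_iff₀ hw0]
    exact mul_le_of_le_one_right (Real.rpow_nonneg hx0.le _) (hw.2.trans hb1)
  have hupp : (∫ w in Set.Ioc a b, x ^ w / w) ≤ (∫ w in Set.Ioc a b, x ^ w) / a := by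
    rw [← MeasureTheory.integral_div]
    refine MeasureTheory.setIntegral_mono_on hint2 hint3 measurableSet_Ioc fun w hw => ?_
    exact div_le_div_of_nonneg_left (Real.rpow_nonneg hx0.le _) ha0pos hw.1.le
  rw [hI0] at hlow hupp
  have hTdef : x / (2 * Real.log x) = x / 2 / Real.log x := by rw [div_div]
  rw [hTdef]
  set T : ℝ := x / 2 / Real.log x with hT
  set I : ℝ := ∫ w in Set.Ioc a b, x ^ w / w with hI
  have hT0 : 0 ≤ T := by positivity
  have hI0le : (((⌊x⌋₊ : ℕ) : ℝ) - x / 2) / Real.log x ≤ T :=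
    div_le_div_of_nonneg_right (by linarith) hL.le
  have hI0ge : T - 1 / Real.log x ≤ (((⌊x⌋₊ : ℕ) : ℝ) - x / 2) / Real.log x := by
    rw [hT, div_sub_div_same]
    exact div_le_div_of_nonneg_right (by linarith) hL.le
  have h1a : 1 / a ≤ 1 + 2 * (Real.log 2 / Real.log x) := by
    rw [ha'] at ha0pos ⊢
    rw [div_le_iff₀ ha0pos]
    nlinarith
  rw [abs_sub_le_iff]
  constructor
  · -- upper: `I ≤ I₀/a ≤ T/a ≤ T(1 + 2t)`
    have h2 : (((⌊x⌋₊ : ℕ) : ℝ) - x / 2) / Real.log x / a ≤ T * (1 / a) := by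
      rw [← div_eq_mul_one_div]
      exact div_le_div_of_nonneg_right hI0le ha0pos.le
    have h3 : T * (1 / a) ≤ T * (1 + 2 * (Real.log 2 / Real.log x)) := mul_le_mul_of_nonneg_left h1a hT0
    have h4 : T * (1 + 2 * (Real.log 2 / Real.log x)) - T = x * Real.log 2 / Real.log x ^ 2 := by
      rw [hT]; ring
    have h5 : 0 ≤ 1 / Real.log x := by positivity
    linarith
  · -- lower: `T − I ≤ T − I₀ ≤ 1/log x`
    have h4 : 0 ≤ x * Real.log 2 / Real.log x ^ 2 := by positivity
    linarith

/-- **PNT in the window** (the statement of `stub_windowPNT`; PROVED from the tree's PNT `primeCounting_bounds`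
and `window_integral_estimate`). -/
theorem window_pnt_all : ∀ ε : ℝ, 0 < ε → ∃ x₀ : ℝ, ∀ x : ℝ, x₀ ≤ x →
    |(∫ w in Set.Ioc (Real.log (x / (2 * ((1 : ℕ) : ℝ))) / Real.log x) (Real.log ((⌊x⌋₊ : ℕ) : ℝ) / Real.log x),
        x ^ w / w) - ((windowPrimes x).card : ℝ)| ≤ ε * x / Real.log x := by
  intro ε hε
  obtain ⟨x₁, hx₁⟩ :=
    Literature.Barriers.Parity.FriedlanderGranville.primeCounting_bounds (ε := ε / 4) (by positivity)
  refine ⟨max (max x₁ (2 * x₁)) (max (max 4 (4 / ε)) (Real.exp (16 * Real.log 2 / ε))), fun x hx => ?_⟩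
  have hxx₁ : x₁ ≤ x := le_trans (le_trans (le_max_left _ _) (le_max_left _ _)) hx
  have h2x₁ : 2 * x₁ ≤ x := le_trans (le_trans (le_max_right _ _) (le_max_left _ _)) hx
  have hx4 : 4 ≤ x := le_trans (le_trans (le_trans (le_max_left _ _) (le_max_left _ _)) (le_max_right _ _)) hx
  have hx4ε : 4 / ε ≤ x := le_trans (le_trans (le_trans (le_max_right _ _) (le_max_left _ _)) (le_max_right _ _)) hx
  have hexp : Real.exp (16 * Real.log 2 / ε) ≤ x := le_trans (le_trans (le_max_right _ _) (le_max_right _ _)) hx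
  have hx0 : 0 < x := by linarith
  have hlog2 : 0 < Real.log 2 := Real.log_pos (by norm_num)
  have hL4 : 2 * Real.log 2 ≤ Real.log x := by
    have h := Real.log_le_log (by norm_num) hx4
    rw [show (4 : ℝ) = 2 ^ 2 by norm_num, Real.log_pow] at h
    push_cast at h
    linarith
  have hL : 0 < Real.log x := by linarith
  have hLε : 16 * Real.log 2 / ε ≤ Real.log x := by
    have := Real.log_le_log (Real.exp_pos _) hexp
    rwa [Real.log_exp] at this
  have hLε' : 16 * Real.log 2 ≤ Real.log x * ε := (div_le_iff₀ hε).1 hLε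
  have hxε : 4 ≤ x * ε := (div_le_iff₀ hε).1 hx4ε
  rw [Nat.cast_one, mul_one]
  have hint := window_integral_estimate hx4 rfl rfl
  have hcard := card_windowPrimes_eq hx0.le
  have hA := hx₁ x hxx₁
  have hB := hx₁ (x / 2) (by linarith)
  have hlogx2 : Real.log (x / 2) = Real.log x - Real.log 2 := Real.log_div hx0.ne' two_ne_zero
  have hL2 : Real.log x / 2 ≤ Real.log (x / 2) := by rw [hlogx2]; linarith
  have hL2pos : 0 < Real.log (x / 2) := by linarith
  have hY : x / 2 / Real.log (x / 2) ≤ x / Real.log x := by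
    rw [div_le_div_iff₀ hL2pos hL]
    calc x / 2 * Real.log x = x * (Real.log x / 2) := by ring
      _ ≤ x * Real.log (x / 2) := mul_le_mul_of_nonneg_left hL2 hx0.le
  have hD : |x / 2 / Real.log (x / 2) - x / 2 / Real.log x| ≤ x * Real.log 2 / Real.log x ^ 2 := by
    have hne : Real.log x - Real.log 2 ≠ 0 := by linarith
    have : x / 2 / Real.log (x / 2) - x / 2 / Real.log x = x / 2 * Real.log 2 / (Real.log (x / 2) * Real.log x) := by
      rw [hlogx2]; field_simp; ring
    rw [this, abs_of_nonneg (by positivity), div_le_div_iff₀ (by positivity) (by positivity)]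
    calc x / 2 * Real.log 2 * Real.log x ^ 2 = (x * Real.log 2 * Real.log x) * (Real.log x / 2) := by ring
      _ ≤ (x * Real.log 2 * Real.log x) * Real.log (x / 2) := mul_le_mul_of_nonneg_left hL2 (by positivity)
      _ = x * Real.log 2 * (Real.log (x / 2) * Real.log x) := by ring
  set I : ℝ := ∫ w in Set.Ioc (Real.log (x / 2) / Real.log x) (Real.log ((⌊x⌋₊ : ℕ) : ℝ) / Real.log x), x ^ w / w
    with hI
  set T : ℝ := x / (2 * Real.log x) with hT
  have hTP : |T - ((windowPrimes x).card : ℝ)| ≤ ε / 4 * (x / Real.log x) + (x * Real.log 2 / Real.log x ^ 2 + ε / 4 * (x / Real.log x)) := by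
    have hre : T - ((windowPrimes x).card : ℝ) = (x / Real.log x - (Nat.primeCounting ⌊x⌋₊ : ℝ))
        - (x / 2 / Real.log x - (Nat.primeCounting ⌊x / 2⌋₊ : ℝ)) := by
      rw [hcard, hT]; field_simp; ring
    rw [hre]
    refine (abs_sub _ _).trans (add_le_add ?_ ?_)
    · rw [abs_sub_comm]; exact hA
    · calc |x / 2 / Real.log x - (Nat.primeCounting ⌊x / 2⌋₊ : ℝ)|
          ≤ |x / 2 / Real.log x - x / 2 / Real.log (x / 2)| + |x / 2 / Real.log (x / 2) - (Nat.primeCounting ⌊x / 2⌋₊ : ℝ)| :=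
            abs_sub_le _ _ _
        _ ≤ x * Real.log 2 / Real.log x ^ 2 + ε / 4 * (x / Real.log x) := by
            refine add_le_add ?_ ?_
            · rw [abs_sub_comm]; exact hD
            · rw [abs_sub_comm]
              exact hB.trans (mul_le_mul_of_nonneg_left hY (by positivity))
  have hE1 : 2 * (x * Real.log 2 / Real.log x ^ 2) ≤ ε / 4 * (x / Real.log x) := by
    rw [show 2 * (x * Real.log 2 / Real.log x ^ 2) = 2 * x * Real.log 2 / Real.log x ^ 2 by ring,
      show ε / 4 * (x / Real.log x) = ε / 4 * x / Real.log x by ring,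
      div_le_div_iff₀ (by positivity) hL]
    calc 2 * x * Real.log 2 * Real.log x = (x * Real.log x) * (2 * Real.log 2) := by ring
      _ ≤ (x * Real.log x) * (ε * Real.log x / 4) :=
          mul_le_mul_of_nonneg_left (by linarith) (by positivity)
      _ = ε / 4 * x * Real.log x ^ 2 := by ring
  have hE2 : 1 / Real.log x ≤ ε / 4 * (x / Real.log x) := by
    rw [show ε / 4 * (x / Real.log x) = (ε / 4 * x) / Real.log x by ring]
    exact div_le_div_of_nonneg_right (by linarith) hL.le
  calc |I - ((windowPrimes x).card : ℝ)| ≤ |I - T| + |T - ((windowPrimes x).card : ℝ)| := abs_sub_le _ _ _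
    _ ≤ (x * Real.log 2 / Real.log x ^ 2 + 1 / Real.log x)
        + (ε / 4 * (x / Real.log x) + (x * Real.log 2 / Real.log x ^ 2 + ε / 4 * (x / Real.log x))) :=
          add_le_add hint hTP
    _ ≤ ε * x / Real.log x := by
          have : ε * x / Real.log x = 4 * (ε / 4 * (x / Real.log x)) := by ring
          rw [this]; linarith

/-- **Stub 1b-γ** (former stub; PROVED in v17). -/
theorem window_pnt : Signature.windowPNT := window_pnt_all

/-- Former stub (PROVED here; see the card). -/
theorem slice_symm : Signature.sliceSymm := sliceSymm_of_chamber chamber_symm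

/-- **Stub 1b** (former stub; PROVED in full, v16–v19). -/
theorem integral_main_term : Signature.integralMainTerm := integralMainTerm_of slice_symm window_pnt

/-- Former stub (PROVED here; see the card). -/
theorem Vsum_integral : Signature.VsumIntegral := VsumIntegral_of_injSum injSum_integral

/-- Former stub (PROVED here; see the card). -/
theorem Vsum_main_term : Signature.VsumMainTerm := VsumMainTerm_of Vsum_integral integral_main_term

/-- Former stub (PROVED here; see the card). -/
theorem slice_main_term : Signature.sliceMainTerm := sliceMainTerm_of_Vsum Vsum_main_term

/-- Former stub (PROVED here; see the card). -/
theorem sqfree_main_term : Signature.sqfreeMainTerm := sqfreeMainTerm_of_slice slice_main_term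

/-- Former stub (PROVED here; see the card). -/
theorem main_term : Signature.mainTerm := mainTerm_of_sqfree sqfree_main_term

/-- **The repaired Theorem 7.3 (a) at `P = (1/2, 0, ν)` from the five lemmas** (two of them PROVED … -/
theorem fm73aClosed_of (h1 : Signature.signLemma) (h2 : Signature.mainTerm)
    (h3 : Signature.typeITerm) (h4 : Signature.stub_typeIIRegion) (h5 : Signature.squarefullPatch) :
    ∀ ν : ℝ, 0 < ν → ν < 1 / 4 → ∀ g : VecFn, Admissible ν g →
      ∀ c : ℝ, c < sieveBoundG1 ν g → IsLowerSieveConst (1 / 2) 0 ν c := by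
  intro ν hν hν4 g hadm c hc ϖ hϖ
  set V := sieveBoundG1 ν g with hV
  set δ := V - c with hδ
  have hδ0 : 0 < δ := by rw [hδ]; linarith
  have hN : ∀ n : ℕ, 2 ≤ n → ¬ n.Prime → IsRough ν n → ¬ IsExc n → Hwt g ν n ≤ 0 := by
    intro n h2 hp hr he
    rw [Hwt_eq_sum_of_rough hadm h2 hr]
    exact h1 ν hν hν4 g hadm n h2 hp hr he
  obtain ⟨M, hM⟩ := Hwt_abs_le hν hadm.2.1
  have hP : ∀ p : ℕ, p.Prime → Hwt g ν p = 1 := fun p hp => Hwt_prime hadm hp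
  set M' := max M 0 with hM'
  have hM'0 : 0 ≤ M' := le_max_right _ _
  have hM'' : ∀ n : ℕ, 2 ≤ n → IsRough ν n → |Hwt g ν n| ≤ M' :=
    fun n h2 hr => (hM n h2 hr).trans (le_max_left _ _)
  have hmain := h2 ν hν hν4 g hadm
  obtain ⟨x₂, hcheb⟩ := chebyshev_window
  obtain ⟨x₁, hx₁⟩ := hmain (δ / 12) (by positivity)
  obtain ⟨K₃, hK₃⟩ := h3 ν hν hν4 g hadm
  obtain ⟨B₀, hB₀⟩ := h4 ν hν hν4 g hadm 2 (by norm_num) ϖ hϖ.le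
  set B := max B₀ 2 with hB
  have hB2 : (2 : ℝ) ≤ B := le_max_right _ _
  have hB0 : 0 < B := by linarith
  obtain ⟨K₄, x₄, hK₄⟩ := hB₀ B (le_max_left _ _)
  set C₁ := |K₃| + |K₄| + 2 * M' + 1 with hC₁
  have hC₁0 : 0 < C₁ := by positivity
  set C₂ := 7 * M' + 1 with hC₂
  have hC₂0 : 0 < C₂ := by positivity
  set η₁ := δ / (12 * C₁) with hη₁
  set η₂ := δ / (12 * C₂) with hη₂
  have hη₁0 : 0 < η₁ := by positivity
  have hη₂0 : 0 < η₂ := by positivity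
  obtain ⟨x₅, hx₅⟩ := eventually_small hν hη₁0
  obtain ⟨x₆, hx₆⟩ := eventually_small hν hη₂0
  refine ⟨B, max (max (max x₁ x₂) (max x₄ x₅)) x₆, hB0, ?_⟩
  intro x hx a ha hgrowth hI hII
  simp only [max_le_iff] at hx
  obtain ⟨⟨⟨hx1, hx2⟩, hx4, hx5⟩, hx6⟩ := hx
  obtain ⟨h4x, hL1, hpow5, hsq5⟩ := hx₅ x hx5
  obtain ⟨-, -, hpow6, -⟩ := hx₆ x hx6
  have hx2' : (2 : ℝ) ≤ x := by linarith
  have hx0 : 0 < x := by linarith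
  have hx1' : (1 : ℝ) ≤ x := by linarith
  have hL0 : 0 < Real.log x := by linarith
  set P : ℝ := ((windowPrimes x).card : ℝ) with hPdef
  have hP0 : 0 ≤ P := by positivity
  set X : ℝ := x / Real.log x with hX
  have hX0 : 0 ≤ X := div_nonneg hx0.le hL0.le
  set E₁ : ℝ := η₁ * X with hE₁
  set E₂ : ℝ := η₂ * X with hE₂
  have eMain : |∑ n ∈ Nset ν x, Hwt g ν n - (V - 1) * P| ≤ δ / 12 * x / Real.log x := hx₁ x hx1
  have eCheb : x / (3 * Real.log x) ≤ P := hcheb x hx2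
  have eI : |∑ n ∈ window x, (a n - 1) * Hwt g ν n| ≤ K₃ * x / Real.log x ^ B :=
    hK₃ x hx2' B (by linarith) (fun n => a n - 1) hI
  have hwlow : ∀ n : ℕ, -(x ^ (ν / 10)) ≤ a n - 1 := fun n => by
    have h1 : (1 : ℝ) ≤ x ^ (ν / 10) := Real.one_le_rpow hx1' (by positivity)
    linarith [ha n]
  have eII : |∑ n ∈ Rset ν x, (a n - 1) * Hwt g ν n| ≤ K₄ * x / Real.log x ^ (2 : ℝ) :=
    hK₄ x hx4 (fun n => a n - 1) hwlow hgrowth hI hII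
  have eSq : ∑ n ∈ Eset ν x, a n ≤ 4 * x ^ (1 - ν) + 2 * Real.sqrt x + 2 + 2 * x / Real.log x ^ B :=
    h5 ν hν hν4 x hx2' B hB0 a ha hI
  have eSieve := sieve_lower (x := x) (M := M') hP hN hM'' ha (g := g) (ν := ν)
  have hLB : x / Real.log x ^ B ≤ x / Real.log x ^ (2 : ℕ) := by
    apply div_le_div_of_nonneg_left hx0.le (by positivity)
    calc Real.log x ^ (2 : ℕ) = Real.log x ^ ((2 : ℕ) : ℝ) := (Real.rpow_natCast _ 2).symm
      _ ≤ Real.log x ^ B := Real.rpow_le_rpow_of_exponent_le hL1 (by simpa using hB2)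
  have hL2r : x / Real.log x ^ (2 : ℝ) = x / Real.log x ^ (2 : ℕ) := by
    rw [Real.rpow_two]
  have hE₁' : x / Real.log x ^ (2 : ℕ) ≤ E₁ := by
    rw [hE₁, hX, ← mul_div_assoc]; exact hsq5
  have hE₂' : x ^ (1 - ν) ≤ E₂ := by
    rw [hE₂, hX, ← mul_div_assoc]; exact hpow6
  have hsqrt : Real.sqrt x ≤ x ^ (1 - ν) := by
    rw [Real.sqrt_eq_rpow]
    exact Real.rpow_le_rpow_of_exponent_le hx1' (by linarith)
  have htwo : (2 : ℝ) ≤ x ^ (1 - ν) := by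
    have : (2 : ℝ) ≤ Real.sqrt x := by
      rw [show (2 : ℝ) = Real.sqrt 4 by
        rw [show (4 : ℝ) = 2 ^ 2 by norm_num, Real.sqrt_sq (by norm_num)]]
      exact Real.sqrt_le_sqrt h4x
    linarith
  have tW : |∑ n ∈ window x, (a n - 1) * Hwt g ν n| ≤ |K₃| * E₁ := by
    calc |∑ n ∈ window x, (a n - 1) * Hwt g ν n| ≤ K₃ * x / Real.log x ^ B := eI
      _ = K₃ * (x / Real.log x ^ B) := mul_div_assoc _ _ _
      _ ≤ |K₃| * (x / Real.log x ^ B) :=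
          mul_le_mul_of_nonneg_right (le_abs_self _) (div_nonneg hx0.le (by positivity))
      _ ≤ |K₃| * E₁ := mul_le_mul_of_nonneg_left (hLB.trans hE₁') (abs_nonneg _)
  have tR : |∑ n ∈ Rset ν x, (a n - 1) * Hwt g ν n| ≤ |K₄| * E₁ := by
    calc |∑ n ∈ Rset ν x, (a n - 1) * Hwt g ν n| ≤ K₄ * x / Real.log x ^ (2 : ℝ) := eII
      _ = K₄ * (x / Real.log x ^ (2 : ℝ)) := mul_div_assoc _ _ _
      _ ≤ |K₄| * (x / Real.log x ^ (2 : ℝ)) :=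
          mul_le_mul_of_nonneg_right (le_abs_self _) (div_nonneg hx0.le (by positivity))
      _ ≤ |K₄| * E₁ := mul_le_mul_of_nonneg_left (hL2r.le.trans hE₁') (abs_nonneg _)
  have tE : M' * ∑ n ∈ Eset ν x, a n ≤ 7 * (M' * E₂) + 2 * (M' * E₁) := by
    have hin : ∑ n ∈ Eset ν x, a n ≤ 7 * E₂ + 2 * E₁ := by
      have h2x : 2 * x / Real.log x ^ B = 2 * (x / Real.log x ^ B) := mul_div_assoc _ _ _
      rw [h2x] at eSq
      linarith [hLB.trans hE₁']
    calc M' * ∑ n ∈ Eset ν x, a n ≤ M' * (7 * E₂ + 2 * E₁) := mul_le_mul_of_nonneg_left hin hM'0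
      _ = 7 * (M' * E₂) + 2 * (M' * E₁) := by ring
  have tMain : V * P - P - δ / 12 * X ≤ ∑ n ∈ Nset ν x, Hwt g ν n := by
    have h := (abs_le.1 eMain).1
    have hre : δ / 12 * x / Real.log x = δ / 12 * X := by rw [hX]; ring
    have hVP : (V - 1) * P = V * P - P := by ring
    linarith
  have bud1 : |K₃| * E₁ + |K₄| * E₁ + 2 * (M' * E₁) ≤ δ / 12 * X := by
    have hprod : η₁ * C₁ = δ / 12 := by
      rw [hη₁]; field_simp
    calc |K₃| * E₁ + |K₄| * E₁ + 2 * (M' * E₁) = (η₁ * (|K₃| + |K₄| + 2 * M')) * X := by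
          rw [hE₁]; ring
      _ ≤ (η₁ * C₁) * X := by
          apply mul_le_mul_of_nonneg_right _ hX0
          apply mul_le_mul_of_nonneg_left _ hη₁0.le
          rw [hC₁]; linarith
      _ = δ / 12 * X := by rw [hprod]
  have bud2 : 7 * (M' * E₂) ≤ δ / 12 * X := by
    have hprod : η₂ * C₂ = δ / 12 := by
      rw [hη₂]; field_simp
    calc 7 * (M' * E₂) = (η₂ * (7 * M')) * X := by rw [hE₂]; ring
      _ ≤ (η₂ * C₂) * X := by
          apply mul_le_mul_of_nonneg_right _ hX0
          apply mul_le_mul_of_nonneg_left _ hη₂0.le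
          rw [hC₂]; linarith
      _ = δ / 12 * X := by rw [hprod]
  have hXP : δ / 4 * X ≤ 3 * δ / 4 * P := by
    have hX3 : X ≤ 3 * P := by
      have : x / (3 * Real.log x) = X / 3 := by rw [hX]; ring
      linarith [eCheb]
    calc δ / 4 * X ≤ δ / 4 * (3 * P) := mul_le_mul_of_nonneg_left hX3 (by positivity)
      _ = 3 * δ / 4 * P := by ring
  show c * P ≤ ∑ p ∈ windowPrimes x, a p
  calc c * P = (V - δ) * P := by rw [hδ]; ring
    _ ≤ (V - 3 * δ / 4) * P := mul_le_mul_of_nonneg_right (by linarith) hP0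
    _ = V * P - 3 * δ / 4 * P := by ring
    _ ≤ ∑ p ∈ windowPrimes x, a p := by
        linarith [eSieve, tW, tR, tE, tMain, bud1, bud2, hXP]

/-- **Composition (kernel-checked)**: the six leaves (four open stubs + the two proved lemmas) give the ROUTE TARGET BY NAME. -/
theorem SieveConst01651_of :
    Signature.stub_coneCertClosed → Signature.signLemma → Signature.mainTerm →
      Signature.typeITerm → Signature.stub_typeIIRegion → Signature.squarefullPatch →
      Summit.Parity.GeneralizedHardyLittlewood.Theses.FordMaynardSieveConst01651.SieveConst01651 := by
  intro h0 h1 h2 h3 h4 h5 ν hν _hν3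
  obtain ⟨g₀, hpc, h00, hsupp, hH, hV⟩ := h0
  have hadm : Admissible (1651 / 10000) (symmExt g₀) :=
    ⟨isSymmetric_symmExt g₀, isPiecewiseConstOnCone_symmExt hpc, fun e => h00 _,
      supportClosed_symmExt hsupp, starSum_nonpos_of_cone hH⟩
  have hconst : IsLowerSieveConst (1 / 2) 0 (1651 / 10000) (sieveBoundG1 (1651 / 10000) g₀ / 2) :=
    fm73aClosed_of h1 h2 h3 h4 h5 (1651 / 10000) (by norm_num) (by norm_num) (symmExt g₀) hadm _
      (by rw [sieveBoundG1_symmExt]; linarith)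
  exact ⟨_, by linarith, hconst.mono hν⟩

/-- **The skeleton instantiated** (v21): the target BY NAME modulo `stub_signClauseFive`, `stub_certValuePos`, `stub_typeIIRegion`. -/
theorem SieveConst01651_of_stubs :
    Summit.Parity.GeneralizedHardyLittlewood.Theses.FordMaynardSieveConst01651.SieveConst01651 :=
  SieveConst01651_of (coneCertClosed_of stub_signClauseFive stub_certValuePos) sign_lemma main_term typeI_term
    stub_typeIIRegion squarefull_patch

/-- **Composition over the v21 leaves** (kernel-checked): R1 → R2 → Prop 7.19 → the ROUTE TARGET BY NAME. -/
theorem SieveConst01651_of_v21 :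
    Signature.stub_signClauseFive → Signature.stub_certValuePos → Signature.stub_typeIIRegion →
      Summit.Parity.GeneralizedHardyLittlewood.Theses.FordMaynardSieveConst01651.SieveConst01651 :=
  fun h₁ h₂ h4 => SieveConst01651_of (coneCertClosed_of h₁ h₂) sign_lemma main_term typeI_term h4 squarefull_patch

end Summit.Parity.GeneralizedHardyLittlewood.Cruxes.SieveConst01651.SieveDecomposition

end
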